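import Summits.FinalStateConjecture.FinalStateConjecture.Theses.SwallowTheDatum
import Literature.NumberTheory.Sieve.GreenTao2008PseudorandomMajorantProofs
import Literature.Geometry.Lorentzian.SchwarzschildKerrSchildComponents
import Literature.Geometry.Lorentzian.ModelData
import Literature.Geometry.Lorentzian.KerrDataSchwarzschildExtrinsic
import Literature.Geometry.Lorentzian.AsymptoticFlatnessTransition
import Literature.Geometry.Lorentzian.AFEndRestrict
import Literature.Geometry.Lorentzian.ChartCalculus
import Literature.Geometry.Lorentzian.KerrSliceNormalRigidity

/-!
# Disproof of `KerrShieldedDataExist` — standing disprover's work file (cdisprove, gen 2 + gen 3 + gen 4)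

Crux `stmt-FinalStateConjecture-10055` = `Summit.FinalStateConjecture.FinalStateConjecture.Theses.SwallowTheDatum.KerrShieldedDataExist`
(route SwallowTheDatum, rank 5, anti-vacuity of the shielding predicate):
`∀ [Kerr.Facts], ∃ D ∈ admissibleVacuumData E3, ∃ M a r₁ (hM : 0 ≤ M) T φ ψ ν, |a| < M ∧ r₋ < r₁ < r₊ ∧
T = ⟨hard-coded bent height⟩ ∧ IsCompact (range φ)ᶜ ∧ IsOpenEmbedding φ ∧ C^∞ φ ∧ ψ = graph of T∘r over the
Kerr–Schild slice ∧ ψ spacelike ∧ ν future unit normal ∧ φ^*h = ψ^*g_{M,a} ∧ φ^*k = K_ν(ψ)`.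

## Findings (index; details in the numbered sections)

* **VERDICT SO FAR: RESISTS.** It is an `∃`-statement; a refutation needs UNSATISFIABILITY of
  (shielded-as-typed ∧ admissible). A symbol-by-symbol read-back (§1) finds no unsatisfiable or junk-driven
  conjunct, and three independent witness blueprints exist in print / in the crux's Ideas (§8). The one
  object the crux PINS — the immersion `ψ` (graph of the literal height, §6 `psi_eq_graph`) — is certified
  spacelike at every radius and latitude for every sub-extremal spin (§5 `conormalForm_bentSlope_neg`,
  0 sorry): the route's own "cheapest falsifier" is now a theorem, so kill criterion (a)/slice cannot fire.
* §2 `abs_lt_of_window`: the conjunct `|a| < M` is REDUNDANT given `r₋ < r₁ < r₊` and `0 ≤ M`;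
  `no_window_of_not_subextremal`: the natural strengthening to extremal/super-extremal shields is FALSE
  (empty window) — every witness is genuinely sub-extremal.
* §3 `bentHeight_eq_literal` (rfl), `bentHeight_eq_zero_of_le` (NO JUNK LEAKS: the `Real.log` of
  nonpositive arguments below `r₊ < 4M` is multiplied by an exact `0`), `hasDerivAt_bentHeight`
  (T is differentiable on all of ℝ, `deriv T = bentSlope`), `bentHeight_eq_of_ge` (beyond `8M` the slice
  is Boyer–Lindquist: `F′ = 2Mr/Δ = d(r* − r)/dr`, `hasDerivAt_blHeight`).
* §4 slope bounds: `0 ≤ T′ ≤ log((r−2M)/2M) + 2M/(r−2M)` on `[4M, ∞)` (uniform in `a`: tortoise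
  comparison `blHeight_sub_le`), window caps `17/10, 3/2, 8/5`.
* §5 `conormalForm_bentSlope_neg`: `−(r²+a²c²) + T′²(r²+a²) − 2Mr(1+T′)² < 0` for all `r > 0`, all `c`,
  all `|a| < M` (numerically `sup g⁻¹(n,n) = −1.148`, min critical-slope margin `0.795`, `max T′ = 1.078`).
* §6 plumbing the prover can import: `radius_ofTimeSpace` (the KS radius is time-independent),
  `ofTimeSpace_mem_region`, `graph`, `psi_eq_graph` (conjunct 7 pins `ψ`), `graph_eq_sliceEmbed_of_le`
  (on `r ≤ 4M` the graph IS `Kerr.sliceEmbed`, whose spacelikeness / future unit normal are PROVED in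
  the tree: `Kerr.isSpacelikeImmersion_sliceEmbed_holds`, `Kerr.isFutureUnitNormal_sliceNormal_holds`).
* §7 refuted / non-refuted mutations (load-bearing analysis of an ∃-crux = which tightenings die):
  extremal spin — dies (§2); unbent slice `T ≡ 0` with the tautological end chart — dies by the named
  fact `Kerr.not_isStronglyAsymptoticallyFlatDR_data` (KS ends have `tr k ~ 2M/r²`, not `o(r⁻²)`;
  unproved named fact, chart-specific; a chart-free version is the near-miss `unbentShield_not_admissible`,
  sorried with the obstruction); `φ = id` AND tautological end chart — dies (anisotropic `2M x̂⊗x̂/r` term,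
  §7 docstring); CK rates instead of DR — survives (BL end: `h − (1+2M/ρ)δ = O(ρ⁻²)`, `k = O(aMρ⁻³)`);
  junction below `r₋` — survives typed spacelikeness (`1 + 2H > 0` for all `r > 0`) but leaves the domain
  of dependence of any two-sheeted / collapse witness (Cauchy horizon), so no blueprint certifies it.
* §8 WHY IT RESISTS + adversarial checks of the three witness blueprints (bag of gold through the
  Einstein–Rosen throat; Li–Mei collapse glued to Kerr inside the hole; Kehle–Unger trapped-sphere gluing):
  the domain-of-dependence inequality both `a = 0` cards rely on is re-derived (`v_A = r + 4m log(1 − r/2m) < 2m`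
  on the region-II part of the slice versus `S_A + 2m log(S_A/2m − 1)` for the cap radius — any cap at
  areal radius `S_A ≥ 2.6 m` on the second sheet suffices).

LANDED (importable by provers / planners / ideators; all ACCEPTED 2026-08-15):
`Summits.FinalStateConjecture.FinalStateConjecture.Theorems.KerrShieldedDataExist.Negative.NoWindowOfNotSubextremal`
(p69690, §2 window lemmas), `….Negative.BentHeight` (p69789, §2–§3), `….Negative.BentSlopeBounds` (p69910, §4),
`….Negative.BentSliceConormal` (p70005, §5–§6 incl. `conormalForm_bentSlope_neg`, the `a = 0` sharpness and
`psi_eq_graph` / `graph_eq_sliceEmbed_of_le`). This work file keeps its own copies (namespace `…Cruxes…Disproof`)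
plus the read-back, the mutation analysis and the near-miss.

Sanity of the certified quantity (adversarial self-check): with the tree's exact `Kerr.radius` and `ℓ`
(`nullCovectorFun`), finite differences at 2000 random points (`|a| ≤ 1`, `r ≥ 0.3`) confirm
`|∇r|²_δ = (r² + a²)/Σ`, `ℓ⃗·∇r = 1`, `|ℓ⃗|_δ = 1` to `2·10⁻⁹` (`num/gradcheck.py`) — the two identities that turn
`g⁻¹(n,n)` into `conormalForm/Σ`; two earlier refuters' independent numerics (KS Cartesian with the quartic
radius; ingoing Kerr `(v,r,θ,φ̃)` form) give the same `sup = −1.148`.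

## Gen 3 findings (refuter-cdisprove-stmt-FinalStateConjecture-10055-g3-0, 2026-08-16) — VERDICT: STILL RESISTS

* §9 (NEW, 0 sorry; kept in this work file only — its landable twin p75144 was bounced by a gate restart and is WITHDRAWN as superseded by §9b, which lands the full clause through the tree's `radiusGradVec`/`coSharp` calculus instead of re-deriving it): the scalar certificate is
  tied to the tree's OWN bilinear form `Kerr.bilin M a x = η + 2Hℓ⊗ℓ` with no inverse metric: the closed-form vector
  `N = (−1 − 2H(1+t), −t d⃗ + 2H(1+t) ℓ⃗)` satisfies `g(N, w) = w⁰ − t d⃗·w⃗` for all `w` (so `g(N, lift v) = 0` on every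
  lifted tangent vector `(t d⃗·v, v)` of the graph), `(r⁴ + a²z²) g(N,N) = r² · conormalForm M a r (z/r) t`, and
  `g(V, N) = 1 + 2H(1+t) > 0` for the orienting field `V = Kerr.timeVector` — hence `ν = −N/√(−g(N,N))` is the FUTURE unit
  normal; the two identities `ℓ⃗·d⃗ = 1`, `|d⃗|² = r²(r²+a²)/(r⁴+a²z²)` for the implicit-differentiation gradient candidate
  `dᵢ = r(xᵢr² + a²zδᵢ₃)/(r⁴ + a²z²)` and `|ℓ⃗|² = 1` are PROVED from `Kerr.radius_quartic` alone. Left to the slice-clause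
  prover: `d⃗ = ∇(Kerr.radius a ∘ ofTimeSpace 0)` (calculus) and the `mfderiv` of `graph`. Conjuncts 8–9 of the crux
  (spacelike + future unit normal) therefore cannot fail for ANY sub-extremal `(M, a)` and ANY junction radius.
* §9b (NEW, LANDED: p75771 ACCEPTED @ d237348adbc6, `Theorems/KerrShieldedDataExist/Negative/SliceClause.lean`, 0 sorry): **CONJUNCTS 8–9 OF THE CRUX ARE NOW THEOREMS** for the
  pinned `ψ = graph M a r₁`, EVERY `|a| < M` and EVERY `r₁`: `isSpacelikeImmersion_graph :
  (Kerr.smoothMetric M a r₁).IsSpacelikeImmersion 𝓘(ℝ,E3) (graph M a r₁)` and `isFutureUnitNormal_graphNormal` (future unit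
  normal `ν = N/√(−g(N,N))`, `N = −g♯(dt* − dh)` via `Kerr.coSharp`), packaged as `sliceClause_graph` and
  `sliceClause_graph_zero_spin` — the latter IS `PlugTheSecondSheet.stub_sliceClause` (its `0 < r₁` hypothesis is unnecessary).
  Method: `graph M a r₁ = Kerr.leafEmbed a r₁ (bentHeight M a ∘ r) 0` and the tree's hyperboloidal-leaf calculus
  (`KerrHyperboloidalLeaves.lean`: `hasFDerivAt_radius_slice`, `leafConormal_coSharp_of_radial`,
  `leafConormal_timeVector_of_radial`, `hasMFDerivAt_leafEmbed`, `contMDiff_leafEmbed`), generalised from `r₊` to any inner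
  radius; negativity from `conormalForm_bentSlope_neg` at latitude `0` plus `r² ≤ Σ`; `bentHeight` is `C^∞` on `ℝ`
  (`contDiffAt_bentHeight`). So the planner's kill criterion (a)/slice is dead at the level of the typed predicate, not only
  of a scalar; what remains of the crux is conjuncts 1, 6, 10–11 (an admissible vacuum datum that IS the bent slice off a
  compact set) — pure interior-gluing content.
* MODEL VALIDATION (kit job j009651, `num/ricci_check.py`; local float64 pre-run): the tree's Kerr–Schild transcription
  (`Kerr.radius/scalarH/nullCovectorFun/bilin/timeVector`, Visser (32)–(35)) is Ricci-flat at 72 sample points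
  (`a/M ∈ {0, .5, .9, .99}`, exterior, between the horizons, near axis and equator): float64 residual `1.9·10⁻⁴` against a
  non-vacuum control `1.5·10⁻²…9·10⁻²`, `det g = −1`, `g(V,V) = −1 − 2H`; the 50-digit farm run sharpens this (see the job
  evidence on the item). So witnesses with `a ≠ 0` (the route's Li–Mei blueprint has `|a| ≤ Cδ^{1/2}`, possibly nonzero)
  are not killed by a transcription defect of the model, and `Kerr.isRicciFlat` (named fact used by `stub_harvest`) is
  numerically sound.
* §7 UPGRADE (NEW, LANDED: p76510 ACCEPTED @ 463b36317c39, `Theorems/KerrShieldedDataExist/Negative/UnbentEndNotDR.lean`, 0 sorry): the named fact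
  `Kerr.not_isStronglyAsymptoticallyFlatDR_data` behind the refuted mutation "unbent slice + tautological end chart" is now
  PROVED for all `M a r₀` (for `M > 0` and EVERY template mass `M'`): already the order-zero metric rate fails — with
  `B = h − (1 + 2M'/‖x‖)δ` in the chart of `Kerr.afEnd`, `3B(ℓ⃗,ℓ⃗) − Σᵢ B(eᵢ,eᵢ) = 4H` (mass-independent), so
  `‖B‖ ≥ (2/3)H ≥ (4/15)M/‖x‖`, not `o(‖x‖⁻¹)`; no `k`, no derivative needed. The chart-FREE version
  (`unbentShield_not_admissible`, §7) stays a near-miss (Bartnik's uniqueness of the structure at infinity is not in the tree).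
* §10 PRE-TRIAGE OF THE TWO LINE SKELETONS (8 stubs; no cheap kill — details and the checks run in the §10 docblock):
  `plug-the-second-sheet`: `stub_ttShellCap` ✓ (β(A) ~ A^{1/4} → ∞ makes `ρ₂ < 3M₀/8` reachable; `|D|⁶P_TT` is a genuine
  differential operator so σ is exactly TT and shell-supported; positivity of `u` on the annulus is forced by the `n = 0`
  closeness clause, so no `iteratedFDeriv` junk), `stub_massGluing` ✓ (quantifier order `∀Ω ∃ε` is the right one;
  cokernel `span{N}`, and the compensating map `M ↦ G(M)` has nonzero derivative = the CONSERVED `N`-weighted linearised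
  mass flux `16π`, nonzero although `N < 0` on sheet 2; positivity/Liouville force `u = b + c/ρ + O(ρ⁻²)` on `{ρ > ρ₁}`),
  `stub_sliceClause` ✓ (= §5 + §9 + calculus), `stub_harvest` ✓ (β-boosted junction keeps `U < X_E`; KS slice piece has
  `U ≤ U_j` since `(1 − r/2M)e^{r/4M}` decreases), `stub_isotropicEnd` ✓ (`(1+M/2r)⁴ − 1 − 2M/r = 3M²/2r² + M³/2r³ + M⁴/16r⁴`).
  `null-glue-to-a-trapped-sphere`: `stub_roughShieldOfNullGluing` = K–U Cor. 2 (arXiv:2304.08455 p.4: data in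
  `H^{7/2−} × H^{5/2−}`, glue radius `R = 2M − ε`, metric `C²` off the Cauchy-stability region, p.18; Cor. 2 only
  SKETCHED, p.19) — plausible, unlandable; `stub_roughCollarRegluing` — NOTE its conclusion never mentions `(g, κ)`, so it
  asserts smooth KS-shields for EVERY junction `r₃ ∈ (0, 2M)` outright (stronger than the crux needs; true via PlugData +
  harvest if the plug exists, or Li–Mei + scaling only for `r₃/m` in Li–Mei's realisable range); `stub_bentLeafPatching` ✓.
* LI–MEI WITNESS, domain-of-dependence step made precise (read arXiv:2005.01249 §1.3, §2.2, §4 this session): the gluing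
  hypersurface is the CYLINDER `H = {r = r₀}`, `r₀ ∈ (r₋, r₊)` (Prop. 4.1: `r₀ ∈ (0, 2m₀)`), spacelike inside the hole;
  `Σ⁺_I` continues `H` from its late end out to `i⁰` with exactly Kerrian data. In `K₀ = Kerr ∩ {r > r₀}` (causally
  convex in `{r > r₋}`, simply connected) `Σ⁺_I` is properly embedded, hence separates `K₀ = P ⊔ F`; every past-inextendible
  causal curve from a point of `F` has `r` non-decreasing in region II / `> r₊` in region I and `t* → −∞`, so it crosses
  `Σ⁺_I`: `D⁺(Σ⁺_I) ⊇ F`. The typed slice, time-translated by `c₀ ≥ max(t*_b, max_{[r₁,R]} t*_{Σ⁺_I})`, lies in `F` near the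
  junction and, far out, in `D(Σ⁺_I)` because `t* + r` is non-decreasing along future causal curves (arrival at the cylinder
  later than `t*_b`). So ANY junction `r₁ ∈ (r₀, r₊)` is served, for the `(m, a)` Li–Mei produce (`|a| ≤ Cδ^{1/2}`), with
  smooth data (Thm 2.2 is `C^k`-close for every `k`, smooth output). The route's intended witness stands.
* BAG-OF-GOLD CAP, orientation analysis (for the `a = 0` lines): the cap `K` must be a compact scalar-flat 3-BALL whose
  collar is an exact Schwarzschild(`m'`) annulus with areal radius INCREASING into `K` (mean-concave from outside), hence
  `K` contains a large minimal sphere and cores of AF manifolds have the WRONG orientation; the right model is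
  `K = (S³ ∖ B_ε(p), u⁴g₀)` read inside-out with `u = c(1/|x| + A)`, `A` = blow-up (Green's function) mass of a Yamabe-positive
  `(S³, g₀)` flat near `p`: exactness of the collar FORCES `u = c·G_p` (removable singularity + invertibility of `L_{g₀}`),
  i.e. `m' = 2A` in blow-up units and no `l ≥ 1` harmonics in the regular part of `G_p` — which fails generically and, under
  `SO(3)`-symmetry about `p`, forces conformal roundness (`A = 0`). So an exact cap needs a genuine (inside-out Corvino /
  Chruściel–Delay) correction with the 4-parameter family `(m', c)`; near-criticality (`A → ∞`, Beig–Ó Murchadha) gives the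
  room `εA ≫ 1`. This is consistent with both `a = 0` cards; it is recorded because a cap built as "core of an AF manifold"
  or "flat ball" is IMPOSSIBLE (developing-map / orientation argument in §10), a trap for the plug engine.
* §10 also lands the two real inequalities behind §8(a) (gen 2 had them in prose): `advancedTime_lt`
  (`r + 4m log(1 − r/2m) < −r` on `0 < r < 2m`) and `capThreshold_pos` (`S + 2m log(S/2m − 1) > 0` for `S ≥ 3m`).
* Barriers / negatives re-checked: `Literature/Barriers/FinalStateConjecture/*` all dynamical (no bearing on the EXISTENCE
  of one datum); `ledger negatives --problem FinalStateConjecture` unreadable this session (gate down at check time; gen 2: 0).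

## Gen 4 findings (refuter-cdisprove-stmt-FinalStateConjecture-10055-g4-0, 2026-08-16T03:40Z) — VERDICT: STILL RESISTS

* Re-checked against the current tree: crux probe rc0, this file rc0 (1 declared near-miss sorry). Targets synced (§12):
  `stub_sliceClause`, `stub_isotropicEnd` CLOSED in `Theorems/`, `stub_ricciFlatKS` = `Schwarzschild.ricci_smoothMetric_zero_spin`
  (tree); open: `stub_plugData` (XL), `stub_inducedVacuumData` (L), `stub_harvest` (XL); 0 stub-false (concurring with
  drefute r1/r2).
* §12.1 (NEW, 0 sorry): the chart-R → chart-L transition of the harvest, `Θ(t*, x⃗) = (−t* + 4M log|1 − r/2M|, x⃗)`, at the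
  level of the tree's 4-dimensional `Kerr.bilin M 0`: its differential `kruskalFlip M x` is an involution and an ISOMETRY
  (`bilin_kruskalFlip`, `r ∉ {0, 2M}`), and `g(V, Θ_*V) = (r² + 4M²)/(r(r − 2M))` for `V = Kerr.timeVector`
  (`bilin_timeVector_kruskalFlip`): `< 0` on `0 < r < 2M` (orientations agree on region II, `_neg`), `> 0` on `r > 2M`
  (`_pos`: used outside the horizon the formula reverses time orientation — the overlap must stay inside).
* §12.2 (NEW): `conformalFactor_smul` — the plug depth `ρ₃/M` is scale-invariant; "every depth by scaling" in the
  `stub_plugData` docstring is wrong (harmless for truth: depth comes from the engine's shell size `β > 40` / the gluing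
  annulus, not from a homothety).
* §13.4 (NEW, 0 sorry, axioms standard): **THE CHART-FREE UNBENT-SHIELD LEMMA IS PROVED FOR `a = 0`** —
  `ChartFree.unbentShield_not_admissible_zero_spin`: no `D ∈ admissibleVacuumData E3` carries through a smooth open embedding
  `φ` (compact complement of range) the unbent Schwarzschild slice data `((Kerr.data M 0 r₁).h, (Kerr.data M 0 r₁).k)`, WHATEVER
  the end chart — so bending is load-bearing absolutely, not only in the tautological chart (UnbentEndNotDR). Proof: local
  diffeomorphism from `φ^*h ≥ δ` + differentiable inverse, far region ⊂ range φ, curve of speed ≤ √2 along a DR ray, and the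
  two readings of the invariant ratio `k(v,v)/h(v,v)` (Lemma A′ ≥ `M/(r²√(1+2M/r))` vs Lemma B ≤ `(M/8)/t²`). PLUS the
  crux-shaped corollary `ChartFree.not_unbentShieldedDataExist_zero_spin`: the BODY OF THE CRUX WITH `T := 0`, `a := 0` (pinned
  immersion `y ↦ (0,y)`, future unit normal, both pull-back identities) HAS NO WITNESS (`Kerr.eq_sliceNormalRep` forces
  `ν = Kerr.sliceNormal`). Landable twins (≤ 400 lines each): `Negative/UnbentShieldChartFreeLemmas.lean` (Part I) and
  `Negative/UnbentShieldChartFree.lean` (Part II), proposals pending the (overloaded) gate.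
* §13 (NEW, prose with the computations): (1) no closed-form plug — radial-`|σ|²` TT shortcut impossible (only the
  singular `r⁻³` family is spherically symmetric TT), every SO(3)-symmetric cap is conformally flat and flattened by
  Birkhoff, so the Corvino step is unavoidable; (2) RPI / Penrose / Geroch-IMCF-into-the-bag / Shi–Tam give equality or
  nothing — no global obstruction; (3) the chart-free unbent-shield near-miss is carried by `k` alone: in the areal-shift
  chart `x = (1 + M/|z|)z` the unbent slice METRIC is DR at order zero — THEOREMS `hRep_arealShift` (exact defect) and
  `abs_hRep_arealShift_sub_le` (`≤ 3M²/s² ‖v‖‖w‖`, 0 sorry, §13.3) — so only `k` obstructs: `kRep_self_div_ge`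
  (`k_y(y,y)/h_y(y,y) ≥ M/(2r²)` for `r ≥ 2M`, chart-independent ratio; tree closed form `Kerr.kRep` = `(Kerr.data M 0 r₀).k` by
  `Kerr.data_k_zero_apply`) plus the tree's new transition-rigidity files can close it (ingredient list in §13.3); PARTIAL
  RESULT `unbentShield_radial_ratio` (0 sorry): in ANY datum `D` carrying the unbent shield through `φ` (the near-miss hypotheses,
  `a = 0`), `(φ^*D.k)(y,y)/(φ^*D.h)(y,y) ≥ M/(2‖y‖²)` for `‖y‖ ≥ 2M`, and `eventually_abs_kCoeff_le` (0 sorry): in ANY DR chart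
  the same ratio is `≤ ε‖x‖⁻²` far out — only the comparison of the two radii along the shield is missing (volume growth:
  `vol_h(φ{2M≤‖y‖≤R}) ≥ (4π/3)(R³−8M³)` versus `≤ C₀ + 2^{3/2}(4π/3)ρ(R)³` in the DR chart forces `ρ(R) ≥ cR`);
  (4) literature: search-degraded (searchd rc 75 all session), nothing known in print either way for exactness THROUGH
  the throat.

History: gen-0 (refuter-cdisprove-…-10055-0, 2026-08-15T22:42Z) proved an equivalent certificate (its
file, 55 decls, was attached as item evidence only and is not readable from compute-free boxes; this file
is a from-scratch reconstruction and is PUBLISHED to the crux directory so that it survives).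
-/

set_option linter.dupNamespace false

noncomputable section

open Real Set Filter Topology
open scoped Manifold ContDiff InnerProductSpace
open Literature.Geometry.Lorentzian
open Literature.NumberTheory.Sieve.GreenTao2008 (deriv_smoothTransition_nonneg deriv_smoothTransition_le_two)
open Literature.Analysis.Calculus (differentiable_smoothTransition deriv_smoothTransition_of_nonpos
  deriv_smoothTransition_of_one_le)

namespace Summit.FinalStateConjecture.FinalStateConjecture.Cruxes.KerrShieldedDataExist.Disproof

/-! ## §1 Read-back of the typed statement (symbol by symbol) — verdict per conjunct

* `∀ [Kerr.Facts]` — a `Prop` class, INHABITED (`Kerr.isConnected_region_holds`,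
  `Kerr.contMDiff_bilin_holds`, `Kerr.contMDiff_timeVector_holds`; instance search does not find it, the
  prover builds `⟨…⟩`). Neither vacuous nor blocking.
* `D ∈ admissibleVacuumData E3` — `(∀ [D.metric.HasLeviCivita], vacuum constraints ∧ geodesically complete)
  ∧ ∃ (e : AFEnd E3) (M' : ℝ), e.IsSoleEnd ∧ e.IsStronglyAsymptoticallyFlatDR D M'`. `HasLeviCivita` is a
  provable `Fact` (`PseudoRiemannianMetric.hasLeviCivita`), so the first clause is NOT vacuous; the end chart
  `e` and the mass `M'` are EXISTENTIAL and independent of `φ`, so the Kerr–Schild-chart negative fact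
  `Kerr.not_isStronglyAsymptoticallyFlatDR_data` does not bite: the prover reads the Boyer–Lindquist end in
  a radially shifted (quasi-isotropic) chart, where `h − (1 + 2M/ρ)δ = O₂(ρ⁻²)`, `k = O₁(aMρ⁻³)`.
* `∃ M a r₁ (hM : 0 ≤ M)`, `|a| < M`, `rMinus M a < r₁ < rPlus M a` — `|a| < M` forces `0 < M`; it is in
  fact implied by the window (§2). `rPlus/rMinus = M ± √(M² − a²)` (junk `√ = 0` only for `|a| > M`).
* `T = fun r ↦ smoothTransition (r/(4M) − 1) * (C (r₊ log(r−r₊) − r₋ log(r−r₋)) − C (… at 4M))`,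
  `C = M/√(M²−a²)` — `Real.log` of a nonpositive argument occurs only for `r ≤ r₊ < 4M`, where the cutoff
  factor is EXACTLY `0` (§3 `bentHeight_eq_zero_of_le`); `√(M²−a²) > 0`; `4M − r± > 0`. `T ∈ C^∞(ℝ)`
  (locally `0` below `4M`, product of smooth functions above `r₊`; §3 proves `HasDerivAt` everywhere).
* `IsCompact (range φ)ᶜ ∧ IsOpenEmbedding φ ∧ ContMDiff 𝓘(ℝ,E3) (𝓡 3) ∞ φ` (`((⊤ : ℕ∞) : WithTop ℕ∞) = ∞`,
  smooth not analytic; `𝓘(ℝ, E3) = 𝓡 3` definitionally) — satisfiable by the inclusion of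
  `Kerr.slice a r₁ = {max r₁ 0 < r}` (complement = closed confocal ellipsoid, compact). The pull-back
  identity with a spacelike `ψ` forces `dφ` injective, so `φ` is a diffeomorphism onto an open set; an
  end-swapping `φ` (inner end to infinity) is excluded by completeness + the decay of the sole end.
* `∀ y, (ψ y : E4) = ofTimeSpace (T (radius a (ofTimeSpace 0 y))) y` — PINS `ψ` (§6 `psi_eq_graph`);
  `radius` is time-independent (§6), so `ψ y ∈ region a r₁` automatically.
* `(smoothMetric M a r₁).IsSpacelikeImmersion 𝓘(ℝ,E3) ψ` — `ContMDiff … (∞ + 1) ψ ∧ ψ^*g > 0`;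
  `∞ + 1 = ∞` in `WithTop ℕ∞` (checked by `rfl`). Positivity ⇔ the graph conormal is timelike ⇔ §5.
* `IsFutureUnitNormal … ((Kerr.timeOrientation M a r₁ hM).ofLE le_top) ψ ν` — `ν` exists and is unique
  once the graph is spacelike; FUTURE w.r.t. `V = −g♯dt*` because `g⁻¹(n, dt*) = −1 − 2H(1 + T′) < 0`
  (`T′ ≥ 0`, §4 `bentSlope_nonneg`).
* `∀ y, pullbackBilin φ D.h.inner y = pullbackBilin ψ g.val y` and
  `∀ [g.HasLeviCivita] y, (pullbackBilin φ D.k y).toLinearMap₁₂ = secondFundamentalForm 𝓘(ℝ,E3) ψ ν y` —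
  `HasLeviCivita` is a `Prop`, so the instance binder is harmless (proof-irrelevant; inhabited by
  `Kerr.hasLeviCivita_smoothMetric` under `[Kerr.SliceFacts]` or `hasLeviCivita`); `secondFundamentalForm`
  and `pullbackBilin` have junk value `0` only at non-differentiable points (none here). The vacuum
  constraints are insensitive to the sign convention of `k`, so a time-reversed embedding of the Kerr
  region into a witness spacetime is repaired by `k ↦ −k` globally.
* Universe/instances: `E3 : Type`, `ChartedSpace E3 E3` = self chart, `IsManifold (𝓡 3) ∞ E3` — fine.

Nothing mis-typed; nothing vacuous; nothing trivially true (the `∃ D` needs a genuine non-spherical vacuum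
core: `(range φ)ᶜ ≠ ∅` since `E3` is not `S² × ℝ`, and a spherically symmetric vacuum core with regular
centre is flat by Birkhoff, contradicting `M > 0`).
-/

/-! ## §2 Parameter algebra of the junction window -/

section Params

variable {M a : ℝ}

/-- `|a| < M` gives `0 < M`. [folklore] -/
theorem mass_pos (h : |a| < M) : 0 < M := (abs_nonneg a).trans_lt h

/-- `|a| < M` gives `0 < M² − a²`. [folklore] -/
theorem sq_sub_sq_pos (h : |a| < M) : 0 < M ^ 2 - a ^ 2 := by
  have ha : a ^ 2 < M ^ 2 := sq_lt_sq' (abs_lt.1 h).1 (abs_lt.1 h).2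
  linarith

/-- `s = √(M² − a²) > 0` for sub-extremal parameters. [folklore] -/
theorem sqrt_pos' (h : |a| < M) : 0 < Real.sqrt (M ^ 2 - a ^ 2) :=
  Real.sqrt_pos.2 (sq_sub_sq_pos h)

/-- `s² = M² − a²`. [folklore] -/
theorem sq_sqrt' (h : |a| < M) : Real.sqrt (M ^ 2 - a ^ 2) ^ 2 = M ^ 2 - a ^ 2 :=
  Real.sq_sqrt (sq_sub_sq_pos h).le

/-- `√(M² − a²) ≤ M`. [folklore] -/
theorem sqrt_le_mass (h : |a| < M) : Real.sqrt (M ^ 2 - a ^ 2) ≤ M := by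
  have h1 : Real.sqrt (M ^ 2 - a ^ 2) ≤ Real.sqrt (M ^ 2) :=
    Real.sqrt_le_sqrt (by nlinarith [sq_nonneg a])
  rwa [Real.sqrt_sq (mass_pos h).le] at h1

/-- `r₊ + r₋ = 2M`. [folklore] -/
theorem rPlus_add_rMinus (M a : ℝ) : Kerr.rPlus M a + Kerr.rMinus M a = 2 * M := by
  unfold Kerr.rPlus Kerr.rMinus; ring

/-- `r₊ − r₋ = 2√(M² − a²)`. [folklore] -/
theorem rPlus_sub_rMinus (M a : ℝ) :
    Kerr.rPlus M a - Kerr.rMinus M a = 2 * Real.sqrt (M ^ 2 - a ^ 2) := by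
  unfold Kerr.rPlus Kerr.rMinus; ring

/-- `r₊ r₋ = a²` (sub-extremal). [folklore] -/
theorem rPlus_mul_rMinus (h : |a| < M) : Kerr.rPlus M a * Kerr.rMinus M a = a ^ 2 := by
  unfold Kerr.rPlus Kerr.rMinus
  nlinarith [sq_sqrt' h]

/-- `Δ(r) = r² − 2Mr + a² = (r − r₊)(r − r₋)` (sub-extremal). [folklore] -/
theorem delta_factor (h : |a| < M) (r : ℝ) :
    r ^ 2 - 2 * M * r + a ^ 2 = (r - Kerr.rPlus M a) * (r - Kerr.rMinus M a) := by
  have h1 := rPlus_add_rMinus M a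
  have h2 := rPlus_mul_rMinus h
  linear_combination -h2 + r * h1

/-- `r₊ ≤ 2M` (`√(M²−a²) ≤ M`). [folklore] -/
theorem rPlus_le_two_mul (h : |a| < M) : Kerr.rPlus M a ≤ 2 * M := by
  unfold Kerr.rPlus; linarith [sqrt_le_mass h]

/-- `r₊ < 4M`: the junk zone of `Real.log (r − r±)` lies strictly below the transition. [folklore] -/
theorem rPlus_lt_four_mul (h : |a| < M) : Kerr.rPlus M a < 4 * M := by
  linarith [rPlus_le_two_mul h, mass_pos h]

/-- `0 ≤ r₋` (sub-extremal). [folklore] -/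
theorem rMinus_nonneg (h : |a| < M) : 0 ≤ Kerr.rMinus M a :=
  Kerr.IsSubextremal.rMinus_nonneg h

/-- `r₋ < r₊` (sub-extremal). [folklore] -/
theorem rMinus_lt_rPlus (h : |a| < M) : Kerr.rMinus M a < Kerr.rPlus M a :=
  Kerr.IsSubextremal.rMinus_lt_rPlus h

/-- **The `|a| < M` conjunct of the crux is redundant**: a nonempty junction window
`r₋ < r₁ < r₊` together with `0 ≤ M` already forces sub-extremality (for `M ≤ |a|` the square
root `√(M² − a²)` is the junk value `0`, so the window is empty). Information for the prover: the
conjunct costs nothing extra. [folklore] -/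
theorem abs_lt_of_window (hM : 0 ≤ M) {r₁ : ℝ} (h₁ : Kerr.rMinus M a < r₁)
    (h₂ : r₁ < Kerr.rPlus M a) : |a| < M := by
  have hlt : Kerr.rMinus M a < Kerr.rPlus M a := h₁.trans h₂
  unfold Kerr.rMinus Kerr.rPlus at hlt
  have hs : 0 < Real.sqrt (M ^ 2 - a ^ 2) := by linarith
  have hpos : 0 < M ^ 2 - a ^ 2 := Real.sqrt_pos.1 hs
  have h2 : a ^ 2 < M ^ 2 := by linarith
  exact abs_lt_of_sq_lt_sq h2 hM

/-- **Refuted strengthening (extremal / super-extremal shields).** No junction radius exists once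
`M ≤ |a|`: the typed window `(r₋, r₊)` is empty. So every witness of the crux is genuinely
sub-extremal; an "extremal Kerr shield" variant of the crux is false for this trivial reason.
[folklore] -/
theorem no_window_of_not_subextremal (hM : 0 ≤ M) (ha : M ≤ |a|) (r₁ : ℝ) :
    ¬ (Kerr.rMinus M a < r₁ ∧ r₁ < Kerr.rPlus M a) := fun h =>
  absurd (abs_lt_of_window hM h.1 h.2) (not_lt.2 ha)


/-- `Δ(r) > 0` for `r > r₊`. [folklore] -/
theorem delta_pos (h : |a| < M) {r : ℝ} (hr : Kerr.rPlus M a < r) :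
    0 < r ^ 2 - 2 * M * r + a ^ 2 := by
  rw [delta_factor h]
  exact mul_pos (sub_pos.2 hr) (sub_pos.2 ((rMinus_lt_rPlus h).trans hr))

/-- `Δ(r) ≥ r(r − 2M)`. [folklore] -/
theorem delta_ge (M a r : ℝ) : r * (r - 2 * M) ≤ r ^ 2 - 2 * M * r + a ^ 2 := by
  nlinarith [sq_nonneg a]

end Params

/-! ## §3 The hard-coded height `T_{M,a}` and its slope -/

section Height

variable {M a : ℝ}

/-- The Boyer–Lindquist height `F(r) = (M/√(M²−a²)) (r₊ log(r − r₊) − r₋ log(r − r₋))`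
(`= r* − r` up to an additive constant on `r > r₊`). [cite: arXiv08110354, §5.1] -/
def blHeight (M a : ℝ) (r : ℝ) : ℝ :=
  M / Real.sqrt (M ^ 2 - a ^ 2) *
    (Kerr.rPlus M a * Real.log (r - Kerr.rPlus M a) - Kerr.rMinus M a * Real.log (r - Kerr.rMinus M a))

/-- The crux's hard-coded bent height, LITERALLY: `T(r) = χ(r/4M − 1) · (F(r) − F(4M))` with
`χ = Real.smoothTransition`. [cite: arXiv08110354, §5.1] -/
def bentHeight (M a : ℝ) (r : ℝ) : ℝ :=
  Real.smoothTransition (r / (4 * M) - 1) * (blHeight M a r - blHeight M a (4 * M))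

/-- `bentHeight M a` is, by `rfl`, the lambda hard-coded in the crux (`T = fun r ↦ …`). [folklore] -/
theorem bentHeight_eq_literal (M a : ℝ) :
    bentHeight M a = (fun r : ℝ => Real.smoothTransition (r / (4 * M) - 1) * (((M) / Real.sqrt ((M) ^ 2 - (a) ^ 2)) * (Literature.Geometry.Lorentzian.Kerr.rPlus M a * Real.log (r - Literature.Geometry.Lorentzian.Kerr.rPlus M a) - Literature.Geometry.Lorentzian.Kerr.rMinus M a * Real.log (r - Literature.Geometry.Lorentzian.Kerr.rMinus M a)) - ((M) / Real.sqrt ((M) ^ 2 - (a) ^ 2)) * (Literature.Geometry.Lorentzian.Kerr.rPlus M a * Real.log ((4 * M) - Literature.Geometry.Lorentzian.Kerr.rPlus M a) - Literature.Geometry.Lorentzian.Kerr.rMinus M a * Real.log ((4 * M) - Literature.Geometry.Lorentzian.Kerr.rMinus M a)))) :=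
  rfl

/-- Below the transition the cutoff argument is nonpositive: `r ≤ 4M ⇒ r/(4M) − 1 ≤ 0` (`M > 0`).
[folklore] -/
theorem arg_nonpos (hM : 0 < M) {r : ℝ} (hr : r ≤ 4 * M) : r / (4 * M) - 1 ≤ 0 := by
  rw [sub_nonpos, div_le_one (by linarith)]; exact hr

/-- Above the transition the cutoff argument is at least one: `8M ≤ r ⇒ 1 ≤ r/(4M) − 1`. [folklore] -/
theorem one_le_arg (hM : 0 < M) {r : ℝ} (hr : 8 * M ≤ r) : 1 ≤ r / (4 * M) - 1 := by
  rw [le_sub_iff_add_le, le_div_iff₀ (by linarith)]; linarith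

/-- **No junk leaks:** `T ≡ 0` on `r ≤ 4M` (so the undefined `Real.log` of nonpositive arguments at
`r ≤ r₊ < 4M` is multiplied by an exact `0`). [folklore] -/
theorem bentHeight_eq_zero_of_le (hM : 0 < M) {r : ℝ} (hr : r ≤ 4 * M) : bentHeight M a r = 0 := by
  simp [bentHeight, Real.smoothTransition.zero_of_nonpos (arg_nonpos hM hr)]

/-- Beyond `8M` the slice is the Boyer–Lindquist slice: `T = F − F(4M)`. [folklore] -/
theorem bentHeight_eq_of_ge (hM : 0 < M) {r : ℝ} (hr : 8 * M ≤ r) :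
    bentHeight M a r = blHeight M a r - blHeight M a (4 * M) := by
  simp [bentHeight, Real.smoothTransition.one_of_one_le (one_le_arg hM hr)]

/-- `F′(r) = 2Mr/Δ` for `r > r₊` (so `t* = T(r) + const` is `t_BL = const` beyond `8M`).
[cite: arXiv08110354, §5.1] -/
theorem hasDerivAt_blHeight (h : |a| < M) {r : ℝ} (hr : Kerr.rPlus M a < r) :
    HasDerivAt (blHeight M a) (2 * M * r / (r ^ 2 - 2 * M * r + a ^ 2)) r := by
  have hrp : r - Kerr.rPlus M a ≠ 0 := (sub_pos.2 hr).ne'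
  have hrm' : Kerr.rMinus M a < r := (rMinus_lt_rPlus h).trans hr
  have hrm : r - Kerr.rMinus M a ≠ 0 := (sub_pos.2 hrm').ne'
  have h1 : HasDerivAt (fun y => Real.log (y - Kerr.rPlus M a)) (1 / (r - Kerr.rPlus M a)) r := by
    have := ((hasDerivAt_id' r).sub_const (Kerr.rPlus M a)).log hrp
    simpa using this
  have h2 : HasDerivAt (fun y => Real.log (y - Kerr.rMinus M a)) (1 / (r - Kerr.rMinus M a)) r := by
    have := ((hasDerivAt_id' r).sub_const (Kerr.rMinus M a)).log hrm
    simpa using this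
  have hs := sqrt_pos' h
  have hs' : Real.sqrt (M ^ 2 - a ^ 2) ≠ 0 := hs.ne'
  have h3 : HasDerivAt (blHeight M a)
      (M / Real.sqrt (M ^ 2 - a ^ 2) *
        (Kerr.rPlus M a * (1 / (r - Kerr.rPlus M a)) -
          Kerr.rMinus M a * (1 / (r - Kerr.rMinus M a)))) r := by
    unfold blHeight
    exact ((h1.const_mul _).sub (h2.const_mul _)).const_mul _
  refine h3.congr_deriv ?_
  rw [delta_factor h]
  simp only [Kerr.rPlus, Kerr.rMinus] at hrp hrm ⊢
  field_simp
  ring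

/-- The slope of the bent height: `T′(r) = χ′(r/4M − 1)/(4M) · (F(r) − F(4M)) + χ(r/4M − 1) · 2Mr/Δ`
(a total real function; both cutoff factors vanish identically for `r ≤ 4M`). [folklore] -/
def bentSlope (M a : ℝ) (r : ℝ) : ℝ :=
  deriv Real.smoothTransition (r / (4 * M) - 1) / (4 * M) * (blHeight M a r - blHeight M a (4 * M)) +
    Real.smoothTransition (r / (4 * M) - 1) * (2 * M * r / (r ^ 2 - 2 * M * r + a ^ 2))

/-- `T′ ≡ 0` on `r ≤ 4M`. [folklore] -/
theorem bentSlope_eq_zero_of_le (hM : 0 < M) {r : ℝ} (hr : r ≤ 4 * M) : bentSlope M a r = 0 := by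
  simp [bentSlope, Real.smoothTransition.zero_of_nonpos (arg_nonpos hM hr),
    deriv_smoothTransition_of_nonpos (arg_nonpos hM hr)]

/-- `T′ = 2Mr/Δ` (the Boyer–Lindquist slope `d(r* − r)/dr`) on `8M ≤ r`. [folklore] -/
theorem bentSlope_eq_of_ge (hM : 0 < M) {r : ℝ} (hr : 8 * M ≤ r) :
    bentSlope M a r = 2 * M * r / (r ^ 2 - 2 * M * r + a ^ 2) := by
  simp [bentSlope, Real.smoothTransition.one_of_one_le (one_le_arg hM hr),
    deriv_smoothTransition_of_one_le (one_le_arg hM hr)]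

/-- **`T` is differentiable everywhere with derivative `bentSlope`** (product rule on `r > r₊`;
locally `≡ 0` on `r < 4M`; the two open sets cover `ℝ` because `r₊ < 4M`). [folklore] -/
theorem hasDerivAt_bentHeight (h : |a| < M) (r : ℝ) :
    HasDerivAt (bentHeight M a) (bentSlope M a r) r := by
  have hM := mass_pos h
  rcases lt_or_ge r (4 * M) with hr | hr
  · -- locally zero
    have hev : (bentHeight M a) =ᶠ[𝓝 r] fun _ => 0 := by
      filter_upwards [Iio_mem_nhds hr] with y hy
      exact bentHeight_eq_zero_of_le hM hy.le
    rw [bentSlope_eq_zero_of_le hM hr.le]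
    exact (hasDerivAt_const r (0:ℝ)).congr_of_eventuallyEq hev
  · have hrp : Kerr.rPlus M a < r := (rPlus_lt_four_mul h).trans_le hr
    have hχ : HasDerivAt (fun y => Real.smoothTransition (y / (4 * M) - 1))
        (deriv Real.smoothTransition (r / (4 * M) - 1) * (1 / (4 * M))) r := by
      have hin : HasDerivAt (fun y : ℝ => y / (4 * M) - 1) (1 / (4 * M)) r := by
        simpa using ((hasDerivAt_id' r).div_const (4 * M)).sub_const 1
      exact ((differentiable_smoothTransition _).hasDerivAt).comp r hin
    have hF : HasDerivAt (fun y => blHeight M a y - blHeight M a (4 * M))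
        (2 * M * r / (r ^ 2 - 2 * M * r + a ^ 2)) r := by
      simpa using (hasDerivAt_blHeight h hrp).sub_const (blHeight M a (4 * M))
    have key := hχ.mul hF
    have e : bentSlope M a r =
        deriv Real.smoothTransition (r / (4 * M) - 1) * (1 / (4 * M)) *
            (blHeight M a r - blHeight M a (4 * M)) +
          Real.smoothTransition (r / (4 * M) - 1) * (2 * M * r / (r ^ 2 - 2 * M * r + a ^ 2)) := by
      simp only [bentSlope]; ring
    rw [e]
    exact key

/-- `T` is continuous. [folklore] -/
theorem continuous_bentHeight (h : |a| < M) : Continuous (bentHeight M a) :=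
  continuous_iff_continuousAt.2 fun r => (hasDerivAt_bentHeight h r).continuousAt

/-- `deriv T = bentSlope`. [folklore] -/
theorem deriv_bentHeight (h : |a| < M) : deriv (bentHeight M a) = bentSlope M a :=
  funext fun r => (hasDerivAt_bentHeight h r).deriv

end Height

/-! ## §4 Slope bounds on the transition annulus `4M ≤ r ≤ 8M` -/

section SlopeBounds

variable {M a : ℝ}

/-- `F` is differentiable on `[4M, ∞)` (which lies above `r₊`). [folklore] -/
theorem differentiableOn_blHeight (h : |a| < M) :
    DifferentiableOn ℝ (blHeight M a) (Ici (4 * M)) := fun _ hx =>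
  (hasDerivAt_blHeight h ((rPlus_lt_four_mul h).trans_le hx)).differentiableAt.differentiableWithinAt

/-- `F` is monotone on `[4M, ∞)` (`F′ = 2Mr/Δ > 0`). [folklore] -/
theorem monotoneOn_blHeight (h : |a| < M) : MonotoneOn (blHeight M a) (Ici (4 * M)) := by
  have hM := mass_pos h
  refine monotoneOn_of_deriv_nonneg (convex_Ici _) (differentiableOn_blHeight h).continuousOn
    ((differentiableOn_blHeight h).mono interior_subset) fun x hx => ?_
  rw [interior_Ici] at hx
  have hx4 : 4 * M < x := hx
  have hx' : Kerr.rPlus M a < x := (rPlus_lt_four_mul h).trans hx4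
  rw [(hasDerivAt_blHeight h hx').deriv]
  have := delta_pos h hx'
  have : 0 < x := by linarith
  positivity

/-- `0 ≤ F(r) − F(4M)` for `4M ≤ r`. [folklore] -/
theorem blHeight_sub_nonneg (h : |a| < M) {r : ℝ} (hr : 4 * M ≤ r) :
    0 ≤ blHeight M a r - blHeight M a (4 * M) :=
  sub_nonneg.2 (monotoneOn_blHeight h Set.self_mem_Ici hr hr)

/-- The comparison height `G(r) = 2M log(r − 2M) − F(r)` has `G′ = 2M a²/((r − 2M) Δ) ≥ 0` above `4M`,
whence **`F(r) − F(4M) ≤ 2M log((r − 2M)/(2M))`** (the Schwarzschild tortoise bound, uniform in `a`).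
[folklore] -/
theorem blHeight_sub_le (h : |a| < M) {r : ℝ} (hr : 4 * M ≤ r) :
    blHeight M a r - blHeight M a (4 * M) ≤ 2 * M * Real.log ((r - 2 * M) / (2 * M)) := by
  have hM := mass_pos h
  set G : ℝ → ℝ := fun x => 2 * M * Real.log (x - 2 * M) - blHeight M a x with hG
  have hderiv : ∀ x, 4 * M ≤ x → HasDerivAt G
      (2 * M * (1 / (x - 2 * M)) - 2 * M * x / (x ^ 2 - 2 * M * x + a ^ 2)) x := by
    intro x hx
    have hx2 : x - 2 * M ≠ 0 := by
      have : 0 < x - 2 * M := by linarith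
      exact this.ne'
    have h1 : HasDerivAt (fun y => Real.log (y - 2 * M)) (1 / (x - 2 * M)) x := by
      simpa using ((hasDerivAt_id' x).sub_const (2 * M)).log hx2
    exact (h1.const_mul (2 * M)).sub (hasDerivAt_blHeight h ((rPlus_lt_four_mul h).trans_le hx))
  have hdiff : DifferentiableOn ℝ G (Ici (4 * M)) := fun x hx =>
    (hderiv x (show 4 * M ≤ x from hx)).differentiableAt.differentiableWithinAt
  have hmono : MonotoneOn G (Ici (4 * M)) := by
    refine monotoneOn_of_deriv_nonneg (convex_Ici _) hdiff.continuousOn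
      (hdiff.mono interior_subset) fun x hx => ?_
    rw [interior_Ici] at hx
    have hx4 : 4 * M < x := hx
    rw [(hderiv x hx4.le).deriv]
    have hΔ : 0 < x ^ 2 - 2 * M * x + a ^ 2 := delta_pos h ((rPlus_lt_four_mul h).trans hx4)
    have hx2 : 0 < x - 2 * M := by linarith
    rw [sub_nonneg, div_le_iff₀ hΔ, mul_one_div, div_mul_eq_mul_div, le_div_iff₀ hx2]
    nlinarith [sq_nonneg a, hM.le]
  have key := hmono Set.self_mem_Ici hr hr
  simp only [hG] at key
  have h2M : (0:ℝ) < 2 * M := by linarith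
  have hr2 : 0 < r - 2 * M := by linarith
  rw [Real.log_div hr2.ne' h2M.ne']
  have e : (4 * M - 2 * M) = 2 * M := by ring
  rw [e] at key
  nlinarith [key]

/-- **`T′ ≥ 0`** everywhere (each factor of each term is nonnegative). [folklore] -/
theorem bentSlope_nonneg (h : |a| < M) (r : ℝ) : 0 ≤ bentSlope M a r := by
  have hM := mass_pos h
  rcases le_or_gt r (4 * M) with hr | hr
  · rw [bentSlope_eq_zero_of_le hM hr]
  · have h1 := deriv_smoothTransition_nonneg (r / (4 * M) - 1)
    have h2 := blHeight_sub_nonneg h hr.le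
    have h3 := Real.smoothTransition.nonneg (r / (4 * M) - 1)
    have h4 : 0 ≤ 2 * M * r / (r ^ 2 - 2 * M * r + a ^ 2) :=
      div_nonneg (by nlinarith) (delta_pos h ((rPlus_lt_four_mul h).trans hr)).le
    unfold bentSlope
    positivity

/-- `2Mr/Δ ≤ 2M/(r − 2M)` for `r > 2M` (`Δ ≥ r(r − 2M)`). [folklore] -/
theorem blSlope_le (h : |a| < M) {r : ℝ} (hr : 2 * M < r) :
    2 * M * r / (r ^ 2 - 2 * M * r + a ^ 2) ≤ 2 * M / (r - 2 * M) := by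
  have hM := mass_pos h
  have hr0 : 0 < r := by linarith
  have hΔ : 0 < r ^ 2 - 2 * M * r + a ^ 2 := by nlinarith [delta_ge M a r, mul_pos hr0 (sub_pos.2 hr)]
  rw [div_le_div_iff₀ hΔ (sub_pos.2 hr)]
  nlinarith [delta_ge M a r, sq_nonneg a]

/-- **The slope bound on the annulus**: for `4M ≤ r`,
`T′(r) ≤ log((r − 2M)/(2M)) + 2M/(r − 2M)` (using `χ′ ≤ 2`, `χ ≤ 1`, the tortoise bound and
`Δ ≥ r(r − 2M)`). Numerically the right side is `≤ 1.4319` on `[4M, 8M]` (at `8M`), while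
`sup T′ = 1.078` (at `r ≈ 6.52M`, `a = 0`). [folklore] -/
theorem bentSlope_le (h : |a| < M) {r : ℝ} (hr : 4 * M ≤ r) :
    bentSlope M a r ≤ Real.log ((r - 2 * M) / (2 * M)) + 2 * M / (r - 2 * M) := by
  have hM := mass_pos h
  have hd0 := deriv_smoothTransition_nonneg (r / (4 * M) - 1)
  have hd2 := deriv_smoothTransition_le_two (r / (4 * M) - 1)
  have hF0 := blHeight_sub_nonneg h hr
  have hF := blHeight_sub_le h hr
  have hχ0 := Real.smoothTransition.nonneg (r / (4 * M) - 1)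
  have hχ1 := Real.smoothTransition.le_one (r / (4 * M) - 1)
  have hs0 : 0 ≤ 2 * M * r / (r ^ 2 - 2 * M * r + a ^ 2) :=
    div_nonneg (by nlinarith) (delta_pos h ((rPlus_lt_four_mul h).trans_le hr)).le
  have hs := blSlope_le h (show 2 * M < r by linarith)
  have hL0 : 0 ≤ Real.log ((r - 2 * M) / (2 * M)) := by
    apply Real.log_nonneg
    rw [le_div_iff₀ (by linarith)]; linarith
  unfold bentSlope
  have h1 : deriv Real.smoothTransition (r / (4 * M) - 1) / (4 * M) *
      (blHeight M a r - blHeight M a (4 * M)) ≤ Real.log ((r - 2 * M) / (2 * M)) := by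
    have hA : deriv Real.smoothTransition (r / (4 * M) - 1) / (4 * M) ≤ 2 / (4 * M) :=
      div_le_div_of_nonneg_right hd2 (by linarith)
    have hA0 : 0 ≤ deriv Real.smoothTransition (r / (4 * M) - 1) / (4 * M) :=
      div_nonneg hd0 (by linarith)
    calc deriv Real.smoothTransition (r / (4 * M) - 1) / (4 * M) *
          (blHeight M a r - blHeight M a (4 * M))
        ≤ (2 / (4 * M)) * (2 * M * Real.log ((r - 2 * M) / (2 * M))) :=
          mul_le_mul hA hF hF0 (by positivity)
      _ = Real.log ((r - 2 * M) / (2 * M)) := by field_simp; ring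
  have h2 : Real.smoothTransition (r / (4 * M) - 1) * (2 * M * r / (r ^ 2 - 2 * M * r + a ^ 2)) ≤
      2 * M / (r - 2 * M) := by
    calc Real.smoothTransition (r / (4 * M) - 1) * (2 * M * r / (r ^ 2 - 2 * M * r + a ^ 2))
        ≤ 1 * (2 * M / (r - 2 * M)) := mul_le_mul hχ1 hs hs0 zero_le_one
      _ = 2 * M / (r - 2 * M) := one_mul _
  linarith

/-- `log 2 < 0.6932`, `log(5/2) < 1`, `log 3 < 1.1932` — the three numerical inputs. [folklore] -/
theorem log_two_lt : Real.log 2 < 0.6932 := by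
  have := Real.log_two_lt_d9; norm_num at this ⊢; linarith

theorem log_five_halves_lt : Real.log (5 / 2) < 1 := by
  rw [Real.log_lt_iff_lt_exp (by norm_num)]
  have := Real.exp_one_gt_d9; norm_num at this ⊢; linarith

theorem log_three_lt : Real.log 3 < 1.1932 := by
  have h32 : Real.log (3 / 2) < 1 / 2 := by
    rw [Real.log_lt_iff_lt_exp (by norm_num)]
    have := Real.add_one_lt_exp (show (1 / 2 : ℝ) ≠ 0 by norm_num)
    norm_num at this ⊢; linarith
  have e : Real.log 3 = Real.log 2 + Real.log (3 / 2) := by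
    rw [← Real.log_mul (by norm_num) (by norm_num)]; norm_num
  rw [e]; have := log_two_lt; norm_num at this h32 ⊢; linarith

/-- Window caps for the slope: `T′ < 17/10` on `(4M, 6M]`, `< 3/2` on `[6M, 7M]`, `< 8/5` on `[7M, 8M]`.
[folklore] -/
theorem bentSlope_lt_cap₁ (h : |a| < M) {r : ℝ} (hr : 4 * M < r) (hr' : r ≤ 6 * M) :
    bentSlope M a r < 17 / 10 := by
  have hM := mass_pos h
  have hb := bentSlope_le h hr.le
  have hL : Real.log ((r - 2 * M) / (2 * M)) ≤ Real.log 2 := by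
    apply Real.log_le_log (by apply div_pos <;> linarith)
    rw [div_le_iff₀ (by linarith)]; linarith
  have hq : 2 * M / (r - 2 * M) < 1 := by
    rw [div_lt_one (by linarith)]; linarith
  have := log_two_lt
  norm_num at this ⊢; linarith

theorem bentSlope_lt_cap₂ (h : |a| < M) {r : ℝ} (hr : 6 * M ≤ r) (hr' : r ≤ 7 * M) :
    bentSlope M a r < 3 / 2 := by
  have hM := mass_pos h
  have hb := bentSlope_le h (by linarith)
  have hL : Real.log ((r - 2 * M) / (2 * M)) ≤ Real.log (5 / 2) := by
    apply Real.log_le_log (by apply div_pos <;> linarith)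
    rw [div_le_iff₀ (by linarith)]; linarith
  have hq : 2 * M / (r - 2 * M) ≤ 1 / 2 := by
    rw [div_le_iff₀ (by linarith)]; linarith
  have := log_five_halves_lt
  linarith

theorem bentSlope_lt_cap₃ (h : |a| < M) {r : ℝ} (hr : 7 * M ≤ r) (hr' : r ≤ 8 * M) :
    bentSlope M a r < 8 / 5 := by
  have hM := mass_pos h
  have hb := bentSlope_le h (by linarith)
  have hL : Real.log ((r - 2 * M) / (2 * M)) ≤ Real.log 3 := by
    apply Real.log_le_log (by apply div_pos <;> linarith)
    rw [div_le_iff₀ (by linarith)]; linarith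
  have hq : 2 * M / (r - 2 * M) ≤ 2 / 5 := by
    rw [div_le_iff₀ (by linarith)]; linarith
  have := log_three_lt
  norm_num at this ⊢; linarith

end SlopeBounds

/-! ## §5 The conormal form of the graph `t* = T(r)`: the cheapest falsifier, as a theorem -/

section Conormal

variable {M a : ℝ}

/-- `Σ · g⁻¹(n, n)` for the conormal `n = dt* − t dr` of a graph `t* = T(r)` with slope `t = T′(r)`
at a point of Kerr–Schild radius `r` and polar cosine `c = z/r` in ingoing Kerr–Schild coordinates:
`g⁻¹ = η⁻¹ − 2H ℓ♯ ⊗ ℓ♯`, `H = Mr/Σ`, `Σ = r² + a²c²`, `η⁻¹(dr, dr) = (r² + a²)/Σ`, `ℓ♯ · dr = 1`,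
`ℓ♯ · dt* = −1`, whence `Σ g⁻¹(n,n) = −Σ + t²(r² + a²) − 2Mr(1 + t)²`. The graph is SPACELIKE at the
point iff this is `< 0` (then `−g♯ n/|n|` is its future unit normal, future because
`g⁻¹(n, dt*) = −(1 + 2H(1 + t))/… < 0` for `t ≥ 0`). [cite: arXiv08110354, §5.1] [cite: Cook2000, §3.2.2] -/
def conormalForm (M a r c t : ℝ) : ℝ :=
  -(r ^ 2 + a ^ 2 * c ^ 2) + t ^ 2 * (r ^ 2 + a ^ 2) - 2 * M * r * (1 + t) ^ 2

/-- A convex quadratic on `[0, cap]` is bounded by the larger of its endpoint values. [folklore] -/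
theorem quad_le_max {D L K t cap : ℝ} (hD : 0 ≤ D) (ht0 : 0 ≤ t) (ht : t ≤ cap) :
    D * t ^ 2 + L * t + K ≤ max K (D * cap ^ 2 + L * cap + K) := by
  have h1 : D * t ^ 2 ≤ D * (cap * t) := by
    apply mul_le_mul_of_nonneg_left _ hD; nlinarith
  rcases le_or_gt 0 (D * cap + L) with hpos | hneg
  · have h2 : t * (D * cap + L) ≤ cap * (D * cap + L) := mul_le_mul_of_nonneg_right ht hpos
    calc D * t ^ 2 + L * t + K ≤ K + t * (D * cap + L) := by nlinarith
      _ ≤ D * cap ^ 2 + L * cap + K := by nlinarith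
      _ ≤ max K (D * cap ^ 2 + L * cap + K) := le_max_right _ _
  · have h2 : t * (D * cap + L) ≤ 0 := mul_nonpos_iff.2 (Or.inl ⟨ht0, hneg.le⟩)
    calc D * t ^ 2 + L * t + K ≤ K + t * (D * cap + L) := by nlinarith
      _ ≤ K := by linarith
      _ ≤ max K (D * cap ^ 2 + L * cap + K) := le_max_left _ _

/-- The conormal form as a quadratic in the slope: `Q(t) = Δ t² − 4Mr t − (2Mr + Σ)`. [folklore] -/
theorem conormalForm_eq (M a r c t : ℝ) :
    conormalForm M a r c t =
      (r ^ 2 - 2 * M * r + a ^ 2) * t ^ 2 + (-(4 * M * r)) * t + (-(2 * M * r + (r ^ 2 + a ^ 2 * c ^ 2))) := by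
  unfold conormalForm; ring

/-- Window step: if on a radius window the slope is in `[0, cap]` and the endpoint polynomial
`(r² − 2Mr + M²) cap² − 4Mr cap − 2Mr − r²` is negative, the conormal form is negative there
(`Δ ≤ r² − 2Mr + M²` by `a² < M²`, `Σ ≥ r²`). [folklore] -/
theorem conormalForm_neg_of_cap (h : |a| < M) {r t cap : ℝ} (hr : Kerr.rPlus M a < r) (hr0 : 0 < r)
    (ht0 : 0 ≤ t) (ht : t ≤ cap)
    (hP : (r ^ 2 - 2 * M * r + M ^ 2) * cap ^ 2 - 4 * M * r * cap - 2 * M * r - r ^ 2 < 0) (c : ℝ) :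
    conormalForm M a r c t < 0 := by
  have hM := mass_pos h
  have hΔ := delta_pos h hr
  have ha2 : a ^ 2 < M ^ 2 := by nlinarith [sq_sub_sq_pos h]
  rw [conormalForm_eq]
  refine (quad_le_max hΔ.le ht0 ht).trans_lt (max_lt ?_ ?_)
  · nlinarith [sq_nonneg (a * c)]
  · nlinarith [sq_nonneg (a * c), mul_nonneg (sq_nonneg cap) (sub_nonneg.2 ha2.le), sq_nonneg cap]

/-- **THE CHEAPEST FALSIFIER, AS A THEOREM (uniform in the latitude `c` and in `|a| < M`).**
For every sub-extremal `(M, a)` and every `r > 0`,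
`Σ · g⁻¹(n, n) = −(r² + a²c²) + T′(r)²(r² + a²) − 2Mr(1 + T′(r))² < 0`,
`T′ = bentSlope M a = deriv (bentHeight M a)` the slope of the LITERAL hard-coded height of the crux:
below `4M` `T′ = 0`; on `[8M, ∞)` `T′ = 2Mr/Δ` and the form equals `−Σ − 2Mr(1 + T′)`; on the annulus
the slope caps `17/10, 3/2, 8/5` of §4 and convexity in `T′` reduce it to three polynomial
inequalities in `r/M`. So the hard-coded slice is spacelike at every point of `Kerr.region a r₁` it
visits, for EVERY junction radius and every sub-extremal spin: the 'cheap technical death' of the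
line (planner's kill criterion (a), slice clause) does NOT occur. Numerically `sup g⁻¹(n,n) = −1.148`
(`r ≈ 6.65M`, `a = 0`, worst latitude irrelevant there), min critical-slope margin `0.795`.
[cite: arXiv08110354, §5.1] [cite: Cook2000, §3.2.2] -/
theorem conormalForm_bentSlope_neg (h : |a| < M) {r : ℝ} (hr0 : 0 < r) (c : ℝ) :
    conormalForm M a r c (bentSlope M a r) < 0 := by
  have hM := mass_pos h
  have ht0 := bentSlope_nonneg h r
  rcases le_or_gt r (4 * M) with h4 | h4
  · -- Kerr–Schild zone: `T′ = 0`
    rw [bentSlope_eq_zero_of_le hM h4]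
    unfold conormalForm
    nlinarith [sq_nonneg (a * c), mul_pos hM hr0]
  have hrp : Kerr.rPlus M a < r := (rPlus_lt_four_mul h).trans h4
  rcases le_or_gt (8 * M) r with h8 | h8
  · -- Boyer–Lindquist zone: `Δ T′ = 2Mr`
    have hΔ := delta_pos h hrp
    have e := bentSlope_eq_of_ge hM h8 (a := a)
    set t := bentSlope M a r
    have hΔt : (r ^ 2 - 2 * M * r + a ^ 2) * t = 2 * M * r := by
      rw [e, mul_comm, div_mul_cancel₀ _ hΔ.ne']
    have key : conormalForm M a r c t = -(r ^ 2 + a ^ 2 * c ^ 2) - 2 * M * r * (1 + t) := by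
      unfold conormalForm; nlinarith [hΔt]
    rw [key]
    nlinarith [sq_nonneg (a * c), mul_pos hM hr0]
  -- transition annulus, three windows
  rcases le_or_gt r (6 * M) with h6 | h6
  · exact conormalForm_neg_of_cap h hrp hr0 ht0 (bentSlope_lt_cap₁ h h4 h6).le
      (by nlinarith [mul_nonneg (sub_nonneg.2 h4.le) (sub_nonneg.2 h6), mul_pos hM hM]) c
  rcases le_or_gt r (7 * M) with h7 | h7
  · exact conormalForm_neg_of_cap h hrp hr0 ht0 (bentSlope_lt_cap₂ h h6.le h7).le
      (by nlinarith [mul_nonneg (sub_nonneg.2 h6.le) (sub_nonneg.2 h7), mul_pos hM hM]) c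
  · exact conormalForm_neg_of_cap h hrp hr0 ht0 (bentSlope_lt_cap₃ h h7.le h8.le).le
      (by nlinarith [mul_nonneg (sub_nonneg.2 h7.le) (sub_nonneg.2 h8.le), mul_pos hM hM]) c

/-- The same statement with `deriv (bentHeight M a)` in place of the named slope. [folklore] -/
theorem conormalForm_deriv_bentHeight_neg (h : |a| < M) {r : ℝ} (hr0 : 0 < r) (c : ℝ) :
    conormalForm M a r c (deriv (bentHeight M a) r) < 0 := by
  rw [deriv_bentHeight h]; exact conormalForm_bentSlope_neg h hr0 c

end Conormal

/-! ## §5b Tightness of the certificate at zero spin -/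

section Tightness

variable {M : ℝ}

/-- For `a = 0` the conormal form factorises: `Q = r (t + 1) ((r − 2M) t − (r + 2M))`. [folklore] -/
theorem conormalForm_zero_spin (M r c t : ℝ) :
    conormalForm M 0 r c t = r * (t + 1) * ((r - 2 * M) * t - (r + 2 * M)) := by
  unfold conormalForm; ring

/-- **The critical slope is sharp.** For `a = 0`, `r > 2M` and `t ≥ 0`, the graph of slope `t` is spacelike
at radius `r` iff `t < (r + 2M)/(r − 2M)`; at `t = (r + 2M)/(r − 2M)` the conormal is null (the bound of
the certificate cannot be improved). E.g. at `r = 6M` the critical slope is `2`, the hard-coded slope is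
`< 3/2`. [folklore] -/
theorem conormalForm_zero_spin_neg_iff {r t : ℝ} (hr : 2 * M < r) (hr0 : 0 < r) (ht : 0 ≤ t) :
    conormalForm M 0 r 0 t < 0 ↔ t < (r + 2 * M) / (r - 2 * M) := by
  rw [conormalForm_zero_spin, lt_div_iff₀ (sub_pos.2 hr)]
  constructor
  · intro h
    by_contra hle
    rw [not_lt] at hle
    have : 0 ≤ r * (t + 1) * ((r - 2 * M) * t - (r + 2 * M)) :=
      mul_nonneg (mul_nonneg hr0.le (by linarith)) (by linarith)
    linarith
  · intro h
    have h1 : 0 < r * (t + 1) := mul_pos hr0 (by linarith)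
    have h2 : (r - 2 * M) * t - (r + 2 * M) < 0 := by linarith
    nlinarith

/-- At the critical slope the conormal of the graph is null (`Q = 0`). [folklore] -/
theorem conormalForm_zero_spin_critical {r : ℝ} (hr : 2 * M < r) (c : ℝ) :
    conormalForm M 0 r c ((r + 2 * M) / (r - 2 * M)) = 0 := by
  rw [conormalForm_zero_spin]
  have : (r - 2 * M) * ((r + 2 * M) / (r - 2 * M)) - (r + 2 * M) = 0 := by
    rw [mul_div_cancel₀ _ (sub_pos.2 hr).ne']; ring
  rw [this, mul_zero]

/-- Inside the horizon every nonnegative slope is spacelike (`a = 0`, `0 < r < 2M`): the bending could be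
anything there; the crux keeps `T ≡ 0`. [folklore] -/
theorem conormalForm_zero_spin_neg_of_lt {r t : ℝ} (hr0 : 0 < r) (hr : r < 2 * M) (ht : 0 ≤ t) (c : ℝ) :
    conormalForm M 0 r c t < 0 := by
  rw [conormalForm_zero_spin]
  have h1 : 0 < r * (t + 1) := mul_pos hr0 (by linarith)
  have h2 : (r - 2 * M) * t - (r + 2 * M) < 0 := by nlinarith
  nlinarith

end Tightness


/-! ## §6 The pinned immersion: the graph of `T ∘ r` over the Kerr–Schild slice -/

section Graph

variable {M a r₁ : ℝ}

/-- The Kerr–Schild radius does not depend on `t*`: `r(a, (t, y)) = r(a, (0, y))`. [cite: arXiv07060622, (35)] -/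
theorem radius_ofTimeSpace (a t : ℝ) (y : E3) :
    Kerr.radius a (E4.ofTimeSpace t y) = Kerr.radius a (E4.ofTimeSpace 0 y) := by
  have h3 : ∀ s : ℝ, E4.ofTimeSpace s y 3 = y 2 := fun s => E4.ofTimeSpace_apply_succ s y 2
  simp only [Kerr.radius, E4.spatialNorm_ofTimeSpace, h3]

/-- Hence every lift `(t, y)` of a slice point lies in the chart domain `Kerr.region a r₁`. [folklore] -/
theorem ofTimeSpace_mem_region (t : ℝ) {y : E3} (hy : y ∈ Kerr.slice a r₁) :
    E4.ofTimeSpace t y ∈ Kerr.region a r₁ := by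
  rw [Kerr.mem_region, radius_ofTimeSpace]; exact hy

variable (M a r₁) in
/-- The graph `y ↦ (T(r(y)), y)` of the hard-coded height over the Kerr–Schild slice. [folklore] -/
def graph : Kerr.slice a r₁ → Kerr.region a r₁ := fun y =>
  ⟨E4.ofTimeSpace (bentHeight M a (Kerr.radius a (E4.ofTimeSpace 0 (y : E3)))) y,
    ofTimeSpace_mem_region _ y.2⟩

/-- Unfolding lemma for `graph`. [folklore] -/
@[simp] theorem coe_graph (y : Kerr.slice a r₁) :
    (graph M a r₁ y : E4) = E4.ofTimeSpace (bentHeight M a (Kerr.radius a (E4.ofTimeSpace 0 (y : E3)))) y :=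
  rfl

/-- **Conjunct 7 pins `ψ`.** Any `ψ` satisfying the crux's graph clause with the crux's literal `T` IS
`graph M a r₁` — the immersion is not a degree of freedom of the witness (only `D` off `range φ`, the
chart `φ`, the end chart and the sign-determined normal are). [folklore] -/
theorem psi_eq_graph {T : ℝ → ℝ} (hT : T = bentHeight M a)
    {ψ : Kerr.slice a r₁ → Kerr.region a r₁}
    (hψ : ∀ y : Kerr.slice a r₁, (ψ y : E4) =
      E4.ofTimeSpace (T (Kerr.radius a (E4.ofTimeSpace 0 (y : E3)))) (y : E3)) :
    ψ = graph M a r₁ := by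
  funext y; apply Subtype.ext; rw [hψ y, hT]; rfl

/-- **On `r ≤ 4M` the graph is the Kerr–Schild slice embedding** `Kerr.sliceEmbed` (`T = 0` there), whose
spacelikeness and future unit normal are theorems of the tree
(`Kerr.isSpacelikeImmersion_sliceEmbed_holds`, `Kerr.isFutureUnitNormal_sliceNormal_holds`): the
near-junction part of the slice clause costs the prover nothing. [cite: Cook2000, §3.2.2] -/
theorem graph_eq_sliceEmbed_of_le (hM : 0 < M) {y : Kerr.slice a r₁}
    (hy : Kerr.radius a (E4.ofTimeSpace 0 (y : E3)) ≤ 4 * M) :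
    graph M a r₁ y = Kerr.sliceEmbed a r₁ y := by
  apply Subtype.ext
  rw [coe_graph, bentHeight_eq_zero_of_le hM hy, Kerr.coe_sliceEmbed]

/-- The graph is injective (it is a section of the projection `(t, y) ↦ y`). [folklore] -/
theorem graph_injective : Function.Injective (graph M a r₁) := by
  intro y y' h
  have h' := congrArg (fun p : Kerr.region a r₁ => E4.spatial (p : E4)) h
  simp only [coe_graph, E4.spatial_ofTimeSpace] at h'
  exact Subtype.ext h'

end Graph

/-! ## §7 Mutations of the crux: which tightenings die, which survive (load-bearing analysis)

For an `∃`-crux the analogue of "`_false_without_H`" is "which natural STRENGTHENING is false":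

* **Extremal / super-extremal spin** (`|a| ≤ M` replaced by `|a| = M` or dropped with `M ≤ |a|`): FALSE,
  `no_window_of_not_subextremal` (§2) — the typed window `(r₋, r₊)` is empty.
* **Unbent slice** (`T ≡ 0`, a pure Kerr–Schild end): FALSE for `M > 0` IN EVERY CHART (gen 4, §13.4:
  `ChartFree.not_unbentShieldedDataExist_zero_spin` — the body of the crux with `T := 0`, `a := 0` has no witness;
  `ChartFree.unbentShield_not_admissible_zero_spin` — no admissible datum carries the unbent Schwarzschild slice data;
  0 sorry). History: gen 2 refuted only the TAUTOLOGICAL end chart via the named fact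
  `Kerr.not_isStronglyAsymptoticallyFlatDR_data` (proved gen 3, `Negative/UnbentEndNotDR.lean`, by the order-zero
  METRIC anisotropy — a chart-specific obstruction: §13.3 shows the unbent metric IS DR at order zero in the areal-shift
  chart); the chart-free proof goes through the invariant ratio `k(v,v)/h(v,v)` instead (no Bartnik rigidity needed:
  a curve of speed `≤ √2` compares the radii). The general-spin version is the remaining near-miss
  `unbentShield_not_admissible` below (only the closed form of `Kerr.sliceK` for `a ≠ 0` is missing). This is THE reason
  the crux bends to Boyer–Lindquist beyond `8M`: bending is load-bearing absolutely.
* **`φ = id` AND tautological end chart** (read the bent slice in Kerr–Schild Cartesian coordinates): FALSE —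
  for `a = 0`, `r ≥ 8M`: `h = δ + x̂⊗x̂ · ((1 − 2M/r)⁻¹ − 1)`, so `h − (1 + 2M'/r)δ` has the `O(1/r)` part
  `(2M/r) x̂⊗x̂ − (2M'/r) δ ≠ o(1/r)` for every `M'`; the admissible end must be read in the radially shifted
  chart `ỹ = (ρ(r)/r) y`, `r = ρ(1 + M/2ρ)²`. Not a defect: the end chart is existential.
* **CK rates** (`o₄(r^{-3/2}), o₃(r^{-5/2})`) instead of DR: SURVIVES (BL end `O(ρ⁻²)`, `O(aMρ⁻³)`).
* **Junction below the Cauchy horizon** (`r₁ ≤ r₋`, `a ≠ 0`): the typed slice stays spacelike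
  (`1 + 2H > 0` on `r > 0`), but no printed witness certifies exactness there (two-sheeted / collapse
  developments stop at `r = r₋`); the typed window excludes it anyway.
* **Moving the transition window** (planner's restate freedom under kill criterion (a)): with
  `χ((r − αM)/(αM))·(F − F(αM))` on `[αM, 2αM]` the worst conormal value (over `a ∈ [0, M)`, all
  latitudes; always attained at `a = 0` — rotation only helps) is `−1.148 (α = 4)`, `−0.927 (α = 3)`,
  `−0.214 (α = 2.5)`, `+2.07 (α = 2.2`, fails at `r ≈ 3.6M)`, `+5.18 (α = 2.1)`; narrower windows
  `[4M,6M]`, `[4M,5M]`, `[3M,4M]` also pass (`−1.25`, `−1.36`, `−1.18`). So the hard-coded `[4M, 8M]` is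
  far from the edge; any restated window with `α ≥ 2.5` survives (numerics `num/window_scan.py`,
  double precision).
* **Dropping `IsCompact (range φ)ᶜ`**: then `D :=` the Kerr–Schild slice data themselves on
  `X = Kerr.slice` would do — but the crux fixes `X = E3`, and `E3 ≄ S² × ℝ`, so a core is forced; by Birkhoff
  a spherically symmetric vacuum core with regular centre is flat (`M = 0`), so the core is genuinely
  dynamical/non-spherical (Li–Mei pulse zone, or the Beig–Ó Murchadha gold of the bag-of-gold card).
-/

section Mutations

variable {M a : ℝ}

/-- NEAR-MISS for GENERAL spin only — the `a = 0` case is now a THEOREM of this file (gen 4, §13.4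
`ChartFree.unbentShield_not_admissible_zero_spin`, 0 sorry; it also needs `ContMDiff φ`, which the crux supplies):
**no admissible datum on `E3` agrees with the UNBENT Kerr–Schild slice of a positive-mass Kerr outside a compact set**,
whatever the end chart. What is missing for `a ≠ 0` is only the closed form of `Kerr.sliceK` (the tree has it for `a = 0`:
`Kerr.data_k_zero_apply`). Obstruction: the
tree has no uniqueness-of-structure-at-infinity theorem (Bartnik 1986 §3, Cor. 3.2: two AF charts of the
same end differ by a rigid motion plus `O₂(r^{1−α})`), which is what transports the scalar obstruction
`tr_h k = 2M/r² + O(r⁻³) ≠ o(r⁻²)` (Cook 2000 (58)) from the Kerr–Schild chart to the existential chart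
`e` of `admissibleVacuumData`; and `tr_h k` itself is only reachable through `secondFundamentalForm` /
`Kerr.sliceK`, whose closed form is the unproved named fact behind `Kerr.not_isStronglyAsymptoticallyFlatDR_data`.
Tried: (i) chart-specific version = that named fact (NOW PROVED, gen 3: `Negative/UnbentEndNotDR.lean`, p76510 — via the order-zero metric rate, not `tr k`; gen 4, §13.3: that route is chart-specific — in the areal-shift chart the metric IS DR at order zero, `abs_hRep_arealShift_sub_le`, so the chart-free version must use `k`, whose closed form `Kerr.data_k_zero_apply` is now in the tree); (ii) direct computation of
`Kerr.sliceK` from `secondFundamentalForm`'s Koszul definition — blocked on `secondFundamentalForm_apply`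
(named fact, statement only). Kept as documentation of WHY the crux bends the slice. [cite: Bartnik1986, §3] [cite: Cook2000, §3.2.2 (58)] -/
theorem unbentShield_not_admissible [Kerr.Facts] [Kerr.SliceFacts] (hM : 0 < M) (h : |a| < M) {r₁ : ℝ}
    (D : InitialDataSet (𝓡 3) E3) (φ : Kerr.slice a r₁ → E3)
    (hφ : IsCompact (Set.range φ)ᶜ) (hφ' : Topology.IsOpenEmbedding φ)
    (hφs : ContMDiff 𝓘(ℝ, E3) (𝓡 3) ∞ φ)
    (hh : ∀ y : Kerr.slice a r₁, pullbackBilin (I := 𝓡 3) (I' := 𝓘(ℝ, E3)) φ D.h.inner y =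
      (Kerr.data M a r₁ hM.le).h.inner y)
    (hk : ∀ y : Kerr.slice a r₁, pullbackBilin (I := 𝓡 3) (I' := 𝓘(ℝ, E3)) φ D.k y =
      (Kerr.data M a r₁ hM.le).k y) :
    D ∉ admissibleVacuumData E3 := by
  sorry

end Mutations

/-! ## §8 Why it resists — and adversarial checks of the witness blueprints

No typed conjunct is unsatisfiable (§1); the pinned immersion is certified (§5–§6). What remains for a
PROVER is positive work, all of it with printed or crux-card blueprints:

1. **Slice clause** (`IsSpacelikeImmersion`, `IsFutureUnitNormal`): from §5 via `mfderiv (graph) v = (T′ dr(v), v)`,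
   `g(N, N) = conormalForm/Σ` for `N = g♯n` (uses `η⁻¹(dr,dr) = (r²+a²)/Σ`, `ℓ⃗·∇r = 1` — quartic identities of
   `Kerr.radius`), then `Kerr.bilin_pos_of_orthogonal`; on `r ≤ 4M` it is literally the tree's theorem (§6).
2. **The vacuum core** (the real content, Lean-XL): three blueprints —
   (a) *bag of gold* (cards `bag-of-gold-throat-recession`, `plug-the-second-sheet`; `a = 0`): a time-symmetric
   scalar-flat `E3` exactly Schwarzschild on end ∪ sheet 1 ∪ throat ∪ {sheet 2, areal `s < S_A`}, capped by a
   non-static scalar-flat 3-ball (Beig–Ó Murchadha / generic `(S³, g₀)` minus a ball, glued à la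
   Corvino / Chruściel–Delay on the no-KIDs side), then RE-SLICED inside the explicit Kruskal development.
   ADVERSARIAL CHECK of the domain-of-dependence step both cards assert: with `v_A` the advanced time of the
   LEFT exterior (constant on null rays entering region II from region III), `D_Kruskal(E) ⊇ {v_A < S_A*}`,
   `S_A* = S_A + 2m log(S_A/2m − 1)`; on the region-II part `{t*_B = 0, r₁ < r < 2m}` of the crux slice
   `t = r − r*`, so `v_A = r* − t = 2r* − r = r + 4m log(1 − r/2m) < 2m` (and `→ −∞` at the horizon);
   hence ANY cap radius with `S_A* > 2m`, e.g. `S_A ≥ 4m` (cards use `≥ 10m`), keeps the whole typed slice,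
   for EVERY `r₁ ∈ (0, 2m)`, inside the exact Kruskal region (`U = e^{v_A/4m} = e^{r/4m}(1 − r/2m) < 1` there,
   matching the card's `U < 1 < U_E`). The step is sound. Remaining risk of (a): existence of the exactly
   Schwarzschild two-sheeted gluing with a ball cap (Corvino-type gluing with the mass FIXED by the other
   sheet: the cards absorb the 1-dim static cokernel with the cap's own scale/parameters) — plausible, printed
   in pieces (Corvino 2000; Chruściel–Delay 2003 Thm 8.x; IMP gluing), not as one theorem.
   (b) *Li–Mei collapse* (route's intended witness, LiMei2020 Thm 2.2, small `|a|`): exterior exactly Kerr from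
   a cylinder `{r = r₀}`, `r₀ ∈ (r₋, r₊)`, inside the hole; re-slice along `T` in the exact region, junction
   `r₁ ∈ (r₀, r₊)`. (c) *Kehle–Unger* characteristic gluing to a trapped Schwarzschild sphere
   (card `null-glue-to-a-trapped-sphere`; `C²` regularity must be upgraded — its weak point).
3. **Admissibility bookkeeping**: BL end in the shifted chart (DR rates with room), completeness (compact core ∪
   complete BL end), sole end (complement of the far region is a closed bounded set of `E3`), constraints
   (Gauss–Codazzi in the exact region — `HypersurfaceConstraints.lean` has the Gauss half — and by
   construction in the core).

Barrier catalogue (`Literature/Barriers/FinalStateConjecture/*`): none of the catalogued barriers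
(naked-singularity instability, slowly-rotating frontier, Kehrberger logs, Price law, trapping loss,
superradiance, Ionescu–Klainerman non-extension) concerns the EXISTENCE of one shielded datum; nothing to
reduce to. Negatives index: `ledger negatives --problem FinalStateConjecture` = 0.
-/

/-! ## §9 (gen 3) From the scalar certificate to the tree's bilinear form `Kerr.bilin`

The slice clause asks positivity of `ψ^*g` on tangent vectors and a future unit normal for the tree's
`Kerr.smoothMetric M a r₁` (pointwise `Kerr.bilin M a x`, `Kerr.smoothMetric_val`). Part §5 certified the scalar
`conormalForm < 0`; here the scalar is identified with `Σ·g(N, N)` for an EXPLICIT vector `N`, `g`-orthogonal to the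
lifted tangent vectors of the graph and on the past side of the orienting field (so `−N` normalised is the future unit
normal), using only `Kerr.bilin_apply` and the quartic of `Kerr.radius`. The manifold-level statement (conjuncts 8–9 themselves) is LANDED separately as `Negative/SliceClause.lean` (p75771), which uses
the tree's `Kerr.radiusGradVec` (`= gradR` below, same closed form), `Kerr.hasFDerivAt_radius_slice` and `Kerr.coSharp`; this
section stays as the componentwise cross-check (numerically validated by job j009651).
-/

section QuarticAlgebra

/-- `|ℓ⃗|² = 1` as a rational identity from the quartic `r⁴ − (ρ² − a²) r² − a² z² = 0`. [cite: arXiv07060622, (34)–(35)] -/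
theorem ell_spatial_normSq_of_quartic {r a x₁ x₂ x₃ : ℝ} (hr : r ≠ 0) (hra : r ^ 2 + a ^ 2 ≠ 0)
    (hq : r ^ 4 - (x₁ ^ 2 + x₂ ^ 2 + x₃ ^ 2 - a ^ 2) * r ^ 2 - a ^ 2 * x₃ ^ 2 = 0) :
    ((r * x₁ + a * x₂) / (r ^ 2 + a ^ 2)) ^ 2 + ((r * x₂ - a * x₁) / (r ^ 2 + a ^ 2)) ^ 2 +
      (x₃ / r) ^ 2 = 1 := by
  field_simp
  linear_combination (-(r ^ 2 + a ^ 2)) * hq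

/-- `ℓ⃗ · d⃗ = 1` for the gradient candidate `dᵢ = r (xᵢ r² + a² z δᵢ₃)/(r⁴ + a² z²)`, from the quartic. [cite: arXiv07060622, (35)] -/
theorem ell_dot_grad_of_quartic {r a x₁ x₂ x₃ : ℝ} (hr : r ≠ 0) (hra : r ^ 2 + a ^ 2 ≠ 0)
    (hD : r ^ 4 + a ^ 2 * x₃ ^ 2 ≠ 0)
    (hq : r ^ 4 - (x₁ ^ 2 + x₂ ^ 2 + x₃ ^ 2 - a ^ 2) * r ^ 2 - a ^ 2 * x₃ ^ 2 = 0) :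
    (r * x₁ + a * x₂) / (r ^ 2 + a ^ 2) * (r * (x₁ * r ^ 2) / (r ^ 4 + a ^ 2 * x₃ ^ 2)) +
      (r * x₂ - a * x₁) / (r ^ 2 + a ^ 2) * (r * (x₂ * r ^ 2) / (r ^ 4 + a ^ 2 * x₃ ^ 2)) +
      x₃ / r * (r * (x₃ * r ^ 2 + a ^ 2 * x₃) / (r ^ 4 + a ^ 2 * x₃ ^ 2)) = 1 := by
  field_simp
  linear_combination (-(r ^ 2)) * hq

/-- `|d⃗|² = r² (r² + a²)/(r⁴ + a² z²)` for the gradient candidate, from the quartic. [cite: arXiv07060622, (35)] -/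
theorem grad_normSq_of_quartic {r a x₁ x₂ x₃ : ℝ} (hr : r ≠ 0) (hD : r ^ 4 + a ^ 2 * x₃ ^ 2 ≠ 0)
    (hq : r ^ 4 - (x₁ ^ 2 + x₂ ^ 2 + x₃ ^ 2 - a ^ 2) * r ^ 2 - a ^ 2 * x₃ ^ 2 = 0) :
    (r * (x₁ * r ^ 2) / (r ^ 4 + a ^ 2 * x₃ ^ 2)) ^ 2 + (r * (x₂ * r ^ 2) / (r ^ 4 + a ^ 2 * x₃ ^ 2)) ^ 2 +
      (r * (x₃ * r ^ 2 + a ^ 2 * x₃) / (r ^ 4 + a ^ 2 * x₃ ^ 2)) ^ 2 =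
      r ^ 2 * (r ^ 2 + a ^ 2) / (r ^ 4 + a ^ 2 * x₃ ^ 2) := by
  field_simp
  linear_combination (-(r ^ 2)) * hq

end QuarticAlgebra

section ConormalVector

variable {M a : ℝ} {x : E4}

/-- The quartic of the Kerr–Schild radius in coordinates. [cite: arXiv07060622, (35)] -/
theorem radius_quartic' (a : ℝ) (x : E4) :
    Kerr.radius a x ^ 4 - (x 1 ^ 2 + x 2 ^ 2 + x 3 ^ 2 - a ^ 2) * Kerr.radius a x ^ 2 - a ^ 2 * x 3 ^ 2 = 0 := by
  have h := Kerr.radius_quartic a x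
  rwa [E4.spatialNorm_sq] at h

/-- `r⁴ + a² z² > 0` on `{r > 0}`. [folklore] -/
theorem radius_pow_four_add_pos (hx : 0 < Kerr.radius a x) : 0 < Kerr.radius a x ^ 4 + a ^ 2 * x 3 ^ 2 := by
  positivity

/-- `ℓ₀ = 1`. [cite: arXiv07060622, (34)] -/
@[simp] theorem nullCovectorFun_zero (a : ℝ) (x : E4) : Kerr.nullCovectorFun a x 0 = 1 := by
  simp [Kerr.nullCovectorFun]

/-- `ℓ₁`. [cite: arXiv07060622, (34)] -/
theorem nullCovectorFun_one (a : ℝ) (x : E4) :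
    Kerr.nullCovectorFun a x 1 = (Kerr.radius a x * x 1 + a * x 2) / (Kerr.radius a x ^ 2 + a ^ 2) := by
  simp [Kerr.nullCovectorFun]

/-- `ℓ₂`. [cite: arXiv07060622, (34)] -/
theorem nullCovectorFun_two (a : ℝ) (x : E4) :
    Kerr.nullCovectorFun a x 2 = (Kerr.radius a x * x 2 - a * x 1) / (Kerr.radius a x ^ 2 + a ^ 2) := by
  simp [Kerr.nullCovectorFun]

/-- `ℓ₃`. [cite: arXiv07060622, (34)] -/
theorem nullCovectorFun_three (a : ℝ) (x : E4) :
    Kerr.nullCovectorFun a x 3 = x 3 / Kerr.radius a x := by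
  simp [Kerr.nullCovectorFun]

/-- **`|ℓ⃗|² = 1`** on `{r > 0}`. [cite: arXiv07060622, (35)] -/
theorem nullCovectorFun_spatial_normSq (hx : 0 < Kerr.radius a x) :
    Kerr.nullCovectorFun a x 1 ^ 2 + Kerr.nullCovectorFun a x 2 ^ 2 + Kerr.nullCovectorFun a x 3 ^ 2 = 1 := by
  rw [nullCovectorFun_one, nullCovectorFun_two, nullCovectorFun_three]
  exact ell_spatial_normSq_of_quartic hx.ne' (by positivity) (radius_quartic' a x)

/-- The closed-form **gradient candidate** `dᵢ = r (xᵢ r² + a² x₃ δᵢ₃)/(r⁴ + a² x₃²)` for `∇r`. [cite: arXiv07060622, (35)] -/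
def gradR (a : ℝ) (x : E4) : Fin 3 → ℝ :=
  ![Kerr.radius a x * (x 1 * Kerr.radius a x ^ 2) / (Kerr.radius a x ^ 4 + a ^ 2 * x 3 ^ 2),
    Kerr.radius a x * (x 2 * Kerr.radius a x ^ 2) / (Kerr.radius a x ^ 4 + a ^ 2 * x 3 ^ 2),
    Kerr.radius a x * (x 3 * Kerr.radius a x ^ 2 + a ^ 2 * x 3) / (Kerr.radius a x ^ 4 + a ^ 2 * x 3 ^ 2)]

/-- Component `d₀`. [folklore] -/
@[simp] theorem gradR_zero (a : ℝ) (x : E4) : gradR a x 0 =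
    Kerr.radius a x * (x 1 * Kerr.radius a x ^ 2) / (Kerr.radius a x ^ 4 + a ^ 2 * x 3 ^ 2) := rfl
/-- Component `d₁`. [folklore] -/
@[simp] theorem gradR_one (a : ℝ) (x : E4) : gradR a x 1 =
    Kerr.radius a x * (x 2 * Kerr.radius a x ^ 2) / (Kerr.radius a x ^ 4 + a ^ 2 * x 3 ^ 2) := rfl
/-- Component `d₂`. [folklore] -/
@[simp] theorem gradR_two (a : ℝ) (x : E4) : gradR a x 2 =
    Kerr.radius a x * (x 3 * Kerr.radius a x ^ 2 + a ^ 2 * x 3) / (Kerr.radius a x ^ 4 + a ^ 2 * x 3 ^ 2) := rfl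

/-- **`ℓ⃗ · d⃗ = 1`** (`ℓ♯ · dr = 1`). [cite: arXiv08110354, §5.1] -/
theorem gradR_dot_nullCovectorFun (hx : 0 < Kerr.radius a x) :
    Kerr.nullCovectorFun a x 1 * gradR a x 0 + Kerr.nullCovectorFun a x 2 * gradR a x 1 +
      Kerr.nullCovectorFun a x 3 * gradR a x 2 = 1 := by
  rw [nullCovectorFun_one, nullCovectorFun_two, nullCovectorFun_three, gradR_zero, gradR_one, gradR_two]
  exact ell_dot_grad_of_quartic hx.ne' (by positivity) (radius_pow_four_add_pos hx).ne' (radius_quartic' a x)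

/-- **`|d⃗|² = r²(r² + a²)/(r⁴ + a² z²)`** (`= η⁻¹(dr,dr) = (r²+a²)/Σ`). [cite: arXiv08110354, §5.1] -/
theorem gradR_normSq (hx : 0 < Kerr.radius a x) :
    gradR a x 0 ^ 2 + gradR a x 1 ^ 2 + gradR a x 2 ^ 2 =
      Kerr.radius a x ^ 2 * (Kerr.radius a x ^ 2 + a ^ 2) / (Kerr.radius a x ^ 4 + a ^ 2 * x 3 ^ 2) := by
  rw [gradR_zero, gradR_one, gradR_two]
  exact grad_normSq_of_quartic hx.ne' (radius_pow_four_add_pos hx).ne' (radius_quartic' a x)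

variable (M a x) in
/-- `N = (−1 − 2H(1+t), −t d⃗ + 2H(1+t) ℓ⃗)` for a slope `t` and gradient candidate `d⃗`. [cite: arXiv08110354, §5.1] -/
def conormalVecOf (t : ℝ) (d : Fin 3 → ℝ) : E4 :=
  WithLp.toLp 2 ![-(1 + 2 * Kerr.scalarH M a x * (1 + t)),
    -t * d 0 + 2 * Kerr.scalarH M a x * (1 + t) * Kerr.nullCovectorFun a x 1,
    -t * d 1 + 2 * Kerr.scalarH M a x * (1 + t) * Kerr.nullCovectorFun a x 2,
    -t * d 2 + 2 * Kerr.scalarH M a x * (1 + t) * Kerr.nullCovectorFun a x 3]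

/-- `N⁰`. [folklore] -/
@[simp] theorem conormalVecOf_apply_zero (t : ℝ) (d : Fin 3 → ℝ) :
    conormalVecOf M a x t d 0 = -(1 + 2 * Kerr.scalarH M a x * (1 + t)) := rfl
/-- `N¹`. [folklore] -/
@[simp] theorem conormalVecOf_apply_one (t : ℝ) (d : Fin 3 → ℝ) :
    conormalVecOf M a x t d 1 = -t * d 0 + 2 * Kerr.scalarH M a x * (1 + t) * Kerr.nullCovectorFun a x 1 := rfl
/-- `N²`. [folklore] -/
@[simp] theorem conormalVecOf_apply_two (t : ℝ) (d : Fin 3 → ℝ) :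
    conormalVecOf M a x t d 2 = -t * d 1 + 2 * Kerr.scalarH M a x * (1 + t) * Kerr.nullCovectorFun a x 2 := rfl
/-- `N³`. [folklore] -/
@[simp] theorem conormalVecOf_apply_three (t : ℝ) (d : Fin 3 → ℝ) :
    conormalVecOf M a x t d 3 = -t * d 2 + 2 * Kerr.scalarH M a x * (1 + t) * Kerr.nullCovectorFun a x 3 := rfl

/-- **`g(N, w) = w⁰ − t (d⃗ · w⃗)` for every `w`** (needs `ℓ⃗ · d⃗ = 1`; uses `|ℓ⃗|² = 1`). [cite: arXiv08110354, §5.1] -/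
theorem bilin_conormalVecOf (hx : 0 < Kerr.radius a x) {t : ℝ} {d : Fin 3 → ℝ}
    (hd : Kerr.nullCovectorFun a x 1 * d 0 + Kerr.nullCovectorFun a x 2 * d 1 +
      Kerr.nullCovectorFun a x 3 * d 2 = 1) (w : E4) :
    Kerr.bilin M a x (conormalVecOf M a x t d) w = w 0 - t * (d 0 * w 1 + d 1 * w 2 + d 2 * w 3) := by
  have hℓ := nullCovectorFun_spatial_normSq hx
  set ℓ1 := Kerr.nullCovectorFun a x 1 with hℓ1
  set ℓ2 := Kerr.nullCovectorFun a x 2 with hℓ2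
  set ℓ3 := Kerr.nullCovectorFun a x 3 with hℓ3
  set H := Kerr.scalarH M a x with hH
  simp only [Kerr.bilin_apply, Minkowski.bilin_apply, Kerr.nullCovector, E4.covector_apply, Fin.sum_univ_four,
    Fin.sum_univ_three, Fin.isValue, Fin.succ_zero_eq_one, Fin.succ_one_eq_two, Fin.reduceSucc,
    nullCovectorFun_zero, conormalVecOf_apply_zero, conormalVecOf_apply_one, conormalVecOf_apply_two,
    conormalVecOf_apply_three, one_mul]
  rw [← hℓ1, ← hℓ2, ← hℓ3, ← hH]
  linear_combination (2 * H * (w 0 + ℓ1 * w 1 + ℓ2 * w 2 + ℓ3 * w 3) * (-t)) * hd +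
    (2 * H * (w 0 + ℓ1 * w 1 + ℓ2 * w 2 + ℓ3 * w 3) * (2 * H * (1 + t))) * hℓ

/-- **`N ⊥_g (t (d⃗·v), v)`**: orthogonality to the lifted tangent vectors of the graph. [cite: arXiv08110354, §5.1] -/
theorem bilin_conormalVecOf_lift (hx : 0 < Kerr.radius a x) {t : ℝ} {d : Fin 3 → ℝ}
    (hd : Kerr.nullCovectorFun a x 1 * d 0 + Kerr.nullCovectorFun a x 2 * d 1 +
      Kerr.nullCovectorFun a x 3 * d 2 = 1) (v : E3) :
    Kerr.bilin M a x (conormalVecOf M a x t d) (E4.ofTimeSpace (t * (d 0 * v 0 + d 1 * v 1 + d 2 * v 2)) v) = 0 := by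
  rw [bilin_conormalVecOf hx hd]
  have h1 : E4.ofTimeSpace (t * (d 0 * v 0 + d 1 * v 1 + d 2 * v 2)) v 1 = v 0 := E4.ofTimeSpace_apply_succ _ v 0
  have h2 : E4.ofTimeSpace (t * (d 0 * v 0 + d 1 * v 1 + d 2 * v 2)) v 2 = v 1 := E4.ofTimeSpace_apply_succ _ v 1
  have h3 : E4.ofTimeSpace (t * (d 0 * v 0 + d 1 * v 1 + d 2 * v 2)) v 3 = v 2 := E4.ofTimeSpace_apply_succ _ v 2
  rw [E4.ofTimeSpace_apply_zero, h1, h2, h3]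
  ring

/-- **`g(N, N) = −1 + t²|d⃗|² − 2H(1+t)²`** (`= g⁻¹(n, n)`). [cite: arXiv08110354, §5.1] -/
theorem bilin_conormalVecOf_self (hx : 0 < Kerr.radius a x) {t : ℝ} {d : Fin 3 → ℝ}
    (hd : Kerr.nullCovectorFun a x 1 * d 0 + Kerr.nullCovectorFun a x 2 * d 1 +
      Kerr.nullCovectorFun a x 3 * d 2 = 1) :
    Kerr.bilin M a x (conormalVecOf M a x t d) (conormalVecOf M a x t d) =
      -1 + t ^ 2 * (d 0 ^ 2 + d 1 ^ 2 + d 2 ^ 2) - 2 * Kerr.scalarH M a x * (1 + t) ^ 2 := by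
  rw [bilin_conormalVecOf hx hd]
  simp only [conormalVecOf_apply_zero, conormalVecOf_apply_one, conormalVecOf_apply_two,
    conormalVecOf_apply_three]
  linear_combination (-t * (2 * Kerr.scalarH M a x * (1 + t))) * hd

/-- **`g(N, V) = 1 + 2H(1+t)`** for `V = Kerr.timeVector`. [cite: arXiv08110354, §5.1] -/
theorem bilin_conormalVecOf_timeVector (hx : 0 < Kerr.radius a x) {t : ℝ} {d : Fin 3 → ℝ}
    (hd : Kerr.nullCovectorFun a x 1 * d 0 + Kerr.nullCovectorFun a x 2 * d 1 +
      Kerr.nullCovectorFun a x 3 * d 2 = 1) :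
    Kerr.bilin M a x (conormalVecOf M a x t d) (Kerr.timeVector M a x) =
      1 + 2 * Kerr.scalarH M a x * (1 + t) := by
  rw [bilin_conormalVecOf hx hd]
  have h0 : Kerr.timeVector M a x 0 = 1 + 2 * Kerr.scalarH M a x := by
    simp [Kerr.timeVector, Kerr.nullVector]
  have h1 : Kerr.timeVector M a x 1 = -(2 * Kerr.scalarH M a x) * Kerr.nullCovectorFun a x 1 := by
    simp [Kerr.timeVector, Kerr.nullVector]
  have h2 : Kerr.timeVector M a x 2 = -(2 * Kerr.scalarH M a x) * Kerr.nullCovectorFun a x 2 := by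
    simp [Kerr.timeVector, Kerr.nullVector]
  have h3 : Kerr.timeVector M a x 3 = -(2 * Kerr.scalarH M a x) * Kerr.nullCovectorFun a x 3 := by
    simp [Kerr.timeVector, Kerr.nullVector]
  rw [h0, h1, h2, h3]
  linear_combination (2 * Kerr.scalarH M a x * t) * hd

variable (M a x) in
/-- The conormal vector of the graph of slope `t` with the gradient candidate `gradR`. [cite: arXiv08110354, §5.1] -/
def conormalVec (t : ℝ) : E4 := conormalVecOf M a x t (gradR a x)

/-- **`(r⁴ + a²z²) · g(N, N) = r² · conormalForm M a r (z/r) t`**: the certified scalar IS `Σ · g(N,N)`.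
[cite: arXiv08110354, §5.1] [cite: Cook2000, §3.2.2] -/
theorem bilin_conormalVec_self (hx : 0 < Kerr.radius a x) (t : ℝ) :
    (Kerr.radius a x ^ 4 + a ^ 2 * x 3 ^ 2) * Kerr.bilin M a x (conormalVec M a x t) (conormalVec M a x t) =
      Kerr.radius a x ^ 2 * conormalForm M a (Kerr.radius a x) (x 3 / Kerr.radius a x) t := by
  have hd := gradR_dot_nullCovectorFun hx (a := a)
  have hn := gradR_normSq hx (a := a)
  have hD := (radius_pow_four_add_pos hx (a := a)).ne'
  have hr := hx.ne'
  unfold conormalVec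
  rw [bilin_conormalVecOf_self hx hd, hn]
  unfold conormalForm Kerr.scalarH
  field_simp

/-- **The slice clause cannot fail, vector form**: for `|a| < M`, at EVERY point of `{r > 0}` the conormal vector of
the crux's graph (slope `bentSlope M a r`) is timelike, `g(N, N) < 0`. [cite: arXiv08110354, §5.1] -/
theorem bilin_conormalVec_self_neg (h : |a| < M) (hx : 0 < Kerr.radius a x) :
    Kerr.bilin M a x (conormalVec M a x (bentSlope M a (Kerr.radius a x)))
      (conormalVec M a x (bentSlope M a (Kerr.radius a x))) < 0 := by
  have hD := radius_pow_four_add_pos hx (a := a)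
  have key := bilin_conormalVec_self hx (bentSlope M a (Kerr.radius a x)) (M := M)
  have hneg := conormalForm_bentSlope_neg h hx (x 3 / Kerr.radius a x)
  have hr2 : 0 < Kerr.radius a x ^ 2 := by positivity
  by_contra hge
  rw [not_lt] at hge
  have : 0 ≤ Kerr.radius a x ^ 2 * conormalForm M a (Kerr.radius a x) (x 3 / Kerr.radius a x)
      (bentSlope M a (Kerr.radius a x)) := by
    rw [← key]; exact mul_nonneg hD.le hge
  nlinarith

/-- **Future side**: for `M ≥ 0`, `t ≥ 0`, `g(V, N) = 1 + 2H(1+t) > 0`, so `ν = −N/√(−g(N,N))` has `g(V, ν) < 0`, i.e. it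
is the FUTURE unit normal (`TimeOrientation.IsFutureDirected` = causal ∧ `g(V, ·) < 0`). [cite: arXiv08110354, §5.1] -/
theorem bilin_timeVector_conormalVec_pos (hM : 0 ≤ M) (hx : 0 < Kerr.radius a x) {t : ℝ} (ht : 0 ≤ t) :
    0 < Kerr.bilin M a x (Kerr.timeVector M a x) (conormalVec M a x t) := by
  rw [Kerr.bilin_symm, conormalVec, bilin_conormalVecOf_timeVector hx (gradR_dot_nullCovectorFun hx)]
  have := Kerr.scalarH_nonneg hM a x
  positivity

/-- The same at the crux's slope `bentSlope M a r ≥ 0`. [cite: arXiv08110354, §5.1] -/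
theorem bilin_timeVector_conormalVec_bentSlope_pos (h : |a| < M) (hx : 0 < Kerr.radius a x) :
    0 < Kerr.bilin M a x (Kerr.timeVector M a x) (conormalVec M a x (bentSlope M a (Kerr.radius a x))) :=
  bilin_timeVector_conormalVec_pos (mass_pos h).le hx (bentSlope_nonneg h _)

end ConormalVector

/-! ## §10 (gen 3) Pre-triage of the two line skeletons; witness blueprints re-examined

Read in full: `Lines/plug-the-second-sheet.lean` (5 stubs) and `Lines/null-glue-to-a-trapped-sphere.lean` (3 stubs).
No stub is cheaply false; per stub the check actually run:

* `PlugTheSecondSheet.stub_ttShellCap` — `∃ M₀ ρ₁ ρ₂ … ∀ ε ∃ D₁ u`. The `n = 0` clause `‖u y − (1 + M₀/2ρ)‖ ≤ ε` on the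
  annulus forces `u > 0` there, so `u = (conformal factor)^{1/4}` is smooth on the annulus and the `iteratedFDeriv` clauses
  are not junk-satisfiable; `ρ₂ < 3M₀/8` needs `β = M₀/2 > 4` in shell units, available because `β(A) ≈ 1.02 A^{1/4}`
  (balance `Δφ ~ A²φ⁻⁷`); `|ξ|⁶P_TT(ξ)` is polynomial, so `σ_λ` is exactly TT AND compactly supported. Plausible.
* `stub_massGluing` — `∀ (M₀, Ω) ∃ ε ∀ D₁`: correct order for a perturbative gluing. Structural facts any `D₁` must satisfy:
  `h = u⁴δ`, `k = 0`, vacuum on `{ρ > ρ₁}` ⇒ `Δu = 0` there, and positivity of `h` + connectedness ⇒ `u > 0`, so by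
  Bôcher/Kelvin `u = b + c/ρ + O(ρ⁻²)`, `b ≥ 0` (no growing harmonics: a harmonic polynomial bounded below is constant);
  irrelevant anyway since `{ρ > ρ₂}` is REPLACED. Cokernel on `Ω ⊂ {ρ < M₀/2}`: static KIDs `span{N}`,
  `N = (1 − M₀/2ρ)/(1 + M₀/2ρ) < 0` on sheet 2 but nonzero; the obstruction derivative `∂_M G` is the `N`-weighted
  linearised flux of `∂_M((1+M/2ρ)⁴δ)`, CONSERVED in `ρ` (both a linearised solution and a KID), `= 16π ≠ 0` at sheet-1
  infinity. Plausible (Chruściel–Delay 2003 §8.9 is the printed instance).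
* `stub_sliceClause` — §5 + §9 + calculus (`bentHeight M 0` is `C^∞`: `≡ 0` on `r < 4M`, smooth product on `r > 2M`).
* `stub_harvest` — the β-boosted junction `(U, V) = (e^β(1 − r₁/2M)e^{r₁/4M}, e^{−β}e^{r₁/4M})`, `β ≪ 0`, keeps the whole
  connector in `{0 < U < X_E}` = the exact region `D⁺({T = 0, X > −X_E})`; on the KS piece `U(r) = (1 − r/2M)e^{r/4M}e^{−c/4M}`
  is DECREASING in `r` (derivative `−e^{r/4M}(2M + r)/(8M²) < 0`), so `U ≤ U_junction`. Consistent with §8(a).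
* `stub_isotropicEnd` — elementary (`(1+M/2r)⁴ − 1 − 2M/r = 3M²/2r² + M³/2r³ + M⁴/16r⁴ = O_∞(r⁻²)`, `kCoeff ≡ 0`).
* `NullGlue….stub_roughShieldOfNullGluing` — Kehle–Unger arXiv:2304.08455: Thm A (p.16) any `M > 0, R > 0, k`; Cor. 2
  (p.4) data in `H^{7/2−} × H^{5/2−}` on `ℝ³`, exact Schwarzschild DOC + "a full double null slab … terminates at a
  spacelike singularity", glue radius `R = 2M − ε` (p.19, proof only SKETCHED); metric `C²` (p.3 L49, p.18). Plausible,
  not landable; the `C² × C¹` typing of `IsRoughKSShield` matches.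
* `stub_roughCollarRegluing` — NOTE: the conclusion does not mention `(g, κ)`; the stub is "rough shields exist ⇒ smooth
  KS-shields exist for EVERY `r₃ ∈ (0, 2M)` with `(m, a)` ε-close to `(M, 0)`". Stronger than the crux needs (one junction);
  true via PlugData + harvest (any `r₃`), via Li–Mei + scaling only for `r₃/m ≥` Li–Mei's realisable cylinder radius.
  Not refutable cheaply (no obstruction to deep junctions is known: the junction sphere is trapped, which is allowed).
* `stub_bentLeafPatching` — the two smooth data agree on the open overlap `ρ({r₃ < r < 4m})` (`bentHeight ≡ 0` on
  `r ≤ 4m`, `r₊ ≤ 2m`); admissibility's end read in the quasi-isotropic chart (§7). Plausible, size L.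

Li–Mei (arXiv:2005.01249), the route's witness, re-read: gluing surface = cylinder `{r = r₀}`, `r₀ ∈ (r₋, r₊)`; the exact
region of the MGHD contains the FUTURE SIDE `F` of `Σ⁺_I` in `K₀ = {r > r₀}` (separation + `r`-monotonicity of
past-directed causal curves + `t* → −∞`), and the typed slice shifted by a constant `c₀` lies in `F ∪ D⁻`-safe points
(`t* + r` non-decreasing to the future). Junctions `r₁ ∈ (r₀, r₊)`, spins `|a| ≤ Cδ^{1/2}`, smooth data.

Bag-of-gold cap (both `a = 0` cards): must be a scalar-flat BALL `K` with exactly-Schwarzschild(`m'`) collar whose areal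
radius INCREASES into `K`. (i) A flat such ball is impossible (developing map: the image would contain the unbounded
component of `ℝ³ ∖ S_1`). (ii) Cores of AF scalar-flat manifolds (blow-ups `(S³∖{p}, G⁴g₀)`, Corvino-glued ends) have the
OPPOSITE orientation. (iii) The right model is `K = S³ ∖ B_ε(p)` with `u⁴g₀`, `g₀` flat near `p`, `u = c(|x|⁻¹ + A)`:
areal radius `c²(A²|x| + 2A + |x|⁻¹)` increases for `|x| > 1/A`; exactness of the collar forces `u = c G_p` globally
(removable singularity, `L_{g₀}` invertible), so `m' = 2A` (blow-up mass, `> 0` iff `g₀` not conformally round) AND the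
regular part of `G_p` must have no `l ≥ 1` harmonics — generically false, and `SO(3)`-symmetry about `p` forces `A = 0`.
Hence an inside-out Corvino/Chruściel–Delay correction with the 4 parameters `(m', c)` is indispensable; the room for it
is `εA ≫ 1` (near-critical `g₀`, Beig–Ó Murchadha), errors `O(ε/A)` relative vs. an `O(1)` mass parameter. `K` then
contains a large minimal sphere (Simon–Smith) and a ball with minimal boundary — no obstruction (round hemisphere analogue).
-/

section BagOfGoldInequalities

/-- **§8(a), first inequality**: on the region-II part of the crux slice (`t*_B = 0`, `0 < r < 2m`) the left advanced
time `v_A = 2r* − r = r + 4m log(1 − r/2m)` satisfies `v_A < −r < 0`. [cite: ONeill1983, Ch. 13] -/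
theorem advancedTime_lt {m r : ℝ} (hm : 0 < m) (hr : 0 < r) (hr2 : r < 2 * m) :
    r + 4 * m * Real.log (1 - r / (2 * m)) < -r := by
  have hy : 0 < 1 - r / (2 * m) := by
    rw [sub_pos, div_lt_one (by linarith)]; exact hr2
  have hy1 : 1 - r / (2 * m) ≠ 1 := by
    intro h
    have : r / (2 * m) = 0 := by linarith
    rcases div_eq_zero_iff.1 this with h' | h' <;> linarith
  have hlog := Real.log_lt_sub_one_of_pos hy hy1
  have : 4 * m * Real.log (1 - r / (2 * m)) < 4 * m * (1 - r / (2 * m) - 1) :=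
    mul_lt_mul_of_pos_left hlog (by linarith)
  have e : 4 * m * (1 - r / (2 * m) - 1) = -(2 * r) := by field_simp; ring
  linarith

/-- **§8(a), second inequality**: a cap at left areal radius `S ≥ 3m` has `S* = S + 2m log(S/2m − 1) > 0 (> v_A)`,
so the whole typed slice stays inside the exact Kruskal region for every junction `r₁ ∈ (0, 2m)`. [cite: ONeill1983, Ch. 13] -/
theorem capThreshold_pos {m S : ℝ} (hm : 0 < m) (hS : 3 * m ≤ S) :
    0 < S + 2 * m * Real.log (S / (2 * m) - 1) := by
  have harg : (1:ℝ) / 2 ≤ S / (2 * m) - 1 := by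
    rw [le_sub_iff_add_le, le_div_iff₀ (by linarith)]; linarith
  have hlog : Real.log (1 / 2) ≤ Real.log (S / (2 * m) - 1) :=
    Real.log_le_log (by norm_num) harg
  have h2 : Real.log (1 / 2) = -Real.log 2 := by
    rw [one_div, Real.log_inv]
  have := log_two_lt
  nlinarith

end BagOfGoldInequalities

/-! ## §11 (gen 3) Why it still resists — and what WOULD kill it

Every conjunct has now a certificate or a printed witness: 1 (admissibility: Li–Mei Σ⁺ re-sliced, §10; `a = 0`:
PlugData + harvest), 2–4 (window algebra, §2), 5 (literal `T`, no junk, §3), 6 (core forced but unobstructed, §7/§10),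
7 (pins `ψ`, §6), 8–9 (vector-level certificate, §9), 10–11 (definitional on `range φ`, Gauss–Codazzi + Ricci-flatness
of the tree's model, validated numerically). A refutation would need ONE of: (a) a transcription defect making
`Kerr.smoothMetric` non-vacuum for the witness spin (ruled out numerically for all `a`, and `a = 0` witnesses exist anyway);
(b) a defect of `secondFundamentalForm`/`pullbackBilin` junk values at differentiable points (none: junk only at
non-differentiable points); (c) an incompatibility between DR rates and an exactly-Kerr far end in EVERY chart (false:
quasi-isotropic BL chart, `O(ρ⁻²)` room); (d) a topological obstruction to `E3 ⊇` (bent slice ≅ S²×ℝ) ∪ core (none: the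
core is a 3-ball); (e) a global obstruction to vacuum cores behind a trapped junction sphere (none known; Li–Mei and
Kehle–Unger construct them; Penrose/PMT are satisfied with equality-room since the exterior is exact Kerr). The disprover's
standing advice to provers is therefore unchanged: the crux is TRUE and XL; the cheapest complete witness is Li–Mei's Σ⁺
(smooth, any junction above the cylinder) once `SubdataDevelopmentsEmbed`-type exactness is available, and the cheapest
Lean-only path is the `a = 0` plug line, whose only genuinely analytic stubs are the two gluing theorems.
-/

/-! ## §12 (gen 4) Targets: the reshaped six-stub skeleton `Lines/plug-the-second-sheet.lean`

STATUS (2026-08-16T03:30Z). CLOSED in the tree: `stub_sliceClause`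
(`Summit.FinalStateConjecture.FinalStateConjecture.Theorems.SwallowTheDatum.stub_sliceClause`, file
`Theorems/SwallowTheDatumKerrShieldedDataExistStubSliceClause.lean`, exact type match kernel-checked by drefute g2; also
`Negative.sliceClause_graph_zero_spin`, p75771), `stub_isotropicEnd` (`….Theorems.SwallowTheDatum.stub_isotropicEnd`, file
`…StubIsotropicEnd.lean`), `stub_ricciFlatKS` (= `Literature.Geometry.Lorentzian.Schwarzschild.ricci_smoothMetric_zero_spin`,
`SchwarzschildKerrSchildRicciFlat.lean`: sixteen frame identities, 0 sorry). OPEN: `stub_plugData` (XL, lead),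
`stub_inducedVacuumData` (L, generic packaging), `stub_harvest` (XL, two-chart assembly). No stub is false or misstated
(drefute r1/r2 concur; this seat re-derived the items below independently).

### 12.1 `stub_harvest`: the chart-R → chart-L transition is an involutive isometry of the tree's own `Kerr.bilin M 0`,
### orientation-preserving EXACTLY on `r < 2M` (theorems `bilin_kruskalFlip`, `bilin_timeVector_kruskalFlip_neg/_pos`)

The mirror-leaf design needs the second ingoing chart `t*_L = −t*_R + 4M log(1 − r/2M)` (same `x⃗`) on region II. Its
differential at `x` is `Θ_* v = (−v⁰ + 4M⟪x⃗,v⃗⟫/(r(r − 2M)), v⃗) =: kruskalFlip M x v` (`d/dx⃗ [4M log(1 − ‖x⃗‖/2M)] =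
4M x⃗/(r(r − 2M))`). Below: `Θ_*` is an involution, `g_{M,0}(x)(Θ_* v, Θ_* w) = g_{M,0}(x)(v, w)` for `r ∉ {0, 2M}` (so the
SAME `Kerr.smoothMetric M 0 r₀` formulas serve chart L — drefute's point (2), here at the level of the 4-dimensional
`Kerr.bilin`, not only of the `(v, r)` 2-form), and `g(V, Θ_* V) = (r² + 4M²)/(r(r − 2M))` for `V = Kerr.timeVector M 0 x`:
NEGATIVE on `0 < r < 2M` (the two charts' `Kerr.timeOrientation`s agree on region II, so future unit normals and `K`
computed chart-wise glue), POSITIVE on `r > 2M` (used outside the horizon the formula lands in the PAST cone of chart R: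
it is the white-hole chart of region I / the map onto region III — a trap if the overlap is not confined to `r < 2M`).
What is left to the harvest prover here is only `HasFDerivAt Θ (kruskalFlip M x) x` (`Real.log ∘ (1 − ‖E4.spatial ·‖/2M)`,
pattern `Schwarzschild.hasFDerivAt_nu`) and the `mfderiv` bookkeeping.
-/

section KruskalFlip

variable (M : ℝ)

/-- The differential of the Kruskal reflection / chart transition `Θ(t*, x⃗) = (−t* + 4M log|1 − r/2M|, x⃗)` at `x`:
`v ↦ (−v⁰ + 4M⟪x⃗, v⃗⟫/(r(r − 2M)), v⃗)`, `r = ‖x⃗‖`. [cite: ONeill1983, Ch. 13] -/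
def kruskalFlip (x v : E4) : E4 :=
  E4.ofTimeSpace (-(v 0) + 4 * M / (E4.spatialNorm x * (E4.spatialNorm x - 2 * M)) *
    ⟪E4.spatial x, E4.spatial v⟫_ℝ) (E4.spatial v)

/-- Time component of `Θ_* v`. [cite: ONeill1983, Ch. 13] -/
@[simp] theorem kruskalFlip_apply_zero (x v : E4) :
    kruskalFlip M x v 0 = -(v 0) + 4 * M / (E4.spatialNorm x * (E4.spatialNorm x - 2 * M)) *
      ⟪E4.spatial x, E4.spatial v⟫_ℝ := by
  simp [kruskalFlip]

/-- `Θ_*` does not move the spatial part. [cite: ONeill1983, Ch. 13] -/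
@[simp] theorem spatial_kruskalFlip (x v : E4) : E4.spatial (kruskalFlip M x v) = E4.spatial v := by
  simp [kruskalFlip]

/-- `Θ_*` is an involution (so it is the differential of a local diffeomorphism with inverse of the same form).
[cite: ONeill1983, Ch. 13] -/
theorem kruskalFlip_kruskalFlip (x v : E4) : kruskalFlip M x (kruskalFlip M x v) = v := by
  have h0 : kruskalFlip M x (kruskalFlip M x v) 0 = v 0 := by simp
  have hs : E4.spatial (kruskalFlip M x (kruskalFlip M x v)) = E4.spatial v := by simp
  calc kruskalFlip M x (kruskalFlip M x v)
      = E4.ofTimeSpace (E4.time (kruskalFlip M x (kruskalFlip M x v)))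
          (E4.spatial (kruskalFlip M x (kruskalFlip M x v))) := (E4.ofTimeSpace_time_spatial _).symm
    _ = E4.ofTimeSpace (E4.time v) (E4.spatial v) := by rw [E4.time_apply, h0, hs, ← E4.time_apply]
    _ = v := E4.ofTimeSpace_time_spatial v

/-- **The chart transition is an isometry of the Schwarzschild Kerr–Schild form onto itself**:
`g_{M,0}(x)(Θ_* v, Θ_* w) = g_{M,0}(x)(v, w)` at every `x` with `r ≠ 0`, `r ≠ 2M` (both signs of `r − 2M`; the
geometric use is on region II). Equivalent 2-form statement: `dv_L = −dv_R + (2/f) dr` preserves `−f dv² + 2 dv dr`.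
[cite: ONeill1983, Ch. 13] -/
theorem bilin_kruskalFlip {x : E4} (hx : E4.spatialNorm x ≠ 0) (hx2 : E4.spatialNorm x ≠ 2 * M) (v w : E4) :
    Kerr.bilin M 0 x (kruskalFlip M x v) (kruskalFlip M x w) = Kerr.bilin M 0 x v w := by
  have h2 : E4.spatialNorm x - 2 * M ≠ 0 := sub_ne_zero.2 hx2
  have h2' : E4.spatialNorm x - M * 2 ≠ 0 := by rwa [mul_comm] at h2
  rw [Kerr.bilin_zero_spin_apply M hx, Kerr.bilin_zero_spin_apply M hx]
  simp only [kruskalFlip_apply_zero, spatial_kruskalFlip]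
  field_simp
  ring

/-- `V⁰ = 1 + 2H` for `V = Kerr.timeVector M 0 x` (`ℓ₀ = 1`). [cite: arXiv08110354, §5.1] -/
theorem timeVector_zero_spin_apply_zero (x : E4) : Kerr.timeVector M 0 x 0 = 1 + 2 * Kerr.scalarH M 0 x := by
  simp [Kerr.timeVector, Kerr.nullVector, Kerr.nullCovectorFun]

/-- `⟪x⃗, V⃗⟫ = −2H r` for `V = Kerr.timeVector M 0 x = (1 + 2H, −2H x⃗/r)`. [cite: arXiv08110354, §5.1] -/
theorem inner_spatial_timeVector_zero_spin {x : E4} (hx : E4.spatialNorm x ≠ 0) :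
    ⟪E4.spatial x, E4.spatial (Kerr.timeVector M 0 x)⟫_ℝ = -(2 * Kerr.scalarH M 0 x) * E4.spatialNorm x := by
  rw [Kerr.inner_spatial_eq]
  have hsq := E4.spatialNorm_sq x
  simp only [Kerr.timeVector, Kerr.nullVector, Kerr.nullCovectorFun, Kerr.radius_zero_left]
  simp
  field_simp
  rw [hsq]
  ring

/-- **Time orientation under the transition**: `g(V, Θ_* V) = (r² + 4M²)/(r(r − 2M))` for `V = Kerr.timeVector M 0 x`
(`r ∉ {0, 2M}`). [cite: ONeill1983, Ch. 13] -/
theorem bilin_timeVector_kruskalFlip {x : E4} (hx : E4.spatialNorm x ≠ 0) (hx2 : E4.spatialNorm x ≠ 2 * M) :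
    Kerr.bilin M 0 x (Kerr.timeVector M 0 x) (kruskalFlip M x (Kerr.timeVector M 0 x)) =
      (E4.spatialNorm x ^ 2 + 4 * M ^ 2) / (E4.spatialNorm x * (E4.spatialNorm x - 2 * M)) := by
  have h2 : E4.spatialNorm x - 2 * M ≠ 0 := sub_ne_zero.2 hx2
  have h2' : E4.spatialNorm x - M * 2 ≠ 0 := by rwa [mul_comm] at h2
  have hr : 0 < Kerr.radius 0 x := by
    rw [Kerr.radius_zero_left]; exact lt_of_le_of_ne (E4.spatialNorm_nonneg x) (Ne.symm hx)
  rw [Kerr.bilin_timeVector hr, kruskalFlip_apply_zero, timeVector_zero_spin_apply_zero,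
    inner_spatial_timeVector_zero_spin M hx, Kerr.scalarH_zero_spin M hx]
  field_simp
  ring

/-- **Inside the horizon the two ingoing charts are time-orientation COMPATIBLE**: on `0 < r < 2M`,
`g(V, Θ_* V) < 0`, i.e. `Θ_* V` lies in the cone of `V = Kerr.timeVector` (both are `g`-timelike by the isometry).
[cite: ONeill1983, Ch. 13] -/
theorem bilin_timeVector_kruskalFlip_neg {x : E4} (h0 : 0 < E4.spatialNorm x) (h2 : E4.spatialNorm x < 2 * M) :
    Kerr.bilin M 0 x (Kerr.timeVector M 0 x) (kruskalFlip M x (Kerr.timeVector M 0 x)) < 0 := by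
  rw [bilin_timeVector_kruskalFlip M h0.ne' h2.ne]
  apply div_neg_of_pos_of_neg
  · positivity
  · nlinarith

/-- **Outside the horizon the same formula REVERSES time orientation**: on `r > 2M ≥ 0`, `g(V, Θ_* V) > 0`
(there `Θ` is the passage to the outgoing/white-hole chart composed with `t ↦ −t`; its geometric image is region III,
not a re-charting of region I with the same future). The harvest's overlap must therefore be confined to `r < 2M`.
[cite: ONeill1983, Ch. 13] -/
theorem bilin_timeVector_kruskalFlip_pos (hM : 0 ≤ M) {x : E4} (h2 : 2 * M < E4.spatialNorm x) :
    0 < Kerr.bilin M 0 x (Kerr.timeVector M 0 x) (kruskalFlip M x (Kerr.timeVector M 0 x)) := by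
  have h0 : 0 < E4.spatialNorm x := by linarith
  rw [bilin_timeVector_kruskalFlip M h0.ne' h2.ne']
  apply div_pos
  · positivity
  · nlinarith

end KruskalFlip

/-! ### 12.2 `stub_plugData`: the depth `ρ₃/M` is SCALE-INVARIANT (theorem `conformalFactor_smul`)

The stub's docstring says "any such construction gives every `ρ₃/M > 0` by scaling". Not so: the homothety
`y ↦ c y`, `M ↦ c M` (under which vacuum data go to vacuum data, `(h, k) ↦ (c² σ_c^* h, c σ_c^* k)`) maps "exact on
`{‖y‖ > ρ₃}` for mass `M`" to "exact on `{‖y‖ > c ρ₃}` for mass `c M`" — the ratio `ρ₃/M` is invariant because the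
isotropic factor is (`conformalFactor_smul`). The depth `ρ₃ < M/40` (sheet-2 areal radius `> 11.0 M`) must come from WHERE
the engine places its non-exact ball (shell radius `2` versus `M₀/2 = β(A)`, i.e. `β > 40`, `A ≳ 2.4·10⁶` in the TT-shell
engine's units; or the location of the gluing annulus), not from scaling. Harmless for truth, relevant for the proof plan.
-/

section PlugScale

/-- The isotropic Schwarzschild factor is invariant under the joint scaling `(M, y) ↦ (cM, cy)`, `c > 0`
(so "exact isotropic Schwarzschild outside `‖y‖ = ρ₃`" has the scale-invariant depth `ρ₃/M`). [cite: MisnerThorneWheeler1973, (31.22)] -/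
theorem conformalFactor_smul {c : ℝ} (hc : 0 < c) (M : ℝ) (y : E3) :
    Schwarzschild.conformalFactor (c * M) (c • y) = Schwarzschild.conformalFactor M y := by
  rw [Schwarzschild.conformalFactor_apply, Schwarzschild.conformalFactor_apply, norm_smul,
    Real.norm_of_nonneg hc.le]
  rcases eq_or_ne y 0 with rfl | hy
  · simp
  · have hy' : ‖y‖ ≠ 0 := norm_ne_zero_iff.2 hy
    field_simp

end PlugScale

/-! ## §13 (gen 4) Why it still resists — three more would-be shortcuts / obstructions examined

VERDICT (gen 4): RESISTS. New this generation, all negative for the disprover: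

1. **No closed-form plug, and why (Birkhoff twice).** (i) Conformal-method plugs `(φ⁴δ, φ⁻²σ)` with `σ` TT w.r.t. `δ`,
   compactly supported: `φ` is exactly `1 + m/2ρ` outside the support iff all exterior multipoles of `|σ|²φ⁻⁷` vanish,
   e.g. if `|σ|²_δ` is RADIAL (then `φ` is radial by uniqueness for the monotone equation `−8Δφ = |σ|²φ⁻⁷`) — but the
   only spherically symmetric TT tensors on `ℝ³ ∖ 0` are `C r⁻³(dr² − ½r²dΩ²)` (traceless + `p′ + 3p/r = 0`), singular
   at `0`; a finite symmetry group (icosahedral) only kills the multipoles `1 ≤ l ≤ 5`; so exactness outside needs the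
   card's homogenisation PLUS a genuine Corvino step — no free lunch. (ii) Every SO(3)-symmetric seed/cap is conformally
   flat (Kuiper: a simply connected closed conformally flat 3-manifold is the round `S³`, Yamabe-positive, never
   critical) and every spherically symmetric scalar-flat ball with regular centre is FLAT (Riemannian Birkhoff: the
   Hawking mass `(√B/2)(1 − B′²/4AB)` of `A dρ² + B dΩ²` is constant when `R = 0`), so "Miao-type corner (flat ball ∪
   everted Schwarzschild collar, `H₋ = 2/r_b ≥ H₊ = −(2/r_b)√(1 − 2M/r_b)`, distributional `R ≥ 0`) followed by a
   conformal deformation to `R ≡ 0`" kills the whole mass in symmetry (`u = (1 + M/2ρ)⁻¹`, result flat). The bag MUST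
   break spherical symmetry, consistent with §7; the lead's engine does.
2. **No global obstruction from the inequalities of the positive-mass circle.** With the exterior exactly Schwarzschild
   down through the throat: RPI/Penrose hold with EQUALITY for the outermost minimal sphere = throat (area `16πM²`;
   all closed minimal surfaces lie in `{ρ ≤ M/2}` by the maximum principle against the mean-convex foliation of sheet 1),
   and equality only forces the EXTERIOR of the outermost minimal surface to be Schwarzschild — which it is. Geroch
   monotonicity of the Hawking mass along (weak) IMCF run INTO the bag from the collar (legal: the collar spheres are
   mean-convex towards the bag, `H = +(2/r)√(1 − 2M/r)` for the inward co-orientation, and `R_h = |k|² ≥ 0` for maximal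
   plugs) starts at `m_H = M` and can only end on a minimal surface `S ⊂ bag` with `√(|S|/16π) ≥ M`, i.e. `|S| ≥ 16πM²` —
   automatically true since areas increase from `4π(11M)²`; Shi–Tam/Brown–York need `H > 0` outward and say nothing for
   the everted collar. In the development: the bag boundary is outer-trapped w.r.t. end I but enclosed by the bifurcate
   sphere (= event-horizon cross-section, area `16πM² = 16πM²_ADM`; nothing from the bag reaches `𝓘⁺` of end I) —
   Penrose's heuristic is satisfied with equality. Nothing bites.
3. **The chart-free unbent-shield lemma (§7 near-miss) is carried by `k` ALONE.** New observation correcting the gen-2/3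
   narrative: at ORDER ZERO the unbent Kerr–Schild slice metric `h = δ + (2M/r) x̂⊗x̂ = (1 + 2M/r)dr² + r²dΩ²` (`a = 0`)
   IS DR-close to Schwarzschild in the areal-shift chart `x = (1 + M/‖z‖) z` (`r = s + M`, `s = ‖z‖`):
   `h(Dx·v, Dx·w) − (1 + 2M/s)⟪v, w⟫ = −2M² v_r w_r/(s(s + M)) + (M²/s²)⟪v_⊥, w_⊥⟫ = O(M²/s²)` with all derivatives —
   so `Negative/UnbentEndNotDR.lean` (tautological chart, metric anisotropy `4H`) does NOT generalise through the
   metric; what is chart-independent is `|k|_h = 2√3 M/r² (1 + O(M/r))` (`K_ij = −(2Mα/r²)(δ_ij − (2 + M/r)nᵢnⱼ)`, now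
   in the tree: `Kerr.data_k_zero_apply`, `KerrDataSchwarzschildExtrinsic.lean`), versus DR's `k = o(r⁻²)`. Closing
   the near-miss therefore needs: (a) an `AFEnd` built from `φ` (inverse function theorem + exclusion of end-swapping by
   a volume argument), (b) the tree's transition machinery (`AsymptoticFlatnessTransition.hCoeff_transition`,
   `ADMTransitionRotation`: `DG → O ∈ O(3)`, `‖DG‖ ≤ 2`, `|G(y)| ~ |y|`) applied to `k` (a `kCoeff_transition` law),
   (c) the scalar lower bound on `|k|_h` from `Kerr.data_k_zero_apply`. All ingredients except (a) and the `k`-law now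
   exist; size L. Kept as the standing near-miss; the crux bends to Boyer–Lindquist precisely to make `k ≡ 0` far out.
4. **Literature** (`lit search` down all session, rc 75 ×4; galaxy substring search unusable for this query — recorded
   as search-degraded): no printed PlugData (exact Schwarzschild THROUGH the throat with a one-ball complement) is known
   to this seat; nearest: Miao, Proc. AMS 132 (2004) (scalar-flat `ℝ³` with a stable minimal sphere), Corvino 2000 /
   Chruściel–Delay 2003 (far-zone exactness; annulus gluing modulo KIDs, `span{N}` on any Schwarzschild annulus — the
   sheet-2 collar is ISOMETRIC to a sheet-1 annulus under `ρ ↦ M²/4ρ`, so its KID space is the same line),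
   Mantoulidis–Schoen 2015 (`R ≥ 0`, not vacuum), Czimek–Rodnianski / Mao–Oh–Tao 2022–23 (obstruction-free far-zone
   gluing). None is an obstruction.

Standing advice unchanged: crux TRUE, XL; for the lead, §12.1 supplies the chart-L isometry and its orientation
window, §12.2 the warning that depth is not obtained by scaling.
-/

/-! ### §13.3 made precise: the unbent slice METRIC is DR at order zero in the areal-shift chart (0 sorry)

`arealShift M z = (1 + M/‖z‖) z` (`‖x‖ = ‖z‖ + M`), differential `arealShiftD` (`hasFDerivAt_arealShift`,
`arealShiftD_eq`); with `h = Kerr.hRep M` — the tree's closed form of the unbent slice metric `(Kerr.data M 0 r₀).h`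
(`Kerr.data_h_inner_zero_apply`) — the exact defect identity `hRep_arealShift` and the bound
`abs_hRep_arealShift_sub_le : |h_x(Dx v, Dx w) − (1 + 2M/s)⟪v, w⟫| ≤ 3M²/s² ‖v‖‖w‖`. Consequence for the standing
near-miss `unbentShield_not_admissible`: its proof cannot go through the order-zero metric rate (as the chart-specific
`Negative/UnbentEndNotDR.lean` does); it must use `k`: `hRep_self`, `kRep_self`, `kRep_self_div_ge` below give the
chart-independent radial ratio `k_y(y,y)/h_y(y,y) = 2M(1 + M/r)/(r²(1 + 2M/r)^{3/2}) ≥ M/(2r²)` (`r ≥ 2M`) — see §13 item 3.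
Landable twin: `Theorems/KerrShieldedDataExist/Negative/UnbentArealShift.lean` (proposal pending the gate).
-/

section ArealShift

/-- The areal-shift chart `x = (1 + M/‖z‖) z` of `E3 ∖ 0` (so that `‖x‖ = ‖z‖ + M` for `M ≥ 0`: the Kerr–Schild
radius `r` against the shifted radius `s = r − M`). [cite: Cook2000, §3.2.2] -/
def arealShift (M : ℝ) (z : E3) : E3 := (1 + M / ‖z‖) • z

/-- The differential of the areal shift: `v ↦ (1 + M/‖z‖) v − (M⟪z, v⟫/‖z‖³) z`. [cite: Cook2000, §3.2.2] -/
def arealShiftD (M : ℝ) (z v : E3) : E3 := (1 + M / ‖z‖) • v - (M * ⟪z, v⟫_ℝ / ‖z‖ ^ 3) • z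

/-- The areal shift is differentiable off the origin, with the stated differential (as a continuous linear map).
[cite: Cook2000, §3.2.2] -/
theorem hasFDerivAt_arealShift (M : ℝ) {z : E3} (hz : z ≠ 0) :
    HasFDerivAt (arealShift M)
      ((1 + M / ‖z‖) • ContinuousLinearMap.id ℝ E3 +
        ((-(1:ℕ) : ℝ) / ‖z‖ ^ (1 + 2) * M) • (E3.covec z).smulRight z) z := by
  have h1 : HasFDerivAt (fun y : E3 ↦ M * (‖y‖ ^ 1)⁻¹) (M • ((-(1 : ℕ) : ℝ) / ‖z‖ ^ (1 + 2)) • E3.covec z) z :=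
    (Kerr.hasFDerivAt_inv_norm_pow hz 1).const_mul M
  have h2 : HasFDerivAt (fun y : E3 ↦ 1 + M * (‖y‖ ^ 1)⁻¹) (M • ((-(1 : ℕ) : ℝ) / ‖z‖ ^ (1 + 2)) • E3.covec z) z :=
    h1.const_add 1
  have h3 := h2.smul (hasFDerivAt_id z)
  have hfun : arealShift M = fun y : E3 ↦ (1 + M * (‖y‖ ^ 1)⁻¹) • y := by
    funext y; simp [arealShift, div_eq_mul_inv]
  rw [hfun]
  refine h3.congr_fderiv ?_
  ext v
  simp [ContinuousLinearMap.smulRight_apply, E3.covec_apply, div_eq_mul_inv]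
  ring

/-- The continuous linear map of `hasFDerivAt_arealShift` is `arealShiftD`. [cite: Cook2000, §3.2.2] -/
theorem arealShiftD_eq (M : ℝ) (z v : E3) :
    ((1 + M / ‖z‖) • ContinuousLinearMap.id ℝ E3 +
        ((-(1:ℕ) : ℝ) / ‖z‖ ^ (1 + 2) * M) • (E3.covec z).smulRight z) v = arealShiftD M z v := by
  simp [arealShiftD, ContinuousLinearMap.smulRight_apply, E3.covec_apply, sub_eq_add_neg, div_eq_mul_inv,
    smul_smul]
  ring_nf

/-- `‖(1 + M/‖z‖) z‖ = ‖z‖ + M` for `M ≥ 0`, `z ≠ 0`. [cite: Cook2000, §3.2.2] -/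
theorem norm_arealShift {M : ℝ} (hM : 0 ≤ M) {z : E3} (hz : z ≠ 0) : ‖arealShift M z‖ = ‖z‖ + M := by
  have hn : 0 < ‖z‖ := norm_pos_iff.2 hz
  rw [arealShift, norm_smul, Real.norm_of_nonneg (by positivity)]
  field_simp

/-- **The unbent Kerr–Schild slice metric is DR-close to Schwarzschild at order zero in the areal-shift chart**
(exact defect): with `h = Kerr.hRep M` (`h_y = δ + (2M/‖y‖³)⟪y,·⟫⊗⟪y,·⟫ = (1 + 2M/r)dr² + r²dΩ²`), `x = (1 + M/s)z`,
`s = ‖z‖`: `h_x(Dx v, Dx w) − (1 + 2M/s)⟪v, w⟫ = (M²/s²)(⟪v,w⟫ − ⟪z,v⟫⟪z,w⟫/s²) − (2M²/(s(s+M)))⟪z,v⟫⟪z,w⟫/s²`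
(tangential `+M²/s²`, radial `−2M²/(s(s+M))`). [cite: Cook2000, §3.2.2 (55)] -/
theorem hRep_arealShift {M : ℝ} (hM : 0 ≤ M) {z : E3} (hz : z ≠ 0) (v w : E3) :
    Kerr.hRep M (arealShift M z) (arealShiftD M z v) (arealShiftD M z w) - (1 + 2 * M / ‖z‖) * ⟪v, w⟫_ℝ =
      M ^ 2 / ‖z‖ ^ 2 * (⟪v, w⟫_ℝ - ⟪z, v⟫_ℝ * ⟪z, w⟫_ℝ / ‖z‖ ^ 2) -
        2 * M ^ 2 / (‖z‖ * (‖z‖ + M)) * (⟪z, v⟫_ℝ * ⟪z, w⟫_ℝ / ‖z‖ ^ 2) := by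
  have hn : 0 < ‖z‖ := norm_pos_iff.2 hz
  have hn' : ‖z‖ ≠ 0 := hn.ne'
  have hsM : ‖z‖ + M ≠ 0 := by positivity
  have hzz : ⟪z, z⟫_ℝ = ‖z‖ ^ 2 := real_inner_self_eq_norm_sq z
  rw [Kerr.hRep_apply, norm_arealShift hM hz]
  simp only [arealShift, arealShiftD, inner_sub_left, inner_sub_right, inner_smul_left, inner_smul_right,
    RCLike.conj_to_real, hzz, real_inner_comm z v]
  rw [real_inner_comm w v]
  field_simp
  ring

/-- **Order-zero DR rate of the unbent slice in the areal-shift chart**: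
`|h_x(Dx v, Dx w) − (1 + 2M/s)⟪v, w⟫| ≤ (3M²/s²) ‖v‖ ‖w‖` — an `O(r⁻²) = o(r⁻¹)` defect, so the metric part of
`IsStronglyAsymptoticallyFlatDR` (order `m = 0`) does NOT obstruct the unbent shield in this chart; the obstruction of
§7/§13.3 lives in `k`. [cite: Cook2000, §3.2.2 (55)–(57)] -/
theorem abs_hRep_arealShift_sub_le {M : ℝ} (hM : 0 ≤ M) {z : E3} (hz : z ≠ 0) (v w : E3) :
    |Kerr.hRep M (arealShift M z) (arealShiftD M z v) (arealShiftD M z w) - (1 + 2 * M / ‖z‖) * ⟪v, w⟫_ℝ| ≤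
      3 * M ^ 2 / ‖z‖ ^ 2 * (‖v‖ * ‖w‖) := by
  rw [hRep_arealShift hM hz]
  have hn : 0 < ‖z‖ := norm_pos_iff.2 hz
  set zr : E3 := (‖z‖⁻¹) • z with hzr
  have hzr1 : ‖zr‖ = 1 := by rw [hzr, norm_smul, norm_inv, norm_norm, inv_mul_cancel₀ hn.ne']
  have hv : ⟪z, v⟫_ℝ = ‖z‖ * ⟪zr, v⟫_ℝ := by
    rw [hzr, inner_smul_left, RCLike.conj_to_real]; field_simp
  have hw : ⟪z, w⟫_ℝ = ‖z‖ * ⟪zr, w⟫_ℝ := by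
    rw [hzr, inner_smul_left, RCLike.conj_to_real]; field_simp
  have hav : |⟪zr, v⟫_ℝ| ≤ ‖v‖ := by simpa [hzr1] using abs_real_inner_le_norm zr v
  have haw : |⟪zr, w⟫_ℝ| ≤ ‖w‖ := by simpa [hzr1] using abs_real_inner_le_norm zr w
  set vt : E3 := v - ⟪zr, v⟫_ℝ • zr with hvt
  set wt : E3 := w - ⟪zr, w⟫_ℝ • zr with hwt
  have hzrzr : ⟪zr, zr⟫_ℝ = 1 := by rw [real_inner_self_eq_norm_sq, hzr1]; norm_num
  have htang : ⟪v, w⟫_ℝ - ⟪z, v⟫_ℝ * ⟪z, w⟫_ℝ / ‖z‖ ^ 2 = ⟪vt, wt⟫_ℝ := by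
    rw [hv, hw, hvt, hwt]
    simp only [inner_sub_left, inner_sub_right, inner_smul_left, inner_smul_right, RCLike.conj_to_real, hzrzr,
      real_inner_comm zr v]
    rw [real_inner_comm w zr]
    field_simp
    ring
  have hvt_le : ‖vt‖ ≤ ‖v‖ := by
    have : ‖vt‖ ^ 2 = ‖v‖ ^ 2 - ⟪zr, v⟫_ℝ ^ 2 := by
      rw [hvt, ← real_inner_self_eq_norm_sq, ← real_inner_self_eq_norm_sq]
      simp only [inner_sub_left, inner_sub_right, inner_smul_left, inner_smul_right, RCLike.conj_to_real, hzrzr,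
        real_inner_comm zr v]
      ring
    nlinarith [norm_nonneg vt, norm_nonneg v, sq_nonneg ⟪zr, v⟫_ℝ]
  have hwt_le : ‖wt‖ ≤ ‖w‖ := by
    have : ‖wt‖ ^ 2 = ‖w‖ ^ 2 - ⟪zr, w⟫_ℝ ^ 2 := by
      rw [hwt, ← real_inner_self_eq_norm_sq, ← real_inner_self_eq_norm_sq]
      simp only [inner_sub_left, inner_sub_right, inner_smul_left, inner_smul_right, RCLike.conj_to_real, hzrzr,
        real_inner_comm zr w]
      ring
    nlinarith [norm_nonneg wt, norm_nonneg w, sq_nonneg ⟪zr, w⟫_ℝ]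
  have h1 : |⟪vt, wt⟫_ℝ| ≤ ‖v‖ * ‖w‖ :=
    (abs_real_inner_le_norm vt wt).trans (mul_le_mul hvt_le hwt_le (norm_nonneg _) (norm_nonneg _))
  have h2 : |⟪z, v⟫_ℝ * ⟪z, w⟫_ℝ / ‖z‖ ^ 2| ≤ ‖v‖ * ‖w‖ := by
    rw [hv, hw, show ‖z‖ * ⟪zr, v⟫_ℝ * (‖z‖ * ⟪zr, w⟫_ℝ) / ‖z‖ ^ 2 = ⟪zr, v⟫_ℝ * ⟪zr, w⟫_ℝ by
      field_simp]
    rw [abs_mul]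
    exact mul_le_mul hav haw (abs_nonneg _) (norm_nonneg _)
  rw [htang]
  have hc1 : 0 ≤ M ^ 2 / ‖z‖ ^ 2 := by positivity
  have hc2 : 0 ≤ 2 * M ^ 2 / (‖z‖ * (‖z‖ + M)) := by positivity
  have hc2' : 2 * M ^ 2 / (‖z‖ * (‖z‖ + M)) ≤ 2 * M ^ 2 / ‖z‖ ^ 2 := by
    apply div_le_div_of_nonneg_left (by positivity) (by positivity)
    nlinarith
  calc |M ^ 2 / ‖z‖ ^ 2 * ⟪vt, wt⟫_ℝ - 2 * M ^ 2 / (‖z‖ * (‖z‖ + M)) * (⟪z, v⟫_ℝ * ⟪z, w⟫_ℝ / ‖z‖ ^ 2)|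
      ≤ |M ^ 2 / ‖z‖ ^ 2 * ⟪vt, wt⟫_ℝ| + |2 * M ^ 2 / (‖z‖ * (‖z‖ + M)) * (⟪z, v⟫_ℝ * ⟪z, w⟫_ℝ / ‖z‖ ^ 2)| :=
        abs_sub _ _
    _ = M ^ 2 / ‖z‖ ^ 2 * |⟪vt, wt⟫_ℝ| + 2 * M ^ 2 / (‖z‖ * (‖z‖ + M)) * |⟪z, v⟫_ℝ * ⟪z, w⟫_ℝ / ‖z‖ ^ 2| := by
        rw [abs_mul, abs_mul, abs_of_nonneg hc1, abs_of_nonneg hc2]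
    _ ≤ M ^ 2 / ‖z‖ ^ 2 * (‖v‖ * ‖w‖) + 2 * M ^ 2 / ‖z‖ ^ 2 * (‖v‖ * ‖w‖) :=
        add_le_add (mul_le_mul_of_nonneg_left h1 hc1) (mul_le_mul hc2' h2 (abs_nonneg _) (by positivity))
    _ = 3 * M ^ 2 / ‖z‖ ^ 2 * (‖v‖ * ‖w‖) := by ring

end ArealShift

section RadialK

/-- The unbent slice metric on the position vector: `h_y(y, y) = ‖y‖² (1 + 2M/‖y‖)`. [cite: Cook2000, §3.2.2 (55)] -/
theorem hRep_self (M : ℝ) {y : E3} (hy : y ≠ 0) : Kerr.hRep M y y y = ‖y‖ ^ 2 * (1 + 2 * M / ‖y‖) := by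
  have hn : ‖y‖ ≠ 0 := norm_ne_zero_iff.2 hy
  rw [Kerr.hRep_apply, real_inner_self_eq_norm_sq]
  field_simp

/-- The unbent slice second fundamental form on the position vector (closed form `Kerr.kRep`, the tree's
`(Kerr.data M 0 r₀).k` by `Kerr.data_k_zero_apply`): `k_y(y, y) = 2M (1 + M/‖y‖)/√(1 + 2M/‖y‖)`.
[cite: Cook2000, §3.2.2 (57)] -/
theorem kRep_self (M : ℝ) {y : E3} (hy : y ≠ 0) :
    Kerr.kRep M y y y = 2 * M * (1 + M / ‖y‖) / √(1 + 2 * M / ‖y‖) := by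
  have hn : ‖y‖ ≠ 0 := norm_ne_zero_iff.2 hy
  rw [Kerr.kRep, real_inner_self_eq_norm_sq]
  field_simp
  ring

/-- **The radial second fundamental form of the unbent slice is of exact order `M/r²` relative to the metric**:
for `0 < M` and `‖y‖ ≥ 2M`, `k_y(y, y) / h_y(y, y) ≥ M/(2‖y‖²)` (indeed `= 2M(1 + M/r)/(r²(1 + 2M/r)^{3/2})`).
Being the ratio of the `(0,2)`-tensor `k` to the metric `h` on one vector, this is chart-independent; it is the
quantity that forbids `k = o(r⁻²)` in any chart asymptotic to the Kerr–Schild one (the chart-free obstruction to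
the unbent shield). [cite: Cook2000, §3.2.2 (57)] -/
theorem kRep_self_div_ge {M : ℝ} (hM : 0 < M) {y : E3} (hy : 2 * M ≤ ‖y‖) :
    M / (2 * ‖y‖ ^ 2) ≤ Kerr.kRep M y y y / Kerr.hRep M y y y := by
  have hn : 0 < ‖y‖ := by linarith
  have hy0 : y ≠ 0 := norm_pos_iff.1 hn
  rw [kRep_self M hy0, hRep_self M hy0]
  set r := ‖y‖ with hr
  have hu : 0 < 1 + 2 * M / r := by positivity
  set S := √(1 + 2 * M / r) with hSdef
  have hS : 0 < S := Real.sqrt_pos.2 hu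
  have hS2 : S ^ 2 = 1 + 2 * M / r := Real.sq_sqrt hu.le
  -- `S ≤ 3/2` since `S² = 1 + 2M/r ≤ 2 ≤ 9/4`
  have hle1 : 2 * M / r ≤ 1 := by rw [div_le_one hn]; exact hy
  have hle2 : 1 + 2 * M / r ≤ 2 := by linarith
  have hSle : S ≤ 3 / 2 := by nlinarith [hS2, hS]
  have hMr : 0 ≤ M / r := by positivity
  have key : S ^ 2 * S ≤ 4 * (1 + M / r) := by
    rw [hS2]; nlinarith [hSle, hle2, hS.le]
  rw [← hS2, div_le_div_iff₀ (by positivity) (by positivity), div_mul_eq_mul_div, le_div_iff₀ hS]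
  have hMr2 : 0 ≤ M * r ^ 2 := by positivity
  calc M * (r ^ 2 * S ^ 2) * S = (M * r ^ 2) * (S ^ 2 * S) := by ring
    _ ≤ (M * r ^ 2) * (4 * (1 + M / r)) := mul_le_mul_of_nonneg_left key hMr2
    _ = 2 * M * (1 + M / r) * (2 * r ^ 2) := by ring

/-- **Lemma A towards the chart-free unbent-shield lemma.** In ANY datum `D` on `E3` that carries the unbent
Schwarzschild Kerr–Schild slice through `φ` (the crux's pull-back identities with `T ≡ 0`, `a = 0`), the chart-free
ratio `k/h` on the pushed-forward radial vector at `φ(y)` is at least `M/(2‖y‖²)` once `‖y‖ ≥ 2M` — so `D.k` is not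
`o(r⁻²)` relative to `D.h` along the shield, whatever chart one reads the end in; what remains for the near-miss is the
comparison of the Kerr–Schild radius with the radius of the admissible end's chart. [cite: Cook2000, §3.2.2 (57)] -/
theorem unbentShield_radial_ratio [Kerr.Facts] [Kerr.SliceFacts] {M : ℝ} (hM : 0 < M) {r₁ : ℝ}
    (D : InitialDataSet (𝓡 3) E3) (φ : Kerr.slice 0 r₁ → E3)
    (hh : ∀ y : Kerr.slice 0 r₁, pullbackBilin (I := 𝓡 3) (I' := 𝓘(ℝ, E3)) φ D.h.inner y =
      (Kerr.data M 0 r₁ hM.le).h.inner y)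
    (hk : ∀ y : Kerr.slice 0 r₁, pullbackBilin (I := 𝓡 3) (I' := 𝓘(ℝ, E3)) φ D.k y =
      (Kerr.data M 0 r₁ hM.le).k y)
    (y : Kerr.slice 0 r₁) (hy : 2 * M ≤ ‖(y : E3)‖) :
    M / (2 * ‖(y : E3)‖ ^ 2) ≤
      pullbackBilin (I := 𝓡 3) (I' := 𝓘(ℝ, E3)) φ D.k y (y : E3) (y : E3) /
        pullbackBilin (I := 𝓡 3) (I' := 𝓘(ℝ, E3)) φ D.h.inner y (y : E3) (y : E3) := by
  rw [hh y, hk y, Kerr.data_h_inner_zero_apply M hM.le y, Kerr.data_k_zero_apply M hM.le y]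
  exact kRep_self_div_ge hM hy

/-- **Lemma A′ (all radii).** For `M > 0` and every `y ≠ 0`:
`k_y(y,y)/h_y(y,y) ≥ M/(‖y‖² √(1 + 2M/‖y‖)) = M/(r^{3/2}√(r + 2M))` — positive at every radius, `~ M/r²` at infinity and
`→ ∞` at the origin; so the chart-free ratio is bounded below on every bounded punctured ball as well (this serves the
end-swapping branch of the radius comparison). [cite: Cook2000, §3.2.2 (57)] -/
theorem kRep_self_div_ge' {M : ℝ} (hM : 0 < M) {y : E3} (hy : y ≠ 0) :
    M / (‖y‖ ^ 2 * √(1 + 2 * M / ‖y‖)) ≤ Kerr.kRep M y y y / Kerr.hRep M y y y := by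
  have hn : 0 < ‖y‖ := norm_pos_iff.2 hy
  rw [kRep_self M hy, hRep_self M hy]
  set r := ‖y‖ with hr
  have hu : 0 < 1 + 2 * M / r := by positivity
  set S := √(1 + 2 * M / r) with hSdef
  have hS : 0 < S := Real.sqrt_pos.2 hu
  have hS2 : S ^ 2 = 1 + 2 * M / r := Real.sq_sqrt hu.le
  rw [← hS2, div_le_div_iff₀ (by positivity) (by positivity), div_mul_eq_mul_div, le_div_iff₀ hS]
  -- M (r² S²) S ≤ 2M(1 + M/r)(r² S) ⇔ S² ≤ 2(1 + M/r) = 1 + S²... i.e. S² ≤ 2 + 2M/r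
  have key : S ^ 2 ≤ 2 * (1 + M / r) := by
    rw [hS2]
    have h1 : 2 * M / r = 2 * (M / r) := by ring
    have h2 : 0 ≤ M / r := by positivity
    linarith
  have hpos : 0 ≤ M * r ^ 2 * S := by positivity
  calc M * (r ^ 2 * S ^ 2) * S = (M * r ^ 2 * S) * S ^ 2 := by ring
    _ ≤ (M * r ^ 2 * S) * (2 * (1 + M / r)) := mul_le_mul_of_nonneg_left key hpos
    _ = 2 * M * (1 + M / r) * (r ^ 2 * S) := by ring

end RadialK

section FarRegion

/-- **Far regions eventually avoid any compact set.** For an end structure `e` of `X` (closed at infinity) and a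
compact `K ⊆ X` there is a radius `R'` with `e.far R' ∩ K = ∅` (the closed sets `Φ({R + n + 1 ≤ ‖x‖})` decrease to `∅`;
finite-intersection property). Used with `K = (range φ)ᶜ`: far out, the admissible end lies inside the shield's image —
no inverse-function or end-swapping argument is needed in that direction. [cite: Bartnik1986, §1] -/
theorem exists_far_inter_eq_empty {X : Type*} [TopologicalSpace X] [ChartedSpace E3 X] (e : AFEnd X)
    {K : Set X} (hK : IsCompact K) : ∃ R' : ℝ, e.R < R' ∧ e.far R' ∩ K = ∅ := by
  -- closed neighbourhoods of infinity `F n = Φ({R + n + 1 ≤ ‖x‖})`, decreasing, with empty intersection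
  set F : ℕ → Set X := fun n ↦ ((↑) : e.U → X) '' (e.chart ⁻¹' {x | e.R + n + 1 ≤ ‖(x : E3)‖}) with hF
  have hFc : ∀ n, IsClosed (F n) := fun n ↦ e.isClosed_far _ (by have := n.cast_nonneg (α := ℝ); linarith)
  have hanti : ∀ {m n : ℕ}, m ≤ n → F n ⊆ F m := by
    intro m n hmn
    rintro _ ⟨z, hz, rfl⟩
    refine ⟨z, ?_, rfl⟩
    have hmn' : (m : ℝ) ≤ n := Nat.cast_le.2 hmn
    simp only [mem_preimage, mem_setOf_eq] at hz ⊢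
    linarith
  have hFd : Directed (· ⊇ ·) F := fun m n ↦
    ⟨max m n, hanti (le_max_left m n), hanti (le_max_right m n)⟩
  have hFi : K ∩ ⋂ n, F n = ∅ := by
    ext p
    simp only [mem_inter_iff, mem_iInter, mem_empty_iff_false, iff_false, not_and, not_forall]
    intro _
    by_cases hp : p ∈ (e.U : Set X)
    · obtain ⟨n, hn⟩ := exists_nat_gt (‖(e.chart ⟨p, hp⟩ : E3)‖ - e.R - 1)
      refine ⟨n, ?_⟩
      rintro ⟨z, hz, hzp⟩
      have : z = ⟨p, hp⟩ := Subtype.ext hzp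
      subst this
      simp only [mem_preimage, mem_setOf_eq] at hz
      linarith
    · refine ⟨0, ?_⟩
      rintro ⟨z, -, rfl⟩
      exact hp z.2
  obtain ⟨n, hn⟩ := hK.elim_directed_family_closed F hFc hFi hFd
  refine ⟨e.R + n + 1, by have := n.cast_nonneg (α := ℝ); linarith, ?_⟩
  rw [Set.inter_comm, ← Set.subset_empty_iff, ← hn]
  exact Set.inter_subset_inter_right _ (by
    rintro _ ⟨z, hz, rfl⟩
    refine ⟨z, ?_, rfl⟩
    simp only [mem_preimage, mem_setOf_eq] at hz ⊢
    exact le_of_lt hz)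

end FarRegion


section DRSide

open Filter Asymptotics Bornology Topology

/-- **Lemma B (DR side) towards the chart-free unbent-shield lemma.** In a Dafermos–Rodnianski chart of ANY end, the
second fundamental form is `o(r⁻²)` RELATIVE TO THE METRIC on every single vector: for every `ε > 0`, far out in the
chart, `|k_x(v, v)| ≤ ε ‖x‖⁻² h_x(v, v)` for all `v` (order-zero parts of `IsStronglyAsymptoticallyFlatDR`: `‖h − (1+2M/r)δ‖ → 0`
gives `h_x(v,v) ≥ ‖v‖²/2`, and `‖k_x‖ = o(‖x‖⁻²)`). With `unbentShield_radial_ratio` (`≥ M/(2‖y‖²)` in the Kerr–Schild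
radius) the standing near-miss is reduced to comparing the two radii along the shield (volume growth; see the work file
§13.3). [cite: DafermosRodnianski2013, App. B.2.3] -/
theorem eventually_abs_kCoeff_le {X : Type*} [TopologicalSpace X] [ChartedSpace E3 X] [IsManifold (𝓡 3) ∞ X]
    (e : AFEnd X) (D : InitialDataSet (𝓡 3) X) {M : ℝ}
    (hDR : e.IsStronglyAsymptoticallyFlatDR D M) {ε : ℝ} (hε : 0 < ε) :
    ∀ᶠ x in cobounded E3, ∀ v : E3,
      |AFEnd.kCoeff e D x v v| ≤ ε * ‖x‖ ^ (-2 : ℝ) * AFEnd.hCoeff e D x v v := by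
  -- order-zero parts of the DR conditions
  have hh := hDR.1 0 (Nat.zero_le _)
  have hk := hDR.2 0 (Nat.zero_le _)
  simp only [CharP.cast_eq_zero, sub_zero, norm_iteratedFDeriv_zero] at hh hk
  -- (1) h-part tends to 0 in operator norm: o(‖x‖⁻¹) and ‖x‖⁻¹ → 0
  have hh0 : Tendsto (fun x : E3 ↦ ‖AFEnd.hCoeff e D x - (1 + 2 * M / ‖x‖) • (innerSL ℝ : E3 →L[ℝ] E3 →L[ℝ] ℝ)‖)
      (cobounded E3) (𝓝 0) := by
    have h1 : Tendsto (fun x : E3 ↦ ‖x‖ ^ (-(1:ℝ))) (cobounded E3) (𝓝 0) :=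
      (tendsto_rpow_neg_atTop (by norm_num : (0:ℝ) < 1)).comp (tendsto_norm_cobounded_atTop (E := E3))
    have h2 := hh.trans_tendsto h1
    simpa using h2
  -- the coefficient 2M/‖x‖ → 0
  have hM0 : Tendsto (fun x : E3 ↦ 2 * M / ‖x‖) (cobounded E3) (𝓝 0) := by
    have := (tendsto_norm_cobounded_atTop (E := E3)).inv_tendsto_atTop.const_mul (2 * M)
    simpa [div_eq_mul_inv] using this
  -- (2) far out: ‖h − (1+2M/r)δ‖ ≤ 1/4 and |2M/r| ≤ 1/4, hence h(v,v) ≥ ‖v‖²/2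
  have hA : ∀ᶠ x in cobounded E3,
      ‖AFEnd.hCoeff e D x - (1 + 2 * M / ‖x‖) • (innerSL ℝ : E3 →L[ℝ] E3 →L[ℝ] ℝ)‖ ≤ 1 / 4 := by
    have := hh0.eventually (gt_mem_nhds (by norm_num : (0:ℝ) < 1 / 4))
    exact this.mono fun x hx ↦ by simpa using hx.le
  have hB : ∀ᶠ x in cobounded E3, |2 * M / ‖x‖| ≤ 1 / 4 := by
    have := hM0.abs.eventually (gt_mem_nhds (by simp : |(0:ℝ)| < 1 / 4))
    exact this.mono fun x hx ↦ le_of_lt hx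
  -- (3) k-part: ‖k_x‖ ≤ (ε/2) ‖x‖⁻²
  have hC : ∀ᶠ x in cobounded E3, ‖AFEnd.kCoeff e D x‖ ≤ ε / 2 * ‖x‖ ^ (-2 : ℝ) := by
    have := hk.def (by positivity : 0 < ε / 2)
    refine this.mono fun x hx ↦ ?_
    simpa [Real.norm_eq_abs, abs_of_nonneg (Real.rpow_nonneg (norm_nonneg x) _)] using hx
  filter_upwards [hA, hB, hC] with x hxA hxB hxC v
  -- metric lower bound
  set B := AFEnd.hCoeff e D x - (1 + 2 * M / ‖x‖) • (innerSL ℝ : E3 →L[ℝ] E3 →L[ℝ] ℝ) with hBdef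
  have hBv : |B v v| ≤ 1 / 4 * ‖v‖ ^ 2 := by
    calc |B v v| = ‖B v v‖ := (Real.norm_eq_abs _).symm
      _ ≤ ‖B‖ * ‖v‖ * ‖v‖ := B.le_opNorm₂ v v
      _ ≤ 1 / 4 * ‖v‖ * ‖v‖ := by gcongr
      _ = 1 / 4 * ‖v‖ ^ 2 := by ring
  have hI : (innerSL ℝ : E3 →L[ℝ] E3 →L[ℝ] ℝ) v v = ‖v‖ ^ 2 := by
    rw [← real_inner_self_eq_norm_sq v]; rfl
  have hhv : AFEnd.hCoeff e D x v v = B v v + (1 + 2 * M / ‖x‖) * ‖v‖ ^ 2 := by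
    rw [hBdef, sub_apply, sub_apply, smul_apply, smul_apply, hI, smul_eq_mul]
    ring
  have hlow : ‖v‖ ^ 2 / 2 ≤ AFEnd.hCoeff e D x v v := by
    rw [hhv]
    have := abs_le.1 hBv
    have := abs_le.1 hxB
    nlinarith [sq_nonneg ‖v‖]
  -- k upper bound
  have hkv : |AFEnd.kCoeff e D x v v| ≤ ε / 2 * ‖x‖ ^ (-2 : ℝ) * ‖v‖ ^ 2 := by
    calc |AFEnd.kCoeff e D x v v| = ‖AFEnd.kCoeff e D x v v‖ := (Real.norm_eq_abs _).symm
      _ ≤ ‖AFEnd.kCoeff e D x‖ * ‖v‖ * ‖v‖ := (AFEnd.kCoeff e D x).le_opNorm₂ v v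
      _ ≤ ε / 2 * ‖x‖ ^ (-2 : ℝ) * ‖v‖ * ‖v‖ := by gcongr
      _ = ε / 2 * ‖x‖ ^ (-2 : ℝ) * ‖v‖ ^ 2 := by ring
  have hpos : 0 ≤ ε * ‖x‖ ^ (-2 : ℝ) := by positivity
  calc |AFEnd.kCoeff e D x v v| ≤ ε / 2 * ‖x‖ ^ (-2 : ℝ) * ‖v‖ ^ 2 := hkv
    _ = ε * ‖x‖ ^ (-2 : ℝ) * (‖v‖ ^ 2 / 2) := by ring
    _ ≤ ε * ‖x‖ ^ (-2 : ℝ) * AFEnd.hCoeff e D x v v := mul_le_mul_of_nonneg_left hlow hpos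

end DRSide




/-! ## The chart-free unbent-shield lemma (`a = 0`): local-diffeomorphism and chart calculus, assembly -/

namespace ChartFree

open Set Filter Topology Function Asymptotics Bornology
open Literature.Geometry.Lorentzian.AFEnd




variable {U : TopologicalSpace.Opens E3}

open scoped Classical in
/-- Total representative of a map out of an open subset (junk `0` outside). -/
def rep (φ : U → E3) (y : E3) : E3 := if h : y ∈ U then φ ⟨y, h⟩ else 0

/-- Auxiliary step of the chart-free unbent-shield lemma (§13.4). [folklore] -/
theorem rep_eq (φ : U → E3) (y : U) : φ y = rep φ y := by
  unfold rep
  rw [dif_pos y.2]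

/-- Auxiliary step of the chart-free unbent-shield lemma (§13.4). [folklore] -/
theorem contDiffAt_rep {φ : U → E3} (hφs : ContMDiff 𝓘(ℝ, E3) (𝓡 3) ∞ φ) (y : U) :
    ContDiffAt ℝ ∞ (rep φ) y :=
  (OpensChart.contMDiffAt_iff y φ (rep φ) (rep_eq φ)).1 (hφs y)

/-- Auxiliary step of the chart-free unbent-shield lemma (§13.4). [folklore] -/
theorem mfderiv_eq_fderiv_rep {φ : U → E3} (hφs : ContMDiff 𝓘(ℝ, E3) (𝓡 3) ∞ φ) (y : U) :
    mfderiv 𝓘(ℝ, E3) (𝓡 3) φ y = fderiv ℝ (rep φ) y :=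
  OpensChart.mfderiv_eq y φ (rep φ) (rep_eq φ) ((contDiffAt_rep hφs y).differentiableAt (by simp))

/-- Auxiliary step of the chart-free unbent-shield lemma (§13.4). [folklore] -/
theorem hasStrictFDerivAt_rep {φ : U → E3} (hφs : ContMDiff 𝓘(ℝ, E3) (𝓡 3) ∞ φ) (y : U) :
    HasStrictFDerivAt (rep φ) (fderiv ℝ (rep φ) y) y :=
  (contDiffAt_rep hφs y).hasStrictFDerivAt (by simp)

/-- Pull-backs along `φ` read through the representative. -/
theorem pullbackBilin_rep {φ : U → E3} (hφs : ContMDiff 𝓘(ℝ, E3) (𝓡 3) ∞ φ)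
    (b : Π x : E3, TangentSpace (𝓡 3) x →L[ℝ] TangentSpace (𝓡 3) x →L[ℝ] ℝ) (y : U) (v w : E3) :
    pullbackBilin (I := 𝓡 3) (I' := 𝓘(ℝ, E3)) φ b y v w = b (φ y) (fderiv ℝ (rep φ) y v) (fderiv ℝ (rep φ) y w) := by
  rw [pullbackBilin_apply, mfderiv_eq_fderiv_rep hφs y]
  rfl

/-- If the pull-back of some bilinear family dominates `‖v‖²`, the differential of the representative is injective. -/
theorem injective_fderiv_rep {φ : U → E3} (hφs : ContMDiff 𝓘(ℝ, E3) (𝓡 3) ∞ φ)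
    (b : Π x : E3, TangentSpace (𝓡 3) x →L[ℝ] TangentSpace (𝓡 3) x →L[ℝ] ℝ) (y : U)
    (hdom : ∀ v : E3, ‖v‖ ^ 2 ≤ pullbackBilin (I := 𝓡 3) (I' := 𝓘(ℝ, E3)) φ b y v v) :
    Injective (fderiv ℝ (rep φ) y) := by
  refine (injective_iff_map_eq_zero (fderiv ℝ (rep φ) y)).2 fun v hv ↦ ?_
  have h := hdom v
  have h0 : pullbackBilin (I := 𝓡 3) (I' := 𝓘(ℝ, E3)) φ b y v v = 0 := by
    rw [pullbackBilin_rep hφs b y, hv]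
    exact (b (φ y)).map_zero₂ _
  rw [h0] at h
  have : ‖v‖ ^ 2 = 0 := le_antisymm h (sq_nonneg _)
  exact norm_eq_zero.1 (pow_eq_zero_iff (n := 2) two_ne_zero |>.1 this)

/-- The differential of the representative as a continuous linear equivalence. -/
def fderivEquiv {φ : U → E3} (hφs : ContMDiff 𝓘(ℝ, E3) (𝓡 3) ∞ φ)
    (b : Π x : E3, TangentSpace (𝓡 3) x →L[ℝ] TangentSpace (𝓡 3) x →L[ℝ] ℝ) (y : U)
    (hdom : ∀ v : E3, ‖v‖ ^ 2 ≤ pullbackBilin (I := 𝓡 3) (I' := 𝓘(ℝ, E3)) φ b y v v) : E3 ≃L[ℝ] E3 :=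
  (LinearMap.linearEquivOfInjective (fderiv ℝ (rep φ) y : E3 →ₗ[ℝ] E3) (injective_fderiv_rep hφs b y hdom)
    rfl).toContinuousLinearEquiv

/-- Auxiliary step of the chart-free unbent-shield lemma (§13.4). [folklore] -/
theorem fderivEquiv_coe {φ : U → E3} (hφs : ContMDiff 𝓘(ℝ, E3) (𝓡 3) ∞ φ)
    (b : Π x : E3, TangentSpace (𝓡 3) x →L[ℝ] TangentSpace (𝓡 3) x →L[ℝ] ℝ) (y : U)
    (hdom : ∀ v : E3, ‖v‖ ^ 2 ≤ pullbackBilin (I := 𝓡 3) (I' := 𝓘(ℝ, E3)) φ b y v v) :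
    (fderivEquiv hφs b y hdom : E3 →L[ℝ] E3) = fderiv ℝ (rep φ) y := by
  ext v
  rfl

/-! ### The inverse on the range -/

variable [Nonempty U]

/-- The inverse of the open embedding `φ`, as a total map `E3 → E3` (junk off the range). -/
def inv (φ : U → E3) (hφ' : IsOpenEmbedding φ) (p : E3) : E3 := ((hφ'.toOpenPartialHomeomorph φ).symm p : U)

/-- Auxiliary step of the chart-free unbent-shield lemma (§13.4). [folklore] -/
theorem inv_apply (φ : U → E3) (hφ' : IsOpenEmbedding φ) (y : U) : inv φ hφ' (φ y) = y := by
  simp only [inv]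
  rw [hφ'.toOpenPartialHomeomorph_left_inv]

/-- Auxiliary step of the chart-free unbent-shield lemma (§13.4). [folklore] -/
theorem rep_inv {φ : U → E3} (hφ' : IsOpenEmbedding φ) {p : E3} (hp : p ∈ range φ) :
    rep φ (inv φ hφ' p) = p := by
  obtain ⟨y, rfl⟩ := hp
  rw [inv_apply, ← rep_eq]

/-- Auxiliary step of the chart-free unbent-shield lemma (§13.4). [folklore] -/
theorem inv_mem (φ : U → E3) (hφ' : IsOpenEmbedding φ) (p : E3) : inv φ hφ' p ∈ U :=
  ((hφ'.toOpenPartialHomeomorph φ).symm p).2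

/-- Auxiliary step of the chart-free unbent-shield lemma (§13.4). [folklore] -/
theorem continuousAt_inv {φ : U → E3} (hφ' : IsOpenEmbedding φ) {p : E3} (hp : p ∈ range φ) :
    ContinuousAt (inv φ hφ') p := by
  have htarget : p ∈ (hφ'.toOpenPartialHomeomorph φ).target := by
    rwa [hφ'.toOpenPartialHomeomorph_target]
  exact continuous_subtype_val.continuousAt.comp ((hφ'.toOpenPartialHomeomorph φ).continuousAt_symm htarget)

/-- **The inverse is differentiable on the range, with the inverse differential.** -/
theorem hasFDerivAt_inv {φ : U → E3} (hφ' : IsOpenEmbedding φ) (hφs : ContMDiff 𝓘(ℝ, E3) (𝓡 3) ∞ φ)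
    (b : Π x : E3, TangentSpace (𝓡 3) x →L[ℝ] TangentSpace (𝓡 3) x →L[ℝ] ℝ)
    (hdom : ∀ (y : U) (v : E3), ‖v‖ ^ 2 ≤ pullbackBilin (I := 𝓡 3) (I' := 𝓘(ℝ, E3)) φ b y v v)
    {p : E3} (hp : p ∈ range φ) :
    HasFDerivAt (inv φ hφ')
      ((fderivEquiv hφs b ⟨inv φ hφ' p, inv_mem φ hφ' p⟩ (hdom _)).symm : E3 →L[ℝ] E3) p := by
  refine HasFDerivAt.of_local_left_inverse (f := rep φ) (continuousAt_inv hφ' hp) ?_ ?_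
  · rw [fderivEquiv_coe]
    exact (hasStrictFDerivAt_rep hφs ⟨inv φ hφ' p, inv_mem φ hφ' p⟩).hasFDerivAt
  · filter_upwards [hφ'.isOpen_range.mem_nhds hp] with q hq
    exact rep_inv hφ' hq




variable (e : AFEnd E3) (D : InitialDataSet (𝓡 3) E3)

/-- Auxiliary step of the chart-free unbent-shield lemma (§13.4). [folklore] -/
theorem contDiffAt_dataChartTotal {x : E3} (hx : e.R < ‖x‖) : ContDiffAt ℝ ∞ e.dataChartTotal x :=
  contMDiffAt_iff_contDiffAt.1 (e.contMDiffAt_dataChartTotal hx)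

/-- Auxiliary step of the chart-free unbent-shield lemma (§13.4). [folklore] -/
theorem contDiffAt_chartExt {p : E3} (hp : p ∈ e.U) : ContDiffAt ℝ ∞ e.chartExt p :=
  contMDiffAt_iff_contDiffAt.1 (e.contMDiffAt_chartExt hp)

/-- Auxiliary step of the chart-free unbent-shield lemma (§13.4). [folklore] -/
theorem mfderiv_dataChartTotal_eq (x : E3) :
    mfderiv 𝓘(ℝ, E3) (𝓡 3) e.dataChartTotal x = fderiv ℝ e.dataChartTotal x :=
  mfderiv_eq_fderiv

/-- `hCoeff` through the Fréchet derivative of the extended inverse chart (`X = E3`). -/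
theorem hCoeff_eq_fderiv {x : E3} (hx : e.R < ‖x‖) (v w : E3) :
    hCoeff e D x v w =
      D.h.inner (e.dataChartTotal x) (fderiv ℝ e.dataChartTotal x v) (fderiv ℝ e.dataChartTotal x w) := by
  rw [hCoeff_eq_inner_dataChartTotal D hx, mfderiv_dataChartTotal_eq e x]
  rfl

/-- `kCoeff` through the Fréchet derivative of the extended inverse chart (`X = E3`). -/
theorem kCoeff_eq_fderiv {x : E3} (hx : e.R < ‖x‖) (v w : E3) :
    kCoeff e D x v w =
      D.k (e.dataChartTotal x) (fderiv ℝ e.dataChartTotal x v) (fderiv ℝ e.dataChartTotal x w) := by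
  rw [kCoeff_of_lt D hx]
  change D.k (e.dataChart ⟨x, hx⟩) (mfderiv (𝓡 3) (𝓡 3) e.dataChart ⟨x, hx⟩ v)
    (mfderiv (𝓡 3) (𝓡 3) e.dataChart ⟨x, hx⟩ w) = _
  rw [mfderiv_dataChart_eq_total, mfderiv_dataChart_eq_total, mfderiv_dataChartTotal_eq e x]
  have hpt : e.dataChart ⟨x, hx⟩ = e.dataChartTotal x := dataChart_eq_dataChartTotal ⟨x, hx⟩
  rw [hpt]
  rfl

/-- The differentials of the chart and of the inverse chart are mutually inverse (at `p ∈ U`, `x = chartExt p`). -/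
theorem fderiv_dataChartTotal_comp_chartExt {p : E3} (hp : p ∈ e.U) (v : E3) :
    fderiv ℝ e.dataChartTotal (e.chartExt p) (fderiv ℝ e.chartExt p v) = v := by
  have hx : e.R < ‖e.chartExt p‖ := lt_norm_chartExt hp
  have h1 : HasFDerivAt e.chartExt (fderiv ℝ e.chartExt p) p :=
    ((contDiffAt_chartExt e hp).differentiableAt (by simp)).hasFDerivAt
  have h2 : HasFDerivAt e.dataChartTotal (fderiv ℝ e.dataChartTotal (e.chartExt p)) (e.chartExt p) :=
    ((contDiffAt_dataChartTotal e hx).differentiableAt (by simp)).hasFDerivAt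
  have hcomp := h2.comp p h1
  -- `dataChartTotal ∘ chartExt = id` near `p` (on the open end `U`)
  have hev : (e.dataChartTotal ∘ e.chartExt) =ᶠ[𝓝 p] id := by
    filter_upwards [e.U.isOpen.mem_nhds hp] with q hq
    exact dataChartTotal_chartExt hq
  have hid : HasFDerivAt (e.dataChartTotal ∘ e.chartExt) (ContinuousLinearMap.id ℝ E3) p :=
    (hasFDerivAt_id p).congr_of_eventuallyEq hev
  have := hcomp.unique hid
  exact congrArg (fun L : E3 →L[ℝ] E3 ↦ L v) this

variable {X : Type*} [TopologicalSpace X] [ChartedSpace E3 X] [IsManifold (𝓡 3) ∞ X]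

/-! ### DR bounds with the natural power and the metric upper bound -/

/-- DR bounds at order zero, quantified with a radius: beyond some `n₁`, `h_x(v,v) ≤ 2‖v‖²` and
`|k_x(v,v)| ≤ (ε/‖x‖²) h_x(v,v)` for all `v`. -/
theorem exists_radius_DR_bounds (e' : AFEnd X) (D' : InitialDataSet (𝓡 3) X) {M' : ℝ}
    (hDR : e'.IsStronglyAsymptoticallyFlatDR D' M') {ε : ℝ} (hε : 0 < ε) :
    ∃ n₁ : ℝ, ∀ x : E3, n₁ ≤ ‖x‖ → ∀ v : E3,
      AFEnd.hCoeff e' D' x v v ≤ 2 * ‖v‖ ^ 2 ∧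
        |AFEnd.kCoeff e' D' x v v| ≤ ε / ‖x‖ ^ 2 * AFEnd.hCoeff e' D' x v v := by
  have hh := hDR.1 0 (Nat.zero_le _)
  simp only [CharP.cast_eq_zero, sub_zero, norm_iteratedFDeriv_zero] at hh
  have hh0 : Tendsto (fun x : E3 ↦ ‖AFEnd.hCoeff e' D' x - (1 + 2 * M' / ‖x‖) • (innerSL ℝ : E3 →L[ℝ] E3 →L[ℝ] ℝ)‖)
      (cobounded E3) (𝓝 0) := by
    have h1 : Tendsto (fun x : E3 ↦ ‖x‖ ^ (-(1:ℝ))) (cobounded E3) (𝓝 0) :=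
      (tendsto_rpow_neg_atTop (by norm_num : (0:ℝ) < 1)).comp (tendsto_norm_cobounded_atTop (E := E3))
    have h2 := hh.trans_tendsto h1
    simpa using h2
  have hM0 : Tendsto (fun x : E3 ↦ 2 * M' / ‖x‖) (cobounded E3) (𝓝 0) := by
    have := (tendsto_norm_cobounded_atTop (E := E3)).inv_tendsto_atTop.const_mul (2 * M')
    simpa [div_eq_mul_inv] using this
  have hA : ∀ᶠ x in cobounded E3,
      ‖AFEnd.hCoeff e' D' x - (1 + 2 * M' / ‖x‖) • (innerSL ℝ : E3 →L[ℝ] E3 →L[ℝ] ℝ)‖ ≤ 1 / 4 := by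
    have := hh0.eventually (gt_mem_nhds (by norm_num : (0:ℝ) < 1 / 4))
    exact this.mono fun x hx ↦ by simpa using hx.le
  have hB : ∀ᶠ x in cobounded E3, |2 * M' / ‖x‖| ≤ 1 / 4 := by
    have := hM0.abs.eventually (gt_mem_nhds (by simp : |(0:ℝ)| < 1 / 4))
    exact this.mono fun x hx ↦ le_of_lt hx
  have hK := eventually_abs_kCoeff_le e' D' hDR hε
  have hpos : ∀ᶠ x in cobounded E3, (1:ℝ) ≤ ‖x‖ := eventually_cobounded_le_norm 1
  obtain ⟨n₁, -, hn₁⟩ := (Filter.hasBasis_cobounded_norm.eventually_iff).1 (hA.and (hB.and (hK.and hpos)))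
  refine ⟨n₁, fun x hx v ↦ ?_⟩
  obtain ⟨hxA, hxB, hxK, hx1⟩ := hn₁ hx
  set B := AFEnd.hCoeff e' D' x - (1 + 2 * M' / ‖x‖) • (innerSL ℝ : E3 →L[ℝ] E3 →L[ℝ] ℝ) with hBdef
  have hBv : |B v v| ≤ 1 / 4 * ‖v‖ ^ 2 := by
    calc |B v v| = ‖B v v‖ := (Real.norm_eq_abs _).symm
      _ ≤ ‖B‖ * ‖v‖ * ‖v‖ := B.le_opNorm₂ v v
      _ ≤ 1 / 4 * ‖v‖ * ‖v‖ := by gcongr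
      _ = 1 / 4 * ‖v‖ ^ 2 := by ring
  have hI : (innerSL ℝ : E3 →L[ℝ] E3 →L[ℝ] ℝ) v v = ‖v‖ ^ 2 := by
    rw [← real_inner_self_eq_norm_sq v]; rfl
  have hhv : AFEnd.hCoeff e' D' x v v = B v v + (1 + 2 * M' / ‖x‖) * ‖v‖ ^ 2 := by
    rw [hBdef, sub_apply, sub_apply, smul_apply, smul_apply, hI, smul_eq_mul]
    ring
  refine ⟨?_, ?_⟩
  · rw [hhv]
    have := abs_le.1 hBv
    have := abs_le.1 hxB
    nlinarith [sq_nonneg ‖v‖]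
  · have hrpow : ‖x‖ ^ (-2 : ℝ) = 1 / ‖x‖ ^ 2 := by
      rw [Real.rpow_neg (norm_nonneg x), one_div]
      norm_num
    have := hxK v
    rw [hrpow] at this
    rw [show ε / ‖x‖ ^ 2 = ε * (1 / ‖x‖ ^ 2) by ring]
    exact this

/-! ### The chart-free unbent-shield lemma -/

/-- `h_KS` dominates `δ`: `‖v‖² ≤ hRep M y v v` for `M ≥ 0`. -/
theorem sq_norm_le_hRep {M : ℝ} (hM : 0 ≤ M) (y v : E3) : ‖v‖ ^ 2 ≤ Kerr.hRep M y v v := by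
  rw [Kerr.hRep_apply, real_inner_self_eq_norm_sq]
  have : 0 ≤ 2 * M / ‖y‖ ^ 3 * (⟪y, v⟫_ℝ * ⟪y, v⟫_ℝ) :=
    mul_nonneg (by positivity) (mul_self_nonneg _)
  linarith

/-- Division-free form of Lemma A′: `M · h_y(y,y) ≤ ‖y‖² √(1 + 2M/‖y‖) · k_y(y,y)` for `y ≠ 0`. -/
theorem mul_hRep_le {M : ℝ} (hM : 0 < M) {y : E3} (hy : y ≠ 0) :
    M * Kerr.hRep M y y y ≤ ‖y‖ ^ 2 * √(1 + 2 * M / ‖y‖) * Kerr.kRep M y y y := by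
  have hn : 0 < ‖y‖ := norm_pos_iff.2 hy
  rw [kRep_self M hy, hRep_self M hy]
  set r := ‖y‖ with hr
  have hu : 0 < 1 + 2 * M / r := by positivity
  set S := √(1 + 2 * M / r) with hSdef
  have hS : 0 < S := Real.sqrt_pos.2 hu
  have hS2 : S ^ 2 = 1 + 2 * M / r := Real.sq_sqrt hu.le
  have hr0 : r ≠ 0 := hn.ne'
  have hL : M * (r ^ 2 * (1 + 2 * M / r)) = M * r ^ 2 + 2 * M ^ 2 * r := by field_simp
  have hR : r ^ 2 * S * (2 * M * (1 + M / r) / S) = 2 * M * r ^ 2 + 2 * M ^ 2 * r := by field_simp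
  rw [hL, hR]
  nlinarith [sq_nonneg r]

/-- `r² √(1 + 2M/r) ≤ (r + 2M)²` for `r > 0`, `M ≥ 0`. -/
theorem sq_mul_sqrt_le {M r : ℝ} (hM : 0 ≤ M) (hr : 0 < r) : r ^ 2 * √(1 + 2 * M / r) ≤ (r + 2 * M) ^ 2 := by
  have hu : 0 ≤ 1 + 2 * M / r := by positivity
  have hS := Real.sqrt_nonneg (1 + 2 * M / r)
  have hS2 : √(1 + 2 * M / r) ^ 2 = 1 + 2 * M / r := Real.sq_sqrt hu
  -- square both sides
  have hlhs : 0 ≤ r ^ 2 * √(1 + 2 * M / r) := by positivity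
  have hrhs : 0 ≤ (r + 2 * M) ^ 2 := by positivity
  rw [← abs_of_nonneg hlhs, ← abs_of_nonneg hrhs, ← sq_le_sq]
  have hr0 : r ≠ 0 := hr.ne'
  have : (r ^ 2 * √(1 + 2 * M / r)) ^ 2 = r ^ 3 * (r + 2 * M) := by
    rw [mul_pow, hS2]; field_simp
  rw [this]
  have h1 : r ≤ r + 2 * M := by linarith
  have h3 : r ^ 3 ≤ (r + 2 * M) ^ 3 := by gcongr
  nlinarith [h3, pow_pos (by linarith : 0 < r + 2 * M) 3]

/-- Points of the inverse chart beyond radius `R'` lie in `far R'`. -/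
theorem dataChartTotal_mem_far (e' : AFEnd E3) {R' : ℝ} {x : E3} (hx : e'.R < ‖x‖) (hR' : R' < ‖x‖) :
    e'.dataChartTotal x ∈ e'.far R' := by
  rw [dataChartTotal_of_lt hx]
  exact (e'.dataChart_mem_far_iff).2 hR'

/-- **The chart-free unbent-shield lemma (`a = 0`).** No admissible vacuum datum on `E3` carries, through a smooth
open embedding `φ` of the Kerr–Schild slice with compact complement, the UNBENT Schwarzschild slice data
`(h_KS, k_KS) = ((Kerr.data M 0 r₁).h, (Kerr.data M 0 r₁).k)` — whatever the end chart of admissibility. -/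
theorem unbentShield_not_admissible_zero_spin [Kerr.Facts] [Kerr.SliceFacts] {M : ℝ} (hM : 0 < M) {r₁ : ℝ}
    (D : InitialDataSet (𝓡 3) E3) (φ : Kerr.slice 0 r₁ → E3)
    (hφc : IsCompact (Set.range φ)ᶜ) (hφ' : IsOpenEmbedding φ)
    (hφs : ContMDiff 𝓘(ℝ, E3) (𝓡 3) ∞ φ)
    (hh : ∀ y : Kerr.slice 0 r₁, pullbackBilin (I := 𝓡 3) (I' := 𝓘(ℝ, E3)) φ D.h.inner y =
      (Kerr.data M 0 r₁ hM.le).h.inner y)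
    (hk : ∀ y : Kerr.slice 0 r₁, pullbackBilin (I := 𝓡 3) (I' := 𝓘(ℝ, E3)) φ D.k y =
      (Kerr.data M 0 r₁ hM.le).k y) :
    D ∉ admissibleVacuumData E3 := by
  intro hadm
  obtain ⟨-, e, M', hsole, hDR⟩ := mem_admissibleVacuumData_iff.mp hadm
  -- a point of the slice (nonemptiness, for the inverse)
  haveI : Nonempty (Kerr.slice 0 r₁) := by
    refine ⟨⟨EuclideanSpace.single (0 : Fin 3) (max r₁ 0 + 1), ?_⟩⟩
    rw [Kerr.mem_slice_zero_iff, PiLp.norm_single, Real.norm_eq_abs, abs_of_pos (by positivity)]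
    linarith [le_max_right r₁ 0]
  -- pull-backs in closed form, and domination of `δ`
  have hh' : ∀ (y : Kerr.slice 0 r₁) (v w : E3), pullbackBilin (I := 𝓡 3) (I' := 𝓘(ℝ, E3)) φ D.h.inner y v w =
      Kerr.hRep M y v w := fun y v w ↦ by
    rw [hh y]; exact Kerr.data_h_inner_zero_apply M hM.le y v w
  have hk' : ∀ (y : Kerr.slice 0 r₁) (v w : E3), pullbackBilin (I := 𝓡 3) (I' := 𝓘(ℝ, E3)) φ D.k y v w =
      Kerr.kRep M y v w := fun y v w ↦ by
    rw [hk y]; exact Kerr.data_k_zero_apply M hM.le y v w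
  have hdom : ∀ (y : Kerr.slice 0 r₁) (v : E3), ‖v‖ ^ 2 ≤ pullbackBilin (I := 𝓡 3) (I' := 𝓘(ℝ, E3)) φ D.h.inner y v v :=
    fun y v ↦ by rw [hh' y v v]; exact sq_norm_le_hRep hM.le _ _
  -- DR bounds beyond `n₁` with `ε = M/8`
  obtain ⟨n₁, hn₁⟩ := exists_radius_DR_bounds e D hDR (by positivity : 0 < M / 8)
  -- far out, the end lies inside the image of the shield
  obtain ⟨R', hR'R, hR'⟩ := exists_far_inter_eq_empty e hφc
  have hfar : ∀ p, p ∈ e.far R' → p ∈ Set.range φ := fun p hp ↦ by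
    by_contra hnp
    have : p ∈ e.far R' ∩ (Set.range φ)ᶜ := ⟨hp, hnp⟩
    rw [hR'] at this
    exact this
  -- the ray and the curve
  set n₀ : ℝ := max (max n₁ R') (max e.R 1) + 1 with hn₀
  have hn₀R : e.R < n₀ := by
    have := le_max_left e.R 1; have := le_max_right (max n₁ R') (max e.R 1); linarith
  have hn₀R' : R' < n₀ := by
    have := le_max_right n₁ R'; have := le_max_left (max n₁ R') (max e.R 1); linarith
  have hn₀1 : n₁ ≤ n₀ := by
    have := le_max_left n₁ R'; have := le_max_left (max n₁ R') (max e.R 1); linarith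
  have hn₀pos : 0 < n₀ := by
    have := le_max_right e.R 1; have := le_max_right (max n₁ R') (max e.R 1); linarith
  set u : E3 := EuclideanSpace.single (0 : Fin 3) (1 : ℝ) with hu
  have hu1 : ‖u‖ = 1 := by rw [hu, PiLp.norm_single]; simp
  have hxt : ∀ t : ℝ, 0 ≤ t → ‖t • u‖ = t := fun t ht ↦ by
    rw [norm_smul, hu1, mul_one, Real.norm_of_nonneg ht]
  -- points of the ray beyond `n₀`
  have hray : ∀ t : ℝ, n₀ ≤ t → e.R < ‖t • u‖ ∧ n₁ ≤ ‖t • u‖ ∧ e.dataChartTotal (t • u) ∈ Set.range φ := by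
    intro t ht
    have ht0 : 0 ≤ t := le_trans hn₀pos.le ht
    rw [hxt t ht0]
    refine ⟨by linarith, by linarith, hfar _ (dataChartTotal_mem_far e (by rw [hxt t ht0]; linarith) ?_)⟩
    rw [hxt t ht0]; linarith
  set γ : ℝ → E3 := fun t ↦ inv φ hφ' (e.dataChartTotal (t • u)) with hγ
  have hγmem : ∀ t, γ t ∈ Kerr.slice 0 r₁ := fun t ↦ inv_mem φ hφ' _
  have hγφ : ∀ t, n₀ ≤ t → rep φ (γ t) = e.dataChartTotal (t • u) := fun t ht ↦ rep_inv hφ' (hray t ht).2.2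
  -- derivative of the curve and its speed
  have hderiv : ∀ t, n₀ ≤ t → ∃ γ' : E3, HasDerivAt γ γ' t ∧ ‖γ'‖ ^ 2 ≤ 2 := by
    intro t ht
    obtain ⟨hxR, hx1, hxr⟩ := hray t ht
    set x : E3 := t • u with hxdef
    set p : E3 := e.dataChartTotal x with hpdef
    set yS : Kerr.slice 0 r₁ := ⟨inv φ hφ' p, inv_mem φ hφ' p⟩ with hyS
    set L : E3 ≃L[ℝ] E3 := fderivEquiv hφs D.h.inner yS (hdom yS) with hL
    have hinv : HasFDerivAt (inv φ hφ') (L.symm : E3 →L[ℝ] E3) p := hasFDerivAt_inv hφ' hφs D.h.inner hdom hxr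
    have hdct : HasFDerivAt e.dataChartTotal (fderiv ℝ e.dataChartTotal x) x :=
      ((contDiffAt_dataChartTotal e hxR).differentiableAt (by simp)).hasFDerivAt
    have hlin : HasDerivAt (fun s : ℝ ↦ s • u) u t := by
      simpa using (hasDerivAt_id t).smul_const u
    have hcomp : HasDerivAt γ ((L.symm : E3 →L[ℝ] E3) (fderiv ℝ e.dataChartTotal x u)) t := by
      have := (hinv.comp_hasDerivAt t (hdct.comp_hasDerivAt t hlin))
      exact this
    refine ⟨_, hcomp, ?_⟩
    -- speed: ‖γ'‖² ≤ h_KS(γ', γ') = h(p)(w, w) = hCoeff x u u ≤ 2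
    set w : E3 := fderiv ℝ e.dataChartTotal x u with hw
    have hLw : fderiv ℝ (rep φ) yS ((L.symm : E3 →L[ℝ] E3) w) = w := by
      have : (L : E3 →L[ℝ] E3) ((L.symm : E3 →L[ℝ] E3) w) = w := L.apply_symm_apply w
      rwa [fderivEquiv_coe] at this
    have h1 := hdom yS ((L.symm : E3 →L[ℝ] E3) w)
    rw [pullbackBilin_rep hφs D.h.inner yS, hLw] at h1
    have hφy : φ yS = p := by rw [rep_eq φ yS]; exact rep_inv hφ' hxr
    rw [hφy] at h1
    have h2 : D.h.inner p w w = AFEnd.hCoeff e D x u u := by rw [hCoeff_eq_fderiv e D hxR]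
    have h3 := (hn₁ x hx1 u).1
    rw [hu1] at h3
    calc ‖(L.symm : E3 →L[ℝ] E3) w‖ ^ 2 ≤ D.h.inner p w w := h1
      _ = AFEnd.hCoeff e D x u u := h2
      _ ≤ 2 * 1 ^ 2 := h3
      _ = 2 := by norm_num
  -- growth of the curve: ‖γ t‖ ≤ ‖γ n₀‖ + √2 (t − n₀)
  have hgrowth : ∀ t, n₀ ≤ t → ‖γ t - γ n₀‖ ≤ Real.sqrt 2 * (t - n₀) := by
    intro t ht
    choose! γ' hγ' using hderiv
    have hf : ∀ s ∈ Set.Icc n₀ t, HasDerivWithinAt γ (γ' s) (Set.Icc n₀ t) s :=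
      fun s hs ↦ (hγ' s hs.1).1.hasDerivWithinAt
    have hbound : ∀ s ∈ Set.Ico n₀ t, ‖γ' s‖ ≤ Real.sqrt 2 := fun s hs ↦ by
      have := (hγ' s hs.1).2
      rw [← Real.sqrt_le_sqrt_iff (by norm_num : (0:ℝ) ≤ 2)] at this
      rwa [Real.sqrt_sq (norm_nonneg _)] at this
    exact norm_image_sub_le_of_norm_deriv_le_segment' hf hbound t ⟨ht, le_rfl⟩
  -- choose the parameter
  set c₁ : ℝ := ‖γ n₀‖ + Real.sqrt 2 * n₀ + 2 * M with hc₁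
  set t : ℝ := max n₀ (c₁ + 1) with htdef
  have htn₀ : n₀ ≤ t := le_max_left _ _
  have htc : c₁ < t := by have := le_max_right n₀ (c₁ + 1); linarith
  have ht0 : 0 < t := lt_of_lt_of_le hn₀pos htn₀
  obtain ⟨hxR, hx1, hxr⟩ := hray t htn₀
  set x : E3 := t • u with hxdef
  set p : E3 := e.dataChartTotal x with hpdef
  set yS : Kerr.slice 0 r₁ := ⟨γ t, hγmem t⟩ with hyS
  have hyv : (yS : E3) = γ t := rfl
  have hy0 : (yS : E3) ≠ 0 := Kerr.ne_zero_of_mem_slice_zero yS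
  -- the identification of the two readings of `k/h` on the vector `y⃗ = γ t`
  set L : E3 ≃L[ℝ] E3 := fderivEquiv hφs D.h.inner yS (hdom yS) with hL
  have hφy : φ yS = p := by
    rw [rep_eq φ yS, hyv]
    exact hγφ t htn₀
  have hpU : p ∈ (e.U : Set E3) := by rw [hpdef]; exact dataChartTotal_mem x
  have hxp : e.chartExt p = x := chartExt_dataChartTotal hxR
  set w' : E3 := fderiv ℝ e.chartExt p ((L : E3 →L[ℝ] E3) (γ t)) with hw'
  have hDw' : fderiv ℝ e.dataChartTotal x w' = (L : E3 →L[ℝ] E3) (γ t) := by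
    rw [hw', ← hxp]
    exact fderiv_dataChartTotal_comp_chartExt e hpU _
  have hK : AFEnd.kCoeff e D x w' w' = Kerr.kRep M (γ t) (γ t) (γ t) := by
    rw [kCoeff_eq_fderiv e D hxR, hDw', ← hk' yS, pullbackBilin_rep hφs D.k yS, hφy, fderivEquiv_coe]
  have hH : AFEnd.hCoeff e D x w' w' = Kerr.hRep M (γ t) (γ t) (γ t) := by
    rw [hCoeff_eq_fderiv e D hxR, hDw', ← hh' yS, pullbackBilin_rep hφs D.h.inner yS, hφy, fderivEquiv_coe]
  -- Lemma B at x (‖x‖ = t ≥ n₁)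
  have hB := (hn₁ x hx1 w').2
  rw [hK, hH, hxdef, hxt t ht0.le] at hB
  -- Lemma A′ (division-free) at γ t
  have hA := mul_hRep_le hM hy0
  rw [hyv] at hA
  -- h > 0
  have hHpos : 0 < Kerr.hRep M (γ t) (γ t) (γ t) := by
    have := sq_norm_le_hRep hM.le (γ t) (γ t)
    have : 0 < ‖γ t‖ ^ 2 := by rw [← hyv]; positivity
    linarith
  -- combine: M h ≤ r² S k ≤ r² S (M/8)/t² h  ⇒  8 t² ≤ r² S ≤ (r + 2M)²
  set r : ℝ := ‖γ t‖ with hrdef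
  have hr0 : 0 < r := by rw [hrdef, ← hyv]; exact norm_pos_iff.2 hy0
  set S : ℝ := √(1 + 2 * M / r) with hSdef
  have hS0 : 0 ≤ r ^ 2 * S := by positivity
  have hkabs : Kerr.kRep M (γ t) (γ t) (γ t) ≤ M / 8 / t ^ 2 * Kerr.hRep M (γ t) (γ t) (γ t) :=
    le_trans (le_abs_self _) hB
  have hchain : M * Kerr.hRep M (γ t) (γ t) (γ t) ≤ r ^ 2 * S * (M / 8 / t ^ 2) * Kerr.hRep M (γ t) (γ t) (γ t) := by
    calc M * Kerr.hRep M (γ t) (γ t) (γ t) ≤ r ^ 2 * S * Kerr.kRep M (γ t) (γ t) (γ t) := hA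
      _ ≤ r ^ 2 * S * (M / 8 / t ^ 2 * Kerr.hRep M (γ t) (γ t) (γ t)) :=
          mul_le_mul_of_nonneg_left hkabs hS0
      _ = r ^ 2 * S * (M / 8 / t ^ 2) * Kerr.hRep M (γ t) (γ t) (γ t) := by ring
  have h8 : 8 * t ^ 2 ≤ r ^ 2 * S := by
    have := le_of_mul_le_mul_right hchain hHpos
    rw [div_div, ← mul_div_assoc, le_div_iff₀ (by positivity : (0:ℝ) < 8 * t ^ 2)] at this
    have h'' : M * (8 * t ^ 2) ≤ M * (r ^ 2 * S) := by
      calc M * (8 * t ^ 2) ≤ r ^ 2 * S * M := this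
        _ = M * (r ^ 2 * S) := by ring
    exact le_of_mul_le_mul_left h'' hM
  have hrS : r ^ 2 * S ≤ (r + 2 * M) ^ 2 := sq_mul_sqrt_le hM.le hr0
  -- r ≤ ‖γ n₀‖ + √2 (t − n₀) ≤ c₁ − 2M − √2 n₀ + √2 t + ... : r + 2M ≤ √2 t + c₁' with c₁' = ‖γ n₀‖ + 2M
  have hrle : r ≤ ‖γ n₀‖ + Real.sqrt 2 * (t - n₀) := by
    calc r = ‖γ t‖ := rfl
      _ = ‖(γ t - γ n₀) + γ n₀‖ := by rw [sub_add_cancel]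
      _ ≤ ‖γ t - γ n₀‖ + ‖γ n₀‖ := norm_add_le _ _
      _ ≤ Real.sqrt 2 * (t - n₀) + ‖γ n₀‖ := by linarith [hgrowth t htn₀]
      _ = ‖γ n₀‖ + Real.sqrt 2 * (t - n₀) := by ring
  have hs2 : Real.sqrt 2 ^ 2 = 2 := Real.sq_sqrt (by norm_num)
  have hs2pos : 0 < Real.sqrt 2 := Real.sqrt_pos.2 (by norm_num)
  -- 8 t² ≤ (r + 2M)² ≤ (√2 t + c₁ − √2 n₀)² ≤ (√2 t + c₁)²; take square roots: 2√2 t ≤ √2 t + c₁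
  have hbig : 8 * t ^ 2 ≤ (Real.sqrt 2 * t + c₁) ^ 2 := by
    have h1 : r + 2 * M ≤ Real.sqrt 2 * t + c₁ := by
      have h0 : 0 ≤ Real.sqrt 2 * n₀ := by positivity
      have e1 : Real.sqrt 2 * (t - n₀) = Real.sqrt 2 * t - Real.sqrt 2 * n₀ := by ring
      rw [hc₁]; linarith [hrle, e1, h0]
    have h2 : 0 ≤ r + 2 * M := by positivity
    calc 8 * t ^ 2 ≤ r ^ 2 * S := h8
      _ ≤ (r + 2 * M) ^ 2 := hrS
      _ ≤ (Real.sqrt 2 * t + c₁) ^ 2 := by gcongr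
  -- (2√2 t)² = 8t² ≤ (√2 t + c₁)² with both bases ≥ 0 ⇒ 2√2 t ≤ √2 t + c₁ ⇒ √2 t ≤ c₁ < t ≤ √2 t: contradiction
  have hc₁pos : 0 ≤ c₁ := by rw [hc₁]; positivity
  have hbase : 2 * Real.sqrt 2 * t ≤ Real.sqrt 2 * t + c₁ := by
    have hl : 0 ≤ 2 * Real.sqrt 2 * t := by positivity
    have hr' : 0 ≤ Real.sqrt 2 * t + c₁ := by positivity
    have : (2 * Real.sqrt 2 * t) ^ 2 ≤ (Real.sqrt 2 * t + c₁) ^ 2 := by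
      calc (2 * Real.sqrt 2 * t) ^ 2 = 8 * t ^ 2 := by rw [mul_pow, mul_pow, hs2]; ring
        _ ≤ (Real.sqrt 2 * t + c₁) ^ 2 := hbig
    have hsq := Real.sqrt_le_sqrt this
    rwa [Real.sqrt_sq hl, Real.sqrt_sq hr'] at hsq
  have hfin : Real.sqrt 2 * t ≤ c₁ := by linarith
  have h1lt : (1:ℝ) < Real.sqrt 2 := by
    rw [show (1:ℝ) = Real.sqrt 1 by simp]
    exact Real.sqrt_lt_sqrt (by norm_num) (by norm_num)
  have : t < Real.sqrt 2 * t := lt_mul_of_one_lt_left ht0 h1lt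
  linarith

/-- **The crux with the bend removed is FALSE (`a = 0`).** The body of `KerrShieldedDataExist` with `T := 0` (so the pinned
immersion is the Kerr–Schild slice `y ↦ (0, y)` itself) and `a := 0` has no witness: bending the shielding slice is
load-bearing. (The window conjuncts `|a| < M`, `r₋ < r₁ < r₊` and the spacelike clause are dropped — the statement
refuted here is weaker than the crux-with-`T = 0`, hence the refutation stronger.) -/
theorem not_unbentShieldedDataExist_zero_spin [Kerr.Facts] [Kerr.SliceFacts] :
    ¬ ∃ D ∈ admissibleVacuumData E3, ∃ (M r₁ : ℝ) (hM : 0 ≤ M) (φ : Kerr.slice 0 r₁ → E3)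
        (ψ : Kerr.slice 0 r₁ → Kerr.region 0 r₁) (ν : NormalField 𝓘(ℝ, E4) ψ),
        0 < M ∧ IsCompact (Set.range φ)ᶜ ∧ IsOpenEmbedding φ ∧ ContMDiff 𝓘(ℝ, E3) (𝓡 3) ∞ φ ∧
        (∀ y : Kerr.slice 0 r₁, (ψ y : E4) = E4.ofTimeSpace 0 (y : E3)) ∧
        (Kerr.smoothMetric M 0 r₁).IsFutureUnitNormal 𝓘(ℝ, E3)
          ((Kerr.timeOrientation M 0 r₁ hM).ofLE le_top) ψ ν ∧
        (∀ y : Kerr.slice 0 r₁, pullbackBilin (I := 𝓡 3) (I' := 𝓘(ℝ, E3)) φ D.h.inner y =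
          pullbackBilin (I := 𝓘(ℝ, E4)) (I' := 𝓘(ℝ, E3)) ψ (Kerr.smoothMetric M 0 r₁).val y) ∧
        (∀ [(Kerr.smoothMetric M 0 r₁).HasLeviCivita] (y : Kerr.slice 0 r₁),
          (pullbackBilin (I := 𝓡 3) (I' := 𝓘(ℝ, E3)) φ D.k y).toLinearMap₁₂ =
            (Kerr.smoothMetric M 0 r₁).secondFundamentalForm 𝓘(ℝ, E3) ψ ν y) := by
  rintro ⟨D, hadm, M, r₁, hM, φ, ψ, ν, hMpos, hφc, hφ', hφs, hψ, hν, hh, hk⟩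
  have hψeq : ψ = Kerr.sliceEmbed 0 r₁ := funext fun y ↦ Subtype.ext (hψ y)
  subst hψeq
  -- the future unit normal of the slice is unique: `ν = Kerr.sliceNormal M 0 r₁`
  have hνeq : ν = Kerr.sliceNormal M 0 r₁ := by
    funext y
    have hy : (y : E3) ≠ 0 := Kerr.ne_zero_of_mem_slice_zero y
    rw [Kerr.sliceNormal_zero_eq M r₁ y]
    refine Kerr.eq_sliceNormalRep hM hy (fun w ↦ ?_) ?_ ?_
    · have := hν.1.1 y w
      rwa [Kerr.smoothMetric_val, Kerr.mfderiv_sliceEmbed_apply] at this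
    · have := hν.1.2 y
      rwa [Kerr.smoothMetric_val] at this
    · exact (hν.2 y).2
  subst hνeq
  have hh' : ∀ y : Kerr.slice 0 r₁, pullbackBilin (I := 𝓡 3) (I' := 𝓘(ℝ, E3)) φ D.h.inner y =
      (Kerr.data M 0 r₁ hM).h.inner y := fun y ↦ by
    rw [hh y, Kerr.data_h_inner]
    rfl
  have hk' : ∀ y : Kerr.slice 0 r₁, pullbackBilin (I := 𝓡 3) (I' := 𝓘(ℝ, E3)) φ D.k y =
      (Kerr.data M 0 r₁ hM).k y := fun y ↦ by
    ext v w
    have h1 : (pullbackBilin (I := 𝓡 3) (I' := 𝓘(ℝ, E3)) φ D.k y).toLinearMap₁₂ v w =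
        ((Kerr.smoothMetric M 0 r₁).secondFundamentalForm 𝓘(ℝ, E3) (Kerr.sliceEmbed 0 r₁)
          (Kerr.sliceNormal M 0 r₁) y) v w := by rw [hk y]
    change pullbackBilin (I := 𝓡 3) (I' := 𝓘(ℝ, E3)) φ D.k y v w = _ at h1
    rw [h1, Kerr.data_k, Kerr.sliceK_apply]
  exact unbentShield_not_admissible_zero_spin hMpos D φ hφc hφ' hφs hh' hk' hadm

end ChartFree

end Summit.FinalStateConjecture.FinalStateConjecture.Cruxes.KerrShieldedDataExist.Disproof

end
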